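import Mathlib
import Literature.Probability.Moments.HoeffdingDecomposition
import Literature.Computability.Complexity.RandomKSatLowDegreeHardness
import Literature.Computability.Complexity.RandomKSatEnsembleOGP
import Literature.Computability.Complexity.ConstantDepth
import Literature.Computability.Complexity.ACFourierTails
import Literature.Computability.Complexity.DecisionTree
import Literature.Computability.Complexity.FourierTails
import Literature.Combinatorics.BinomialEntropyBound
import Literature.Probability.LatticeModels.BinomialEntropy
import Literature.Computability.Complexity.CookBridges
import Literature.Computability.Complexity.CodeFPStrings
import Literature.Computability.Complexity.HuangSellkeResamplingChain
import Literature.Computability.Complexity.HuangSellkeResamplingChainMoat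
import HarnessLib

/-!
# Huang–Sellke 2025 random `k`-SAT: parameter asymptotics, grand correlation, resample stability, the assembly — `HuangSellke2025KSat{EnsembleOGP,Obstructions,∅}` HOLD (re-homed proofs, file 3 of 3)

**Huang–Sellke 2025: the ensemble overlap-gap property of random `k`-SAT on the resampling chain (Lemma 3.22), the resampling-chain
obstructions (Lemmas 3.22–3.23) and strong low-degree hardness at clause density `α_k = 5·2^k log k / k` (Corollary 3.21)** — the three named
facts `Literature.Computability.Complexity.HuangSellke2025KSatEnsembleOGP`, `…HuangSellke2025KSatObstructions` (`RandomKSatEnsembleOGP.lean`) and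
`…HuangSellke2025KSat` (`RandomKSatLowDegreeHardness.lean`) HOLD (B. Huang, M. Sellke, *Strong low degree hardness for stable local optima in
spin glasses*, arXiv:2501.06427, §3.3.2, Lemma 3.22 «adaptation of Bresler–Huang 2021 Prop. 4.7(iii)», Lemma 3.23, Cor. 3.21 [HuangSellke2025];
G. Bresler, B. Huang, FOCS 2021 [BreslerHuang2021]).  ARCHITECTURE of the in-tree proof (kernel-checked, 0 cited facts; until now Summits-side
only, `Summits/PneNP/PneNP/Theorems/OverlapGapAlgebraSearchHardWindowEnsembleOGPHolds.lean`): the `ε`-resampling chain of random `k`-SAT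
formulas (kernel, semigroup, paths, two-block and multi-time marginals `stub_multiTimeMarginal`), the product over clause slots
(`stub_slotFactorization`), the mixture over refresh patterns (`stub_blockExpansion`), the LITERAL-level greedy slot bound (`stub_slotBound`) and the
band ⇒ first-appearance energy with `s` darts (the DartGame `en_rung`, `stub_bandEnergy`) give the per-tuple first moment `ogp_tupleBound`
(survival `≤ base^m`); with the band count (`stub_bandCount`, binomial entropy), the first moment at one `n` (`stub_ogpCore`) and the parameter
asymptotics (`stub_ogpAsymptotics`: `β = 2.65 log k/k`, `η = 0.05 log k/k`, …) this is Lemma 3.22; the moat / small-ball / entropy ladder of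
`NoStableSection*`, the grand correlation and resample stability / positivity give the chaos and instability legs, and `…StrongLDH` turns the
ensemble OGP into the obstructions (Lemma 3.23) and Cor. 3.21.  (Mathematical note carried over from the source: the printed reduction of Lemma 3.22
to coincident times is false pointwise for the literal-level chain; the in-tree proof bounds every time tuple directly.)  RE-HOMED into
`Literature/` by the Hodge foundations lane (`lit-hodgefound`, seat p20, generations 38–39) as THREE files: verbatim DECLARATION-LEVEL ports (the
declarations needed, in dependency order) of 42 Summits modules `Summits/PneNP/PneNP/Theorems/OverlapGapAlgebra{NoStableSection*,SearchHardWindow*}.lean`,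
namespaces `Summit.PneNP.PneNP.Theorems` / `Summit.PneNP.PneNP.Cruxes.NoStableSection.DartGame` re-rooted as
`Literature.Computability.Complexity.HuangSellke2025Chain` / `….HuangSellke2025Chain.DartGame` (in-tree `stub_…` names kept, they are proved
theorems; the DartGame gadgets `seqOf` & co. come with their bodies), followed (file 3) by the three EXACT-name discharges
`Literature.Computability.Complexity.HuangSellke2025KSatEnsembleOGP_holds`, `…HuangSellke2025KSatObstructions_holds`, `…HuangSellke2025KSat_holds`.
No new named fact (D-0026), no Summits import; built on the tree's Literature layer (`Computability/Complexity/{RandomKSatEnsembleOGP,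
RandomKSatLowDegreeHardness, BinomialEntropy*}`, `Probability/Moments/HoeffdingDecomposition`) and Mathlib.  The Summits
originals stay in place (transitional duplication).  WHAT THIS IS NOT: nothing about P vs NP; no claim beyond the three displayed statements
(ensemble OGP on the resampling chain, the obstructions, and the deterministic saturated form of Cor. 3.21 with `κ = 5`).

THIS FILE (3 of 3; rebuilt in generation 39 after the generation-38 proposal bounced on a missing `open`-ed namespace import) ports: OverlapGapAlgebraSearchHardWindowOgpAsymptotics, OverlapGapAlgebraSearchHardWindowGrandCorrelation, OverlapGapAlgebraSearchHardWindowResamplePositivity, OverlapGapAlgebraSearchHardWindowResampleStability, OverlapGapAlgebraSearchHardWindowInstability, OverlapGapAlgebraSearchHardWindowHsAsymptotics, OverlapGapAlgebraSearchHardWindowHsAssembly, OverlapGapAlgebraSearchHardWindowObstructionsOfOGP, OverlapGapAlgebraSearchHardWindowChaosTupleBound, OverlapGapAlgebraSearchHardWindowChainMassTotal, OverlapGapAlgebraSearchHardWindowSatProbBound, OverlapGapAlgebraSearchHardWindowStrongLDH, OverlapGapAlgebraSearchHardWindowEnsembleOGPHolds.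
-/

noncomputable section

/-!
## Part 1 — port of `Summits/PneNP/PneNP/Theorems/OverlapGapAlgebraSearchHardWindowOgpAsymptotics.lean` (7 declarations kept)

# Route OverlapGapAlgebra, crux `SearchHardWindow` (stmt-PneNP-2460), line `Sketch`: the
# parameter asymptotics of the ensemble OGP (Huang–Sellke 2025, Lemma 3.22)

Stub `stub_ogpAsymptotics` of the skeleton
`Summits/PneNP/PneNP/Cruxes/SearchHardWindow/Lines/Sketch.lean` (section `EnsembleOGP`): the pure
real-analysis half of the ensemble overlap-gap property for random `k`-SAT at clause density
`α_k = 5 · 2^k log k / k`. The first moment of `stub_ogpCore` bounds the mass of the OGP event by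
`(K+1)^{k+1} · 2^n ((n+1)^{2^k} e^{nβ})^k · base^m`, `m = ⌊α_k n⌋`, where
`base = 1 − 2^{−k} D`, `D = 1 + k (1 − SB_s(p₀)) − θ k(k+1)/2 − k(k+1)/2 · 2^{−F}`,
`SB_s(p) = 2(1−p)^s + s p (1−p)^{s−1}` and `p₀ = (β − η − 2θ)/(−log θ)`.

We choose `β = 2.65 log k/k`, `η = 0.05 log k/k` (so `β − η = 2.6 log k/k`), `θ = 1/(k log² k)`,
`F = ⌊log₂ k⌋ + 8` (so `2^F ≥ 128 (k+1)` and `F = O(log k)`), `s = k − F`, exactly the window of the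
DartGame line of crux `NoStableSection`, whose estimates we reuse: with `lg = log k ≥ 7`,
`k p₀ ∈ [2.5, 2.6]` (`glue_KA_s`), hence `s p₀ ∈ [2.45, 2.6]` and the small ball
`SB_s(p₀) ≤ 2 e^{−2.45} + 2.6 e^{−2.45}/0.99 ≤ 0.41` (`oga_SB`, as `glue_KA_SB`), so
`0.57 k ≤ D ≤ k + 1` (`oga_numerics`); thus `0 ≤ base ≤ exp (−2^{−k} D)` and the kill exponent
`α_k 2^{−k} D ≥ 2.85 lg` per `n` beats the count exponent `log 2 + kβ = log 2 + 2.65 lg` by more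
than `0.2` (`oga_params`). For fixed `k` the `n`-asymptotics (`oga_nAsymp`, mirror of
`stub_chaosAsymptotics`) absorb the polynomial factors `(K+1)^{k+1} ≤ 2^{k+1} (n+1)^{A(k+1)}` and
`(n+1)^{k 2^k}` by `cha_poly_le_exp`, giving the rate `c = 0.1`. The `k`-asymptotic inputs
(`k ≥ 1200`, `log k/k ≤ 0.001`, `5 log log k ≤ 0.05 log k`) hold eventually (`oga_eventually`).
-/

section Part1

namespace Literature.Computability.Complexity.HuangSellke2025Chain

open _root_.Finset _root_.Filter _root_.Topology
open Literature.Computability.Complexity.HuangSellke2025Chain.DartGame (glue_log_ge_seven glue_KA_s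
  glue_one_sub_pow_le)

/-! ## Fixed `k`: the `n`-asymptotics -/

/-- **The `n`-asymptotics for a fixed `k`**: if `0 ≤ B ≤ e^{-r}` with `r ≥ 0` and the kill rate
`α_k r` exceeds the count rate `log 2 + k β` by `2c > 0`, then
`(K+1)^{k+1} · 2^n ((n+1)^{2^k} e^{nβ})^k · B^{⌊α_k n⌋} ≤ e^{-c n}` for all large `n`, uniformly in
`K ≤ n^A`. [cite: HuangSellke2025, §3.3.2, Lemma 3.22 (parameter asymptotics β = 2.65 log k/k, η = 0.05 log k/k)] -/
theorem oga_nAsymp {k : ℕ} {β B r c : ℝ} (hB0 : 0 ≤ B) (hBr : B ≤ Real.exp (-r)) (hr : 0 ≤ r)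
    (hc : 0 < c) (hgap : Real.log 2 + k * β + 2 * c ≤ 5 * 2 ^ k * Real.log k / k * r) (A : ℕ) :
    ∀ᶠ n : ℕ in atTop, ∀ K : ℕ, K ≤ n ^ A →
      ((K : ℝ) + 1) ^ (k + 1) * ((2 : ℝ) ^ n * (((n : ℝ) + 1) ^ (2 ^ k) * Real.exp (n * β)) ^ k) *
        B ^ ⌊5 * 2 ^ k * Real.log k / k * n⌋₊ ≤ Real.exp (-(c * n)) := by
  obtain ⟨α, hα⟩ : ∃ α : ℝ, α = 5 * 2 ^ k * Real.log k / k := ⟨_, rfl⟩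
  rw [← hα] at hgap ⊢
  filter_upwards [cha_poly_le_exp ((2 : ℝ) ^ (k + 1) * Real.exp r) (A * (k + 1) + k * 2 ^ k) hc]
    with n hn K hK
  have hn0 : (0 : ℝ) ≤ n := Nat.cast_nonneg n
  -- the power of the base: `B^m ≤ e^r · e^{-α r n}`
  have hBm : B ^ ⌊α * n⌋₊ ≤ Real.exp r * Real.exp (-(α * r * n)) := by
    have hm : α * n - 1 < (⌊α * n⌋₊ : ℝ) := Nat.sub_one_lt_floor _
    have h1 : r * (α * n - 1) ≤ r * ⌊α * n⌋₊ := mul_le_mul_of_nonneg_left hm.le hr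
    calc B ^ ⌊α * n⌋₊ ≤ Real.exp (-r) ^ ⌊α * n⌋₊ := pow_le_pow_left₀ hB0 hBr _
      _ = Real.exp (⌊α * n⌋₊ * (-r)) := (Real.exp_nat_mul _ _).symm
      _ ≤ Real.exp (r + -(α * r * n)) := Real.exp_le_exp.2 (by linarith)
      _ = Real.exp r * Real.exp (-(α * r * n)) := Real.exp_add _ _
  -- the time tuples: `K + 1 ≤ 2 (n + 1) ^ A`
  have hKb : (K : ℝ) + 1 ≤ 2 * ((n : ℝ) + 1) ^ A := by
    have h1 : (K : ℝ) ≤ (n : ℝ) ^ A := by exact_mod_cast hK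
    have h2 : (n : ℝ) ^ A ≤ ((n : ℝ) + 1) ^ A := pow_le_pow_left₀ hn0 (by linarith) A
    have h3 : (1 : ℝ) ≤ ((n : ℝ) + 1) ^ A := one_le_pow₀ (by linarith)
    linarith
  have hT : ((K : ℝ) + 1) ^ (k + 1) ≤ (2 * ((n : ℝ) + 1) ^ A) ^ (k + 1) :=
    pow_le_pow_left₀ (by positivity) hKb _
  have h2n : (2 : ℝ) ^ n = Real.exp (n * Real.log 2) := by
    rw [Real.exp_nat_mul, Real.exp_log two_pos]
  have hek : Real.exp (n * β) ^ k = Real.exp (k * (n * β)) := (Real.exp_nat_mul _ _).symm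
  -- assemble
  calc ((K : ℝ) + 1) ^ (k + 1) * ((2 : ℝ) ^ n * (((n : ℝ) + 1) ^ (2 ^ k) * Real.exp (n * β)) ^ k) *
        B ^ ⌊α * n⌋₊
      ≤ (2 * ((n : ℝ) + 1) ^ A) ^ (k + 1) *
          ((2 : ℝ) ^ n * (((n : ℝ) + 1) ^ (2 ^ k) * Real.exp (n * β)) ^ k) *
          (Real.exp r * Real.exp (-(α * r * n))) :=
        mul_le_mul (mul_le_mul_of_nonneg_right hT (by positivity)) hBm (pow_nonneg hB0 _)
          (by positivity)
    _ = (2 : ℝ) ^ (k + 1) * Real.exp r * ((n : ℝ) + 1) ^ (A * (k + 1) + k * 2 ^ k) *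
          ((2 : ℝ) ^ n * Real.exp (n * β) ^ k * Real.exp (-(α * r * n))) := by ring
    _ ≤ Real.exp (c * n) * ((2 : ℝ) ^ n * Real.exp (n * β) ^ k * Real.exp (-(α * r * n))) :=
        mul_le_mul_of_nonneg_right hn (by positivity)
    _ = Real.exp (c * n + (n * Real.log 2 + k * (n * β) + -(α * r * n))) := by
        rw [h2n, hek, ← Real.exp_add, ← Real.exp_add, ← Real.exp_add]
    _ ≤ Real.exp (-(c * n)) := Real.exp_le_exp.2 (by nlinarith [mul_le_mul_of_nonneg_right hgap hn0])

/-! ## Numerical constants and the small ball with `s` darts -/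

/-- `e^{2.45} ≥ 11.4`.
[cite: HuangSellke2025, §3.3.2, Lemma 3.22 (parameter asymptotics β = 2.65 log k/k, η = 0.05 log k/k)] -/
theorem oga_exp_two_pt_four_five : (11.4 : ℝ) ≤ Real.exp 2.45 := by
  have h1 : (2.7182818283 : ℝ) < Real.exp 1 := Real.exp_one_gt_d9
  have h2 : (1.55125 : ℝ) ≤ Real.exp 0.45 := by
    have := Real.quadratic_le_exp_of_nonneg (show (0 : ℝ) ≤ 0.45 by norm_num)
    norm_num at this ⊢
    linarith
  have he : Real.exp 2.45 = Real.exp 1 * Real.exp 1 * Real.exp 0.45 := by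
    rw [← Real.exp_add, ← Real.exp_add]; norm_num
  rw [he]
  have h0 : (0 : ℝ) ≤ Real.exp 1 := Real.exp_nonneg 1
  nlinarith [mul_le_mul h1.le h1.le (by norm_num) h0, Real.exp_nonneg (0.45 : ℝ)]

/-- The binomial-extremality small ball with `s` darts at the window: if `s p₀ ∈ [2.45, 2.6]` and
`0 ≤ p₀ ≤ 0.01` then `SB_s(p₀) = 2(1-p₀)^s + s p₀ (1-p₀)^{s-1} ≤ 0.41` (as `glue_KA_SB`).
[cite: HuangSellke2025, §3.3.2, Lemma 3.22 (parameter asymptotics β = 2.65 log k/k, η = 0.05 log k/k)] -/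
theorem oga_SB {s : ℕ} {S p₀ : ℝ} (hs1 : 1 ≤ s) (hS : S = s) (hs_le : S * p₀ ≤ 2.6)
    (hs_ge : 2.45 ≤ S * p₀) (hp0 : 0 ≤ p₀) (hp1 : p₀ ≤ 0.01) :
    2 * (1 - p₀) ^ s + S * p₀ * (1 - p₀) ^ (s - 1) ≤ 0.41 := by
  have hp₀lt : p₀ < 1 := by linarith
  have hpow : (1 - p₀) ^ s ≤ Real.exp (-(S * p₀)) := by
    have := glue_one_sub_pow_le hp0 hp₀lt.le s
    rw [← hS, mul_comm] at this
    exact this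
  have hexp : Real.exp (-(S * p₀)) ≤ Real.exp (-2.45) := Real.exp_le_exp.2 (by linarith)
  have he : Real.exp (-2.45) ≤ 1 / 11.4 := by
    rw [Real.exp_neg, one_div]
    exact inv_anti₀ (by norm_num) oga_exp_two_pt_four_five
  have hq : (1 - p₀) ^ s = (1 - p₀) ^ (s - 1) * (1 - p₀) := by
    rw [← pow_succ, Nat.sub_add_cancel hs1]
  have h1p : 0 < 1 - p₀ := by linarith
  have hpow1 : (1 - p₀) ^ (s - 1) ≤ Real.exp (-2.45) / (1 - p₀) := by
    rw [le_div_iff₀ h1p, ← hq]; exact hpow.trans hexp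
  have hpow1' : (1 - p₀) ^ (s - 1) ≤ (1 / 11.4) / 0.99 := by
    refine hpow1.trans ?_
    calc Real.exp (-2.45) / (1 - p₀) ≤ (1 / 11.4) / (1 - p₀) :=
          div_le_div_of_nonneg_right he h1p.le
      _ ≤ (1 / 11.4) / 0.99 := div_le_div_of_nonneg_left (by norm_num) (by norm_num) (by linarith)
  have hA : 2 * (1 - p₀) ^ s ≤ 2 * (1 / 11.4) := by linarith [hpow.trans (hexp.trans he)]
  have hB : S * p₀ * (1 - p₀) ^ (s - 1) ≤ 2.6 * ((1 / 11.4) / 0.99) :=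
    mul_le_mul hs_le hpow1' (pow_nonneg h1p.le _) (by norm_num)
  have : 2 * (1 / 11.4 : ℝ) + 2.6 * ((1 / 11.4) / 0.99) ≤ 0.41 := by norm_num
  linarith

/-! ## The `k`-dependent estimates at the chosen parameters -/

/-- **The numerics at the window** (`K = k ≥ 1200`, `lg = log k`, `lg/K ≤ 0.001`,
`5 log lg ≤ 0.05 lg`; `β = 2.65 lg/K`, `η = 0.05 lg/K`, `θ = 1/(K lg²)`, `F = ⌊log₂ k⌋ + 8`,
`s = k - F`, `p₀ = (β - η - 2θ)/(-log θ)`): the side conditions, and the slot exponent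
`D = 1 + K(1 - SB_s(p₀)) - θ K(K+1)/2 - K(K+1)/2 · 2^{-F}` satisfies `0.57 K ≤ D ≤ K + 1`.
[cite: HuangSellke2025, §3.3.2, Lemma 3.22 (parameter asymptotics β = 2.65 log k/k, η = 0.05 log k/k)] -/
theorem oga_numerics {k s F : ℕ} {K lg β η θ p₀ : ℝ} (hK : K = k) (hlg : lg = Real.log K)
    (hk : 1200 ≤ k) (hE3 : lg / K ≤ 0.001) (hL3 : 5 * Real.log lg ≤ 0.05 * lg)
    (hβ : β = 2.65 * (lg / K)) (hη : η = 0.05 * (lg / K)) (hθ : θ = 1 / (K * lg ^ 2))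
    (hF : F = Nat.log 2 k + 8) (hs : s = k - F) (hp₀ : p₀ = (β - η - 2 * θ) / (-Real.log θ)) :
    0 < η ∧ η < β ∧ β < 5 * lg / K ∧ 0 < θ ∧ θ < 1 ∧ 2 * θ ≤ β - η ∧ s + F ≤ k ∧
    0.57 * K ≤ ((1 : ℝ) + K * (1 - (2 * (1 - p₀) ^ s + s * p₀ * (1 - p₀) ^ (s - 1))) -
      θ * (K * (K + 1) / 2)) - K * (K + 1) / 2 * (1 / 2 : ℝ) ^ F ∧
    ((1 : ℝ) + K * (1 - (2 * (1 - p₀) ^ s + s * p₀ * (1 - p₀) ^ (s - 1))) -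
      θ * (K * (K + 1) / 2)) - K * (K + 1) / 2 * (1 / 2 : ℝ) ^ F ≤ K + 1 := by
  have hkr : (1200 : ℝ) ≤ K := by rw [hK]; exact_mod_cast hk
  have hK0 : (0 : ℝ) < K := by linarith only [hkr]
  have hKne : K ≠ 0 := hK0.ne'
  have hlg7 : 7 ≤ lg := by rw [hlg, hK]; exact glue_log_ge_seven hk
  have hlg0 : 0 < lg := by linarith only [hlg7]
  have hlgne : lg ≠ 0 := hlg0.ne'
  have hlgK0 : 0 < lg / K := div_pos hlg0 hK0
  have hlg2 : (49 : ℝ) ≤ lg ^ 2 := by nlinarith only [hlg7]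
  -- `F`: `128 (K + 1) ≤ 2^F`, `F ≤ 1.45 lg + 8 ≤ 0.0082 K`
  have h2F : 128 * (k + 1) ≤ 2 ^ F := by
    have h := Nat.lt_pow_succ_log_self Nat.one_lt_two k
    rw [pow_succ] at h
    have e : 2 ^ F = 2 ^ Nat.log 2 k * 256 := by rw [hF, pow_add]; norm_num
    rw [e]; omega
  have h2F' : 128 * (K + 1) ≤ (2 : ℝ) ^ F := by rw [hK]; exact_mod_cast h2F
  have hFlg : (F : ℝ) ≤ 1.45 * lg + 8 := by
    have h := Nat.pow_log_le_self 2 (show k ≠ 0 by omega)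
    have h' : (2 : ℝ) ^ Nat.log 2 k ≤ K := by rw [hK]; exact_mod_cast h
    have h'' : (Nat.log 2 k : ℝ) * Real.log 2 ≤ lg := by
      rw [hlg, ← Real.log_pow]; exact Real.log_le_log (by positivity) h'
    have hl2 : (0.6931471803 : ℝ) < Real.log 2 := Real.log_two_gt_d9
    have hF' : (F : ℝ) = Nat.log 2 k + 8 := by rw [hF]; push_cast; ring
    rw [hF']
    nlinarith [mul_le_mul_of_nonneg_left hl2.le (Nat.cast_nonneg (Nat.log 2 k)),
      Nat.cast_nonneg (α := ℝ) (Nat.log 2 k)]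
  have hFK : (F : ℝ) ≤ 0.0082 * K := by
    have : lg ≤ 0.001 * K := by rwa [div_le_iff₀ hK0] at hE3
    linarith only [this, hFlg, hkr]
  have hFk : F ≤ k := by
    have h : (F : ℝ) ≤ (k : ℝ) := by rw [← hK]; linarith only [hFK, hkr]
    exact_mod_cast h
  have hFk' : F < k := by
    have h : (F : ℝ) < (k : ℝ) := by rw [← hK]; linarith only [hFK, hkr]
    exact_mod_cast h
  have hF0 : (0 : ℝ) ≤ F := Nat.cast_nonneg F
  -- `s`
  have hs1 : 1 ≤ s := by rw [hs]; omega
  have hsF : s + F ≤ k := by rw [hs]; omega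
  have hsR : (s : ℝ) = K - F := by rw [hs, Nat.cast_sub hFk, hK]
  -- `θ`
  have hKlg : 0 < K * lg ^ 2 := by positivity
  have hθ0 : 0 < θ := by rw [hθ]; positivity
  have hθ1 : θ < 1 := by
    rw [hθ, div_lt_one hKlg]; nlinarith only [hkr, hlg2]
  have hloglg : 0 ≤ Real.log lg := Real.log_nonneg (by linarith only [hlg7])
  have htpos : 0 < lg + 2 * Real.log lg := by linarith only [hlg0, hloglg]
  have hlogθ : -Real.log θ = lg + 2 * Real.log lg := by
    rw [hθ, one_div, Real.log_inv, neg_neg, Real.log_mul hKne (by positivity), Real.log_pow, ← hlg]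
    push_cast; ring
  have hbη : β - η = 2.6 * (lg / K) := by rw [hβ, hη]; ring
  have h2θ : 2 * θ ≤ β - η := by
    rw [hbη, hθ, show 2 * (1 / (K * lg ^ 2)) = (2 / lg ^ 2) * (1 / K) by field_simp,
      show 2.6 * (lg / K) = (2.6 * lg) * (1 / K) by ring]
    refine mul_le_mul_of_nonneg_right ?_ (by positivity)
    rw [div_le_iff₀ (by positivity)]; nlinarith only [hlg7]
  -- `p₀`: `K p₀ ∈ [2.5, 2.6]`, `p₀ ∈ [0, 0.01]`, `s p₀ ∈ [2.45, 2.6]`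
  have hKp : K * p₀ = (2.6 * lg - 2 * (1 / lg ^ 2)) / (lg + 2 * Real.log lg) := by
    rw [hp₀, hlogθ, hbη, hθ]
    field_simp
  obtain ⟨hs_ge, hs_le⟩ : 2.5 ≤ K * p₀ ∧ K * p₀ ≤ 2.6 := by
    rw [hKp]; exact glue_KA_s hlg7 hL3
  have hp₀0 : 0 ≤ p₀ := by
    by_contra h
    have : K * p₀ < 0 := mul_neg_of_pos_of_neg hK0 (lt_of_not_ge h)
    linarith only [this, hs_ge]
  have hp₀1 : p₀ ≤ 0.01 := by
    by_contra h
    have h' : 0.01 < p₀ := lt_of_not_ge h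
    have : K * 0.01 < K * p₀ := mul_lt_mul_of_pos_left h' hK0
    linarith only [this, hs_le, hkr]
  have h1p : 0 ≤ 1 - p₀ := by linarith only [hp₀1]
  have hSle : (s : ℝ) * p₀ ≤ 2.6 := by
    rw [hsR]; nlinarith only [hs_le, mul_nonneg hF0 hp₀0]
  have hSge : 2.45 ≤ (s : ℝ) * p₀ := by
    rw [hsR]; nlinarith only [hs_ge, hs_le, mul_le_mul_of_nonneg_right hFK hp₀0]
  -- the small ball, the truncation term and the freshness penalty
  set SB : ℝ := 2 * (1 - p₀) ^ s + s * p₀ * (1 - p₀) ^ (s - 1) with hSBdef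
  have hSB : SB ≤ 0.41 := oga_SB hs1 rfl hSle hSge hp₀0 hp₀1
  have hSB0 : 0 ≤ SB := add_nonneg (mul_nonneg zero_le_two (pow_nonneg h1p _))
    (mul_nonneg (mul_nonneg (Nat.cast_nonneg _) hp₀0) (pow_nonneg h1p _))
  have hθt : θ * (K * (K + 1) / 2) ≤ (K + 1) / 2 * (1 / 49) := by
    have e : θ * (K * (K + 1) / 2) = (K + 1) / 2 * (1 / lg ^ 2) := by rw [hθ]; field_simp
    rw [e]
    exact mul_le_mul_of_nonneg_left (div_le_div_of_nonneg_left zero_le_one (by norm_num) hlg2)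
      (by linarith only [hkr])
  have hθt0 : 0 ≤ θ * (K * (K + 1) / 2) := by positivity
  have hpen : K * (K + 1) / 2 * (1 / 2 : ℝ) ^ F ≤ K / 256 := by
    have h : (1 / 2 : ℝ) ^ F ≤ 1 / (128 * (K + 1)) := by
      rw [one_div_pow]
      exact div_le_div_of_nonneg_left zero_le_one (by positivity) h2F'
    calc K * (K + 1) / 2 * (1 / 2 : ℝ) ^ F ≤ K * (K + 1) / 2 * (1 / (128 * (K + 1))) :=
          mul_le_mul_of_nonneg_left h (by positivity)
      _ = K / 256 := by field_simp; ring
  have hpen0 : 0 ≤ K * (K + 1) / 2 * (1 / 2 : ℝ) ^ F := by positivity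
  refine ⟨by rw [hη]; positivity, by rw [hβ, hη]; exact mul_lt_mul_of_pos_right (by norm_num) hlgK0,
    ?_, hθ0, hθ1, h2θ, hsF, ?_, ?_⟩
  · rw [hβ, show (5 : ℝ) * lg / K = 5 * (lg / K) by ring]
    exact mul_lt_mul_of_pos_right (by norm_num) hlgK0
  · have h1 : K * 0.59 ≤ K * (1 - SB) := mul_le_mul_of_nonneg_left (by linarith only [hSB]) hK0.le
    linarith only [h1, hθt, hpen, hkr]
  · have h1 : K * (1 - SB) ≤ K := by nlinarith only [hSB0, hK0]
    linarith only [h1, hθt0, hpen0]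

/-- **The estimates at the chosen parameters, for one large `k`**: the body of
`stub_ogpAsymptotics` for `β = 2.65 log k/k`, `η = 0.05 log k/k`, `θ = 1/(k log² k)`,
`F = ⌊log₂ k⌋ + 8`, `s = k - F`, with rate `c = 0.1`.
[cite: HuangSellke2025, §3.3.2, Lemma 3.22 (parameter asymptotics β = 2.65 log k/k, η = 0.05 log k/k)] -/
theorem oga_params {k : ℕ} (hk : 1200 ≤ k) (hE3 : Real.log k / k ≤ 0.001)
    (hL3 : 5 * Real.log (Real.log k) ≤ 0.05 * Real.log k) {β η θ : ℝ} {s F : ℕ}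
    (hβ : β = 2.65 * (Real.log k / k)) (hη : η = 0.05 * (Real.log k / k))
    (hθ : θ = 1 / (k * Real.log k ^ 2)) (hF : F = Nat.log 2 k + 8) (hs : s = k - F) :
    0 < η ∧ η < β ∧ β < 5 * Real.log k / k ∧
      0 < θ ∧ θ < 1 ∧ 2 * θ ≤ β - η ∧ s + F ≤ k ∧
      0 ≤ (1 - (1 / 2 : ℝ) ^ k * (((1 : ℝ) + k * (1 - (2 * (1 - (β - η - 2 * θ) / (-Real.log θ)) ^ s + s * ((β - η - 2 * θ) / (-Real.log θ)) * (1 - (β - η - 2 * θ) / (-Real.log θ)) ^ (s - 1))) - θ * ((k : ℝ) * (k + 1) / 2)) - (k : ℝ) * (k + 1) / 2 * (1 / 2 : ℝ) ^ F)) ∧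
      ∀ A : ℕ, ∃ c : ℝ, 0 < c ∧ ∀ᶠ n : ℕ in atTop, ∀ K : ℕ, K ≤ n ^ A →
        ((K : ℝ) + 1) ^ (k + 1) * ((2 : ℝ) ^ n * (((n : ℝ) + 1) ^ (2 ^ k) * Real.exp (n * β)) ^ k) *
          (1 - (1 / 2 : ℝ) ^ k * (((1 : ℝ) + k * (1 - (2 * (1 - (β - η - 2 * θ) / (-Real.log θ)) ^ s + s * ((β - η - 2 * θ) / (-Real.log θ)) * (1 - (β - η - 2 * θ) / (-Real.log θ)) ^ (s - 1))) - θ * ((k : ℝ) * (k + 1) / 2)) - (k : ℝ) * (k + 1) / 2 * (1 / 2 : ℝ) ^ F)) ^ ⌊5 * 2 ^ k * Real.log k / k * n⌋₊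
          ≤ Real.exp (-(c * n)) := by
  obtain ⟨hη0, hηβ, hβ5, hθ0, hθ1, h2θ, hsF, hDge, hDle⟩ :=
    oga_numerics rfl rfl hk hE3 hL3 hβ hη hθ hF hs rfl
  set D : ℝ := ((1 : ℝ) + k * (1 - (2 * (1 - (β - η - 2 * θ) / (-Real.log θ)) ^ s +
    s * ((β - η - 2 * θ) / (-Real.log θ)) * (1 - (β - η - 2 * θ) / (-Real.log θ)) ^ (s - 1))) -
    θ * ((k : ℝ) * (k + 1) / 2)) - (k : ℝ) * (k + 1) / 2 * (1 / 2 : ℝ) ^ F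
  have hkr : (1200 : ℝ) ≤ k := by exact_mod_cast hk
  have hk0 : (0 : ℝ) < k := by linarith only [hkr]
  have hkne : (k : ℝ) ≠ 0 := hk0.ne'
  have hhalf0 : (0 : ℝ) ≤ (1 / 2 : ℝ) ^ k := by positivity
  have hX0 : 0 ≤ (1 / 2 : ℝ) ^ k * D := mul_nonneg hhalf0 (by linarith only [hDge, hkr])
  have hX1 : (1 / 2 : ℝ) ^ k * D ≤ 1 := by
    have h2k : (k : ℝ) + 1 ≤ (2 : ℝ) ^ k := by
      exact_mod_cast Nat.succ_le_of_lt Nat.lt_two_pow_self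
    calc (1 / 2 : ℝ) ^ k * D ≤ (1 / 2 : ℝ) ^ k * 2 ^ k :=
          mul_le_mul_of_nonneg_left (hDle.trans h2k) hhalf0
      _ = 1 := by rw [← mul_pow]; norm_num
  have hbase0 : 0 ≤ 1 - (1 / 2 : ℝ) ^ k * D := by linarith only [hX1]
  have hbexp : 1 - (1 / 2 : ℝ) ^ k * D ≤ Real.exp (-((1 / 2 : ℝ) ^ k * D)) := by
    linarith only [Real.add_one_le_exp (-((1 / 2 : ℝ) ^ k * D))]
  have hgap : Real.log 2 + k * β + 2 * 0.1 ≤ 5 * 2 ^ k * Real.log k / k * ((1 / 2 : ℝ) ^ k * D) := by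
    have hone : (2 : ℝ) ^ k * (1 / 2 : ℝ) ^ k = 1 := by rw [← mul_pow]; norm_num
    have e : 5 * 2 ^ k * Real.log k / k * ((1 / 2 : ℝ) ^ k * D) =
        5 * (Real.log k / k) * D * ((2 : ℝ) ^ k * (1 / 2 : ℝ) ^ k) := by ring
    rw [e, hone, mul_one]
    have h1 : 5 * (Real.log k / k) * (0.57 * k) ≤ 5 * (Real.log k / k) * D :=
      mul_le_mul_of_nonneg_left hDge (by positivity)
    have h2 : 5 * (Real.log k / k) * (0.57 * k) = 2.85 * Real.log k := by field_simp; ring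
    have h3 : (k : ℝ) * β = 2.65 * Real.log k := by rw [hβ]; field_simp
    have hlg7 : (7 : ℝ) ≤ Real.log k := glue_log_ge_seven hk
    have hl2 : Real.log 2 < 0.6931471808 := Real.log_two_lt_d9
    linarith only [h1, h2, h3, hlg7, hl2]
  exact ⟨hη0, hηβ, hβ5, hθ0, hθ1, h2θ, hsF, hbase0, fun A =>
    ⟨0.1, by norm_num, oga_nAsymp hbase0 hbexp hX0 (by norm_num) hgap A⟩⟩

/-- The `k`-asymptotic inputs hold for every large `k`: `k ≥ 1200` (so `log k ≥ 7`),
`log k / k ≤ 0.001` and `5 log log k ≤ 0.05 log k`.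
[cite: HuangSellke2025, §3.3.2, Lemma 3.22 (parameter asymptotics β = 2.65 log k/k, η = 0.05 log k/k)] -/
theorem oga_eventually : ∀ᶠ k : ℕ in atTop,
    1200 ≤ k ∧ Real.log k / k ≤ 0.001 ∧ 5 * Real.log (Real.log k) ≤ 0.05 * Real.log k := by
  have L1 : Tendsto (fun k : ℕ => Real.log k / k) atTop (𝓝 0) := by
    have h := Real.tendsto_pow_log_div_mul_add_atTop 1 0 1 one_ne_zero
    have h' : Tendsto (fun x : ℝ => Real.log x / x) atTop (𝓝 0) := by
      simpa using h
    exact h'.comp tendsto_natCast_atTop_atTop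
  have L3 : ∀ᶠ k : ℕ in atTop, 5 * Real.log (Real.log k) ≤ 0.05 * Real.log k := by
    have hlo : ∀ᶠ x : ℝ in atTop, ‖Real.log x‖ ≤ 0.01 * ‖x‖ :=
      Real.isLittleO_log_id_atTop.bound (by norm_num)
    have ht : Tendsto (fun k : ℕ => Real.log k) atTop atTop :=
      Real.tendsto_log_atTop.comp tendsto_natCast_atTop_atTop
    have := ht.eventually hlo
    filter_upwards [this, eventually_ge_atTop 3] with k hk hk3
    have hk3' : (3 : ℝ) ≤ k := by exact_mod_cast hk3
    have hlogpos : 0 < Real.log k := Real.log_pos (by linarith)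
    simp only [Real.norm_eq_abs, abs_of_pos hlogpos] at hk
    have := (le_abs_self _).trans hk
    linarith
  filter_upwards [eventually_ge_atTop 1200,
    L1.eventually (ge_mem_nhds (by norm_num : (0 : ℝ) < 0.001)), L3] with k h1 h2 h3
  exact ⟨h1, h2, h3⟩

/-- **Stub `stub_ogpAsymptotics`** (registered on stmt-PneNP-2460, line `Sketch`, section
`EnsembleOGP`): the parameter asymptotics of the ensemble OGP (Huang–Sellke 2025, Lemma 3.22;
real analysis only). For every large `k` there are a band `[β − η, β]` below `5 log k/k`, a
truncation level `θ ∈ (0,1)` with `2θ ≤ β − η`, a dart count `s` and a freshness threshold `F` with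
`s + F ≤ k`, such that the slot base is in `[0, 1]` and the first-moment bound of `stub_ogpCore` is
`≤ e^{−cn}` eventually in `n`, uniformly in the chain length `K ≤ n^A`.
[cite: HuangSellke2025, §3.3.2, Lemma 3.22 (parameter asymptotics β = 2.65 log k/k, η = 0.05 log k/k)] -/
theorem stub_ogpAsymptotics :
    ∃ k₀ : ℕ, ∀ k : ℕ, k₀ ≤ k → ∃ (β η θ : ℝ) (s F : ℕ), 0 < η ∧ η < β ∧ β < 5 * Real.log k / k ∧
      0 < θ ∧ θ < 1 ∧ 2 * θ ≤ β - η ∧ s + F ≤ k ∧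
      0 ≤ (1 - (1 / 2 : ℝ) ^ k * (((1 : ℝ) + k * (1 - (2 * (1 - (β - η - 2 * θ) / (-Real.log θ)) ^ s + s * ((β - η - 2 * θ) / (-Real.log θ)) * (1 - (β - η - 2 * θ) / (-Real.log θ)) ^ (s - 1))) - θ * ((k : ℝ) * (k + 1) / 2)) - (k : ℝ) * (k + 1) / 2 * (1 / 2 : ℝ) ^ F)) ∧
      ∀ A : ℕ, ∃ c : ℝ, 0 < c ∧ ∀ᶠ n : ℕ in atTop, ∀ K : ℕ, K ≤ n ^ A →
        ((K : ℝ) + 1) ^ (k + 1) * ((2 : ℝ) ^ n * (((n : ℝ) + 1) ^ (2 ^ k) * Real.exp (n * β)) ^ k) *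
          (1 - (1 / 2 : ℝ) ^ k * (((1 : ℝ) + k * (1 - (2 * (1 - (β - η - 2 * θ) / (-Real.log θ)) ^ s + s * ((β - η - 2 * θ) / (-Real.log θ)) * (1 - (β - η - 2 * θ) / (-Real.log θ)) ^ (s - 1))) - θ * ((k : ℝ) * (k + 1) / 2)) - (k : ℝ) * (k + 1) / 2 * (1 / 2 : ℝ) ^ F)) ^ ⌊5 * 2 ^ k * Real.log k / k * n⌋₊
          ≤ Real.exp (-(c * n)) := by
  obtain ⟨k₀, hk₀⟩ := Filter.eventually_atTop.1 oga_eventually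
  refine ⟨k₀, fun k hk => ?_⟩
  obtain ⟨h1, h2, h3⟩ := hk₀ k hk
  exact ⟨_, _, _, _, _, oga_params h1 h2 h3 rfl rfl rfl rfl rfl⟩

end Literature.Computability.Complexity.HuangSellke2025Chain

end Part1

/-!
## Part 2 — port of `Summits/PneNP/PneNP/Theorems/OverlapGapAlgebraSearchHardWindowGrandCorrelation.lean` (12 declarations kept)

# Route OverlapGapAlgebra, crux `SearchHardWindow` (stmt-PneNP-2460): the grand correlation
# inequality (Huang–Sellke 2025, Lemma 3.15 / Lemma 2.7, deterministic case, abstract form)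

For a symmetric stochastic kernel `P` on a finite type `S` with the one-step positivity
`(Σ f)² ≤ #S · Σ_{y,y'} P y y' f y f y'`, a set `good ⊆ S` of density `≥ p` and a symmetric relation
`close` whose failure has one-step mass `≤ u · #S`, the paths `y : Fin (K+1) → S` of the `P`-Markov
chain (started from counting measure) that are good at all `K + 1` times and close at all `K` steps
have total mass `≥ #S · (p² − u)₊ ^ (2K)` for every `K ≥ 1` (`stub_grandCorrelation`, the engine of
line `Sketch` of the crux: there `P` is the `ε`-resampling kernel on literal arrays, `good` = "the
low-degree algorithm solves the instance", `close` = "its output moves little").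

Proof (Huang–Sellke 2025 §2.2 / §3.3, transfer-matrix form). With the symmetric substochastic matrix
`M a b = [good a] · P a b · [close a b] · [good b]` the path mass equals the total mass
`Σ_{a,b} (M ^ K) a b` (`gc_pathSum`: expansion of a path sum by induction on `K`, splitting off the
first vertex with `Fin.consEquiv`; `gc_summand`, `gc_absorb`). The total mass of `M ^ K` is antitone
in `K` (row sums `≤ 1`, `gc_total_mono`), satisfies the doubling inequality
`(Σ M^K)² ≤ #S · Σ M^{2K}` (Cauchy–Schwarz at the midpoint using symmetry, `gc_total_sq_le`), and at
`K = 1` it is `≥ #S · (p² − u)` (positivity applied to the indicator of `good`, minus the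
instability mass, `gc_base`); induction over powers of two (`gc_total_two_pow`) and
`K ≤ 2^j ≤ 2K` conclude (`gc_total_lower`).

References: B. Huang, M. Sellke, *Strong low degree hardness for stable local optima in spin
glasses*, arXiv:2501.06427 (2025), Lemma 2.7 and Lemma 3.15 [HuangSellke2025].
-/

section Part2

namespace Literature.Computability.Complexity.HuangSellke2025Chain

open _root_.Finset
open scoped _root_.Classical

variable {S : Type*}

/-- Transfer-matrix expansion of a path sum: summing `D (y 0) · ∏ₜ M (y t) (y (t+1))` over all paths
`y : Fin (K+1) → S` gives the `D`-weighted total mass `Σ_a D a · Σ_b (M ^ K) a b`.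
[cite: HuangSellke2025, §3.3.2, Lemma 3.22 (the grand correlation)] -/
theorem gc_pathSum [Fintype S] [DecidableEq S] (M : Matrix S S ℝ) :
    ∀ (K : ℕ) (D : S → ℝ),
      ∑ y : Fin (K + 1) → S, D (y 0) * ∏ t : Fin K, M (y t.castSucc) (y t.succ) =
        ∑ a, D a * ∑ b, (M ^ K) a b
  | 0, D => by
    rw [← (Equiv.funUnique (Fin 1) S).symm.sum_comp]
    simp [Matrix.one_apply]
  | K + 1, D => by
    rw [← (Fin.consEquiv fun _ : Fin (K + 1 + 1) => S).sum_comp, Fintype.sum_prod_type]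
    simp only [Fin.consEquiv_apply, Fin.prod_univ_succ, Fin.castSucc_zero, Fin.cons_zero,
      Fin.cons_succ, Fin.castSucc_succ]
    calc ∑ s, ∑ x : Fin (K + 1) → S, D s * (M s (x 0) * ∏ t : Fin K, M (x t.castSucc) (x t.succ))
        = ∑ x : Fin (K + 1) → S, (∑ s, D s * M s (x 0)) *
            ∏ t : Fin K, M (x t.castSucc) (x t.succ) := by
          rw [Finset.sum_comm]
          simp only [Finset.sum_mul, mul_assoc]
      _ = ∑ a, (∑ s, D s * M s a) * ∑ b, (M ^ K) a b :=
          gc_pathSum M K fun a => ∑ s, D s * M s a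
      _ = ∑ s, ∑ a, D s * (M s a * ∑ b, (M ^ K) a b) := by
          simp only [Finset.sum_mul, mul_assoc]
          rw [Finset.sum_comm]
      _ = ∑ s, D s * ∑ b, (M ^ (K + 1)) s b := by
          refine Finset.sum_congr rfl fun s _ => ?_
          rw [← Finset.mul_sum, pow_succ']
          congr 1
          simp only [Matrix.mul_apply, Finset.mul_sum]
          exact Finset.sum_comm

/-- Powers of an entrywise nonnegative matrix are entrywise nonnegative.
[cite: HuangSellke2025, §3.3.2, Lemma 3.22 (the grand correlation)] -/
theorem gc_pow_nonneg [Fintype S] [DecidableEq S] (M : Matrix S S ℝ) (hM0 : ∀ a b, 0 ≤ M a b) :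
    ∀ (K : ℕ) (a b : S), 0 ≤ (M ^ K) a b
  | 0, a, b => by
    rw [pow_zero, Matrix.one_apply]
    split_ifs <;> norm_num
  | K + 1, a, b => by
    rw [pow_succ, Matrix.mul_apply]
    exact Finset.sum_nonneg fun c _ => mul_nonneg (gc_pow_nonneg M hM0 K a c) (hM0 c b)

/-- For a nonnegative matrix with row sums `≤ 1`, the total mass of `M ^ K` is antitone in `K`
(one step). [cite: HuangSellke2025, §3.3.2, Lemma 3.22 (the grand correlation)] -/
theorem gc_total_succ_le [Fintype S] [DecidableEq S] (M : Matrix S S ℝ) (hM0 : ∀ a b, 0 ≤ M a b)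
    (hM1 : ∀ a, ∑ b, M a b ≤ 1) (K : ℕ) :
    ∑ a, ∑ b, (M ^ (K + 1)) a b ≤ ∑ a, ∑ b, (M ^ K) a b := by
  refine Finset.sum_le_sum fun a _ => ?_
  calc ∑ b, (M ^ (K + 1)) a b = ∑ c, (M ^ K) a c * ∑ b, M c b := by
        simp only [pow_succ, Matrix.mul_apply, Finset.mul_sum]
        exact Finset.sum_comm
    _ ≤ ∑ c, (M ^ K) a c * 1 :=
        Finset.sum_le_sum fun c _ => mul_le_mul_of_nonneg_left (hM1 c) (gc_pow_nonneg M hM0 K a c)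
    _ = ∑ c, (M ^ K) a c := by simp only [mul_one]

/-- For a nonnegative matrix with row sums `≤ 1`, the total mass of `M ^ K` is antitone in `K`.
[cite: HuangSellke2025, §3.3.2, Lemma 3.22 (the grand correlation)] -/
theorem gc_total_mono [Fintype S] [DecidableEq S] (M : Matrix S S ℝ) (hM0 : ∀ a b, 0 ≤ M a b)
    (hM1 : ∀ a, ∑ b, M a b ≤ 1) {K K' : ℕ} (h : K ≤ K') :
    ∑ a, ∑ b, (M ^ K') a b ≤ ∑ a, ∑ b, (M ^ K) a b :=
  antitone_nat_of_succ_le (f := fun L => ∑ a, ∑ b, (M ^ L) a b)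
    (fun L => gc_total_succ_le M hM0 hM1 L) h

/-- Doubling by Cauchy–Schwarz at the midpoint: for a symmetric matrix,
`(Σ_{a,b} (M^K) a b)² ≤ #S · Σ_{a,b} (M^{2K}) a b`.
[cite: HuangSellke2025, §3.3.2, Lemma 3.22 (the grand correlation)] -/
theorem gc_total_sq_le [Fintype S] [DecidableEq S] (M : Matrix S S ℝ) (hM : M.IsSymm) (K : ℕ) :
    (∑ a, ∑ b, (M ^ K) a b) ^ 2 ≤ Fintype.card S * ∑ a, ∑ b, (M ^ (2 * K)) a b := by
  have hsymm : ∀ a c, (M ^ K) a c = (M ^ K) c a := fun a c => ((hM.pow K).apply a c).symm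
  have key : ∑ a, ∑ b, (M ^ (2 * K)) a b = ∑ c, (∑ b, (M ^ K) c b) ^ 2 := by
    calc ∑ a, ∑ b, (M ^ (2 * K)) a b
        = ∑ a, ∑ c, ∑ b, (M ^ K) a c * (M ^ K) c b := by
          simp only [two_mul, pow_add, Matrix.mul_apply]
          exact Finset.sum_congr rfl fun a _ => Finset.sum_comm
      _ = ∑ c, ∑ a, ∑ b, (M ^ K) a c * (M ^ K) c b := Finset.sum_comm
      _ = ∑ c, (∑ b, (M ^ K) c b) ^ 2 := by
          refine Finset.sum_congr rfl fun c _ => ?_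
          rw [sq, Finset.sum_mul_sum]
          exact Finset.sum_congr rfl fun a _ => Finset.sum_congr rfl fun b _ => by rw [hsymm a c]
  calc (∑ a, ∑ b, (M ^ K) a b) ^ 2 ≤ #(univ : Finset S) * ∑ c, (∑ b, (M ^ K) c b) ^ 2 :=
        sq_sum_le_card_mul_sum_sq
    _ = Fintype.card S * ∑ a, ∑ b, (M ^ (2 * K)) a b := by rw [Finset.card_univ, key]

/-- Induction over powers of two: if `M` is nonnegative and symmetric and its total mass is
`≥ #S · q` with `q ≥ 0`, then the total mass of `M ^ (2 ^ j)` is `≥ #S · q ^ (2 ^ j)`.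
[cite: HuangSellke2025, §3.3.2, Lemma 3.22 (the grand correlation)] -/
theorem gc_total_two_pow [Fintype S] [DecidableEq S] (M : Matrix S S ℝ) (hM0 : ∀ a b, 0 ≤ M a b)
    (hM : M.IsSymm) (hS : 0 < Fintype.card S) (q : ℝ) (hq : 0 ≤ q)
    (h1 : Fintype.card S * q ≤ ∑ a, ∑ b, M a b) :
    ∀ j : ℕ, Fintype.card S * q ^ (2 ^ j) ≤ ∑ a, ∑ b, (M ^ (2 ^ j)) a b
  | 0 => by simpa using h1
  | j + 1 => by
    have ih := gc_total_two_pow M hM0 hM hS q hq h1 j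
    have hsq := gc_total_sq_le M hM (2 ^ j)
    have hS' : (0 : ℝ) < Fintype.card S := Nat.cast_pos.mpr hS
    have hl : 0 ≤ (Fintype.card S : ℝ) * q ^ 2 ^ j := by positivity
    rw [pow_succ' 2 j, pow_mul']
    refine le_of_mul_le_mul_left ?_ hS'
    calc (Fintype.card S : ℝ) * (Fintype.card S * (q ^ 2 ^ j) ^ 2)
        = (Fintype.card S * q ^ 2 ^ j) ^ 2 := by ring
      _ ≤ (∑ a, ∑ b, (M ^ (2 ^ j)) a b) ^ 2 := pow_le_pow_left₀ hl ih 2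
      _ ≤ Fintype.card S * ∑ a, ∑ b, (M ^ (2 * 2 ^ j)) a b := hsq

/-- Every `K ≥ 1` lies in a dyadic window `K ≤ 2 ^ j ≤ 2K`.
[cite: HuangSellke2025, §3.3.2, Lemma 3.22 (the grand correlation)] -/
theorem gc_exists_two_pow {K : ℕ} (hK : 1 ≤ K) : ∃ j : ℕ, K ≤ 2 ^ j ∧ 2 ^ j ≤ 2 * K :=
  ⟨Nat.log 2 K + 1, (Nat.lt_pow_succ_log_self one_lt_two K).le, by
    rw [pow_succ']
    exact Nat.mul_le_mul_left 2 (Nat.pow_log_le_self 2 (by omega))⟩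

/-- The matrix form of the grand correlation bound: for a nonnegative symmetric matrix with row
sums `≤ 1` whose total mass is `≥ #S · q` with `0 ≤ q ≤ 1`, the total mass of `M ^ K` is
`≥ #S · q ^ (2K)` for every `K ≥ 1`. [cite: HuangSellke2025, §3.3.2, Lemma 3.22 (the grand correlation)] -/
theorem gc_total_lower [Fintype S] [DecidableEq S] (M : Matrix S S ℝ) (hM0 : ∀ a b, 0 ≤ M a b)
    (hM1 : ∀ a, ∑ b, M a b ≤ 1) (hM : M.IsSymm) (hS : 0 < Fintype.card S) (q : ℝ) (hq : 0 ≤ q)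
    (hq1 : q ≤ 1) (h1 : Fintype.card S * q ≤ ∑ a, ∑ b, M a b) {K : ℕ} (hK : 1 ≤ K) :
    Fintype.card S * q ^ (2 * K) ≤ ∑ a, ∑ b, (M ^ K) a b := by
  obtain ⟨j, hKj, hjK⟩ := gc_exists_two_pow hK
  calc Fintype.card S * q ^ (2 * K) ≤ Fintype.card S * q ^ (2 ^ j) :=
        mul_le_mul_of_nonneg_left (pow_le_pow_of_le_one hq hq1 hjK) (Nat.cast_nonneg _)
    _ ≤ ∑ a, ∑ b, (M ^ (2 ^ j)) a b := gc_total_two_pow M hM0 hM hS q hq h1 j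
    _ ≤ ∑ a, ∑ b, (M ^ K) a b := gc_total_mono M hM0 hM1 hKj

/-- Absorption of an idempotent left weight: if `D a · M a b = M a b` for all `a, b`, then also
`D a · (M ^ K) a b = (M ^ K) a b` for `K ≥ 1`. [cite: HuangSellke2025, §3.3.2, Lemma 3.22 (the grand correlation)] -/
theorem gc_absorb [Fintype S] [DecidableEq S] (M : Matrix S S ℝ) (D : S → ℝ)
    (h : ∀ a b, D a * M a b = M a b) {K : ℕ} (hK : 1 ≤ K) (a b : S) :
    D a * (M ^ K) a b = (M ^ K) a b := by
  obtain ⟨K, rfl⟩ := Nat.exists_eq_add_of_le' hK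
  rw [pow_succ', Matrix.mul_apply, Finset.mul_sum]
  exact Finset.sum_congr rfl fun c _ => by rw [← mul_assoc, h]

/-- The summand of the grand correlation sum in transfer-matrix form: with
`M a b = [good a] · P a b · [close a b] · [good b]`, the weight of a path times the indicator of
"good everywhere and close at every step" is `[good (y 0)] · ∏ₜ M (y t) (y (t+1))`.
[cite: HuangSellke2025, §3.3.2, Lemma 3.22 (the grand correlation)] -/
theorem gc_summand (P : S → S → ℝ) (good : S → Bool) (close : S → S → Bool) (M : Matrix S S ℝ)
    (hM : ∀ a b, M a b = (if good a = true then (1 : ℝ) else 0) * P a b *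
      (if close a b = true then (1 : ℝ) else 0) * (if good b = true then (1 : ℝ) else 0))
    (K : ℕ) (y : Fin (K + 1) → S) :
    (∏ t : Fin K, P (y t.castSucc) (y t.succ)) *
        (if (∀ t, good (y t) = true) ∧ (∀ t : Fin K, close (y t.castSucc) (y t.succ) = true)
          then (1 : ℝ) else 0) =
      (if good (y 0) = true then (1 : ℝ) else 0) * ∏ t : Fin K, M (y t.castSucc) (y t.succ) := by
  by_cases h : (∀ t, good (y t) = true) ∧ (∀ t : Fin K, close (y t.castSucc) (y t.succ) = true)
  · rw [if_pos h, if_pos (h.1 0), mul_one, one_mul]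
    exact Finset.prod_congr rfl fun t _ => by rw [hM, h.1, h.1, h.2]; norm_num
  · rw [if_neg h, mul_zero]
    rcases not_and_or.mp h with h1 | h1 <;> obtain ⟨t, ht⟩ := not_forall.mp h1
    · rcases Fin.eq_zero_or_eq_succ t with rfl | ⟨i, rfl⟩
      · rw [if_neg ht, zero_mul]
      · symm
        apply mul_eq_zero_of_right
        apply Finset.prod_eq_zero (Finset.mem_univ i)
        rw [hM]
        simp [ht]
    · symm
      apply mul_eq_zero_of_right
      apply Finset.prod_eq_zero (Finset.mem_univ t)
      rw [hM]
      simp [ht]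

/-- The base case `K = 1`: positivity of `P` applied to the indicator of `good` (density `≥ p`)
minus the one-step instability mass `≤ u · #S` gives total mass `≥ #S · (p² − u)` for
`M a b = [good a] · P a b · [close a b] · [good b]`.
[cite: HuangSellke2025, §3.3.2, Lemma 3.22 (the grand correlation)] -/
theorem gc_base [Fintype S] (P : S → S → ℝ) (hP0 : ∀ y y', 0 ≤ P y y')
    (hPpos : ∀ f : S → ℝ, (∑ y, f y) ^ 2 ≤ Fintype.card S * ∑ y, ∑ y', P y y' * (f y * f y'))
    (good : S → Bool) (close : S → S → Bool) (p u : ℝ) (hp : 0 ≤ p)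
    (hpS : p * Fintype.card S ≤ (univ.filter fun y => good y = true).card)
    (hu : ∑ y, ∑ y', P y y' * (if close y y' = true then (0 : ℝ) else 1) ≤ u * Fintype.card S)
    (hS : 0 < Fintype.card S) (M : Matrix S S ℝ)
    (hM : ∀ a b, M a b = (if good a = true then (1 : ℝ) else 0) * P a b *
      (if close a b = true then (1 : ℝ) else 0) * (if good b = true then (1 : ℝ) else 0)) :
    Fintype.card S * (p ^ 2 - u) ≤ ∑ a, ∑ b, M a b := by
  have hS' : (0 : ℝ) < Fintype.card S := Nat.cast_pos.mpr hS
  have hsumD : ∑ a, (if good a = true then (1 : ℝ) else 0) =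
      ((univ.filter fun y => good y = true).card : ℝ) := by
    rw [Finset.sum_boole]
  have hpos : (∑ a, (if good a = true then (1 : ℝ) else 0)) ^ 2 ≤
      Fintype.card S * ∑ a, ∑ b, P a b *
        ((if good a = true then (1 : ℝ) else 0) * (if good b = true then (1 : ℝ) else 0)) :=
    hPpos _
  have h1 : Fintype.card S * p ^ 2 ≤ ∑ a, ∑ b, P a b *
      ((if good a = true then (1 : ℝ) else 0) * (if good b = true then (1 : ℝ) else 0)) := by
    refine le_of_mul_le_mul_left ?_ hS'
    calc (Fintype.card S : ℝ) * (Fintype.card S * p ^ 2) = (p * Fintype.card S) ^ 2 := by ring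
      _ ≤ (∑ a, (if good a = true then (1 : ℝ) else 0)) ^ 2 := by
          rw [hsumD]
          exact pow_le_pow_left₀ (by positivity) hpS 2
      _ ≤ _ := hpos
  have h2 : ∀ a b, P a b * ((if good a = true then (1 : ℝ) else 0) *
      (if good b = true then (1 : ℝ) else 0)) - P a b * (if close a b = true then (0 : ℝ) else 1)
        ≤ M a b := by
    intro a b
    rw [hM]
    have := hP0 a b
    split_ifs <;> linarith
  calc Fintype.card S * (p ^ 2 - u) = Fintype.card S * p ^ 2 - u * Fintype.card S := by ring
    _ ≤ (∑ a, ∑ b, P a b * ((if good a = true then (1 : ℝ) else 0) *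
          (if good b = true then (1 : ℝ) else 0))) -
          ∑ a, ∑ b, P a b * (if close a b = true then (0 : ℝ) else 1) := sub_le_sub h1 hu
    _ = ∑ a, ∑ b, (P a b * ((if good a = true then (1 : ℝ) else 0) *
          (if good b = true then (1 : ℝ) else 0)) -
          P a b * (if close a b = true then (0 : ℝ) else 1)) := by
        simp only [Finset.sum_sub_distrib]
    _ ≤ ∑ a, ∑ b, M a b := Finset.sum_le_sum fun a _ => Finset.sum_le_sum fun b _ => h2 a b

/-- **Grand correlation inequality** (Huang–Sellke 2025, Lemma 3.15 / Lemma 2.7, deterministic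
case, abstract form). For a symmetric stochastic kernel `P` on a finite type with the one-step
positivity `(Σ f)² ≤ #S · Σ P f f`, a set `good` of density `≥ p` and a symmetric relation `close`
failing with one-step mass `≤ u · #S`: the paths of length `K ≥ 1` that are good at every time and
close at every step have mass `≥ #S · (p² − u)₊ ^ (2K)`.
[cite: HuangSellke2025, §3.3.2, Lemma 3.22 (the grand correlation)] -/
theorem stub_grandCorrelation {S : Type*} [Fintype S] [DecidableEq S]
    (P : S → S → ℝ) (hP0 : ∀ y y', 0 ≤ P y y') (hPsymm : ∀ y y', P y y' = P y' y)
    (hPstoch : ∀ y, ∑ y', P y y' = 1)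
    (hPpos : ∀ f : S → ℝ, (∑ y, f y) ^ 2 ≤ Fintype.card S * ∑ y, ∑ y', P y y' * (f y * f y'))
    (good : S → Bool) (close : S → S → Bool) (hclose : ∀ y y', close y y' = close y' y)
    (p u : ℝ) (hp : 0 ≤ p) (hpS : p * Fintype.card S ≤ (univ.filter fun y => good y = true).card)
    (hu : ∑ y, ∑ y', P y y' * (if close y y' = true then (0 : ℝ) else 1) ≤ u * Fintype.card S)
    (K : ℕ) (hK : 1 ≤ K) :
    Fintype.card S * (max 0 (p ^ 2 - u)) ^ (2 * K) ≤
      ∑ y : Fin (K + 1) → S, (∏ t : Fin K, P (y t.castSucc) (y t.succ)) *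
        (if (∀ t, good (y t) = true) ∧ (∀ t : Fin K, close (y t.castSucc) (y t.succ) = true)
          then (1 : ℝ) else 0) := by
  rcases Nat.eq_zero_or_pos (Fintype.card S) with hS0 | hS
  · rw [hS0, Nat.cast_zero, zero_mul]
    refine Finset.sum_nonneg fun y _ => mul_nonneg (Finset.prod_nonneg fun t _ => hP0 _ _) ?_
    split_ifs <;> norm_num
  -- the transfer matrix `M a b = [good a] · P a b · [close a b] · [good b]`
  obtain ⟨M, hM⟩ : ∃ M : Matrix S S ℝ, ∀ a b, M a b = (if good a = true then (1 : ℝ) else 0) *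
      P a b * (if close a b = true then (1 : ℝ) else 0) * (if good b = true then (1 : ℝ) else 0) :=
    ⟨Matrix.of fun a b => (if good a = true then (1 : ℝ) else 0) * P a b *
      (if close a b = true then (1 : ℝ) else 0) * (if good b = true then (1 : ℝ) else 0),
      fun _ _ => rfl⟩
  have hM0 : ∀ a b, 0 ≤ M a b := by
    intro a b
    rw [hM]
    have := hP0 a b
    split_ifs <;> linarith
  have hM1 : ∀ a, ∑ b, M a b ≤ 1 := by
    intro a
    rw [← hPstoch a]
    refine Finset.sum_le_sum fun b _ => ?_
    rw [hM]
    have := hP0 a b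
    split_ifs <;> linarith
  have hMsymm : M.IsSymm := Matrix.IsSymm.ext fun a b => by
    rw [hM, hM, hPsymm b a, hclose b a]
    ring
  have habs : ∀ a b, (if good a = true then (1 : ℝ) else 0) * M a b = M a b := by
    intro a b
    rw [hM]
    split_ifs <;> ring
  have hS' : (0 : ℝ) < Fintype.card S := Nat.cast_pos.mpr hS
  -- the path sum is the total mass of `M ^ K`
  have hRHS : ∑ y : Fin (K + 1) → S, (∏ t : Fin K, P (y t.castSucc) (y t.succ)) *
      (if (∀ t, good (y t) = true) ∧ (∀ t : Fin K, close (y t.castSucc) (y t.succ) = true)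
        then (1 : ℝ) else 0) = ∑ a, ∑ b, (M ^ K) a b := by
    calc _ = ∑ y : Fin (K + 1) → S, (if good (y 0) = true then (1 : ℝ) else 0) *
          ∏ t : Fin K, M (y t.castSucc) (y t.succ) :=
          Finset.sum_congr rfl fun y _ => gc_summand P good close M hM K y
      _ = ∑ a, (if good a = true then (1 : ℝ) else 0) * ∑ b, (M ^ K) a b :=
          gc_pathSum M K fun a => if good a = true then (1 : ℝ) else 0
      _ = ∑ a, ∑ b, (M ^ K) a b := by
          refine Finset.sum_congr rfl fun a _ => ?_
          rw [Finset.mul_sum]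
          exact Finset.sum_congr rfl fun b _ => gc_absorb M _ habs hK a b
  rw [hRHS]
  -- the parameter `q = (p² − u)₊ ∈ [0, 1]`
  have hp1 : p ≤ 1 := by
    refine le_of_mul_le_mul_right ?_ hS'
    rw [one_mul]
    refine hpS.trans ?_
    rw [← Finset.card_univ]
    exact_mod_cast Finset.card_filter_le _ _
  have hu0 : 0 ≤ u := by
    refine le_of_mul_le_mul_right ?_ hS'
    rw [zero_mul]
    refine le_trans (Finset.sum_nonneg fun a _ => Finset.sum_nonneg fun b _ => ?_) hu
    have := hP0 a b
    split_ifs <;> linarith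
  have hq0 : 0 ≤ max 0 (p ^ 2 - u) := le_max_left _ _
  have hq1 : max 0 (p ^ 2 - u) ≤ 1 := max_le zero_le_one (by nlinarith)
  have h1 : Fintype.card S * max 0 (p ^ 2 - u) ≤ ∑ a, ∑ b, M a b := by
    rcases le_total (p ^ 2 - u) 0 with h | h
    · rw [max_eq_left h, mul_zero]
      exact Finset.sum_nonneg fun a _ => Finset.sum_nonneg fun b _ => hM0 a b
    · rw [max_eq_right h]
      exact gc_base P hP0 hPpos good close p u hp hpS hu hS M hM
  exact gc_total_lower M hM0 hM1 hMsymm hS _ hq0 hq1 h1 hK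

end Literature.Computability.Complexity.HuangSellke2025Chain

end Part2

/-!
## Part 3 — port of `Summits/PneNP/PneNP/Theorems/OverlapGapAlgebraSearchHardWindowResamplePositivity.lean` (6 declarations kept)

# Route OverlapGapAlgebra, crux `SearchHardWindow` (stmt-PneNP-2460): one-step positivity of the
# `ε`-resampling kernel

On the finite product space `ι → Γ` (uniform `Γ`) the `ε`-resampling ("noise") kernel
`P_ε(y, y') = ∏_i ((1 − ε)·[y i = y' i] + ε/|Γ|)` is positive semidefinite for `0 ≤ ε ≤ 1`, in the
counting form consumed by the grand-correlation inequality of line `Sketch`: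
`(Σ_y f y)² ≤ #(ι → Γ) · Σ_{y,y'} P_ε(y, y') f y f y'` (`stub_resamplePositivity`; O'Donnell 2014,
§8.3–8.4: the noise operator `T_ρ`, `ρ = 1 − ε ∈ [0, 1]`, is a positive operator since
`T_ρ = T_{√ρ} T_{√ρ}` with `T_{√ρ}` self-adjoint; Huang–Sellke 2025 §3.3, proof of Lemma 3.15:
"`y, y'` are conditionally i.i.d. given the shared coordinates, then Jensen").

Proof (semigroup / "half-step" form of the conditional-independence argument). Take the
resampling parameter `δ ∈ [0, 1]` with `1 − δ = √(1 − ε)`, so `(1 − δ)² = 1 − ε`. One coordinate of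
the kernel is the Gram matrix of the half-step kernel: `Σ_c P_δ(a, c) P_δ(b, c) = P_ε(a, b)`
(`rsp_coord_gram`), hence by `Fintype.prod_sum` the product kernel is
`P_ε(y, y') = Σ_z P_δ(y, z) P_δ(y', z)` (`rsp_kernel_gram`). The half-step kernel is stochastic
(`rsp_kernel_sum_eq_one`), so `Σ_{y,y'} P_ε f f' = Σ_z (Σ_y P_δ(y, z) f y)²` and
`Σ_z Σ_y P_δ(y, z) f y = Σ_y f y`, and Cauchy–Schwarz over the `#(ι → Γ)` values of `z`
(`sq_sum_le_card_mul_sum_sq`) gives the claim (`rsp_sq_sum_le_of_gram`). The two one-coordinate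
facts `rsp_coord_sum_eq_one`, `rsp_kernel_sum_eq_one` are re-proved here (three lines each) to keep
the file independent of `…ResampleKernelBasic`.

References: R. O'Donnell, *Analysis of Boolean Functions*, CUP 2014, §8.3–8.4 [ODonnell2014];
B. Huang, M. Sellke, *Strong low degree hardness for stable local optima in spin glasses*,
arXiv:2501.06427 (2025), §3.3 [HuangSellke2025].
-/

section Part3

namespace Literature.Computability.Complexity.HuangSellke2025Chain

open _root_.Finset

/-- One coordinate of the `δ`-resampling kernel is a probability vector:
`Σ_{c : Γ} ((1 − δ)·[a = c] + δ/|Γ|) = 1`. [cite: HuangSellke2025, §3.3.2, Lemma 3.22 (resample positivity)] -/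
theorem rsp_coord_sum_eq_one {Γ : Type*} [Fintype Γ] [DecidableEq Γ] [Nonempty Γ] (δ : ℝ)
    (a : Γ) : ∑ c : Γ, ((1 - δ) * (if a = c then (1 : ℝ) else 0) + δ / Fintype.card Γ) = 1 := by
  have hcard : (Fintype.card Γ : ℝ) ≠ 0 := by exact_mod_cast Fintype.card_ne_zero
  rw [Finset.sum_add_distrib, ← Finset.mul_sum, Finset.sum_ite_eq, if_pos (Finset.mem_univ a),
    Finset.sum_const, Finset.card_univ, nsmul_eq_mul, mul_div_cancel₀ _ hcard]
  ring

/-- The `δ`-resampling kernel on `ι → Γ` is stochastic: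
`Σ_z ∏_i ((1 − δ)·[y i = z i] + δ/|Γ|) = ∏_i 1 = 1` (`Fintype.prod_sum` read backwards).
[cite: HuangSellke2025, §3.3.2, Lemma 3.22 (resample positivity)] -/
theorem rsp_kernel_sum_eq_one {ι Γ : Type*} [Fintype ι] [DecidableEq ι] [Fintype Γ]
    [DecidableEq Γ] [Nonempty Γ] (δ : ℝ) (y : ι → Γ) :
    ∑ z : ι → Γ, ∏ i, ((1 - δ) * (if y i = z i then (1 : ℝ) else 0) + δ / Fintype.card Γ) = 1 := by
  rw [← Fintype.prod_sum fun i (c : Γ) =>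
    (1 - δ) * (if y i = c then (1 : ℝ) else 0) + δ / Fintype.card Γ]
  exact Finset.prod_eq_one fun i _ => rsp_coord_sum_eq_one δ (y i)

/-- **Half-step (semigroup) identity in one coordinate**: if `(1 − δ)² = 1 − ε` then
`Σ_c ((1 − δ)[a = c] + δ/|Γ|)·((1 − δ)[b = c] + δ/|Γ|) = (1 − ε)[a = b] + ε/|Γ|`, i.e. the
one-coordinate `ε`-resampling kernel is the Gram matrix of the `δ`-resampling kernel
(`T_{√ρ} ∘ T_{√ρ} = T_ρ`, O'Donnell 2014 §8.3). [cite: HuangSellke2025, §3.3.2, Lemma 3.22 (resample positivity)] -/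
theorem rsp_coord_gram {Γ : Type*} [Fintype Γ] [DecidableEq Γ] [Nonempty Γ] (ε δ : ℝ)
    (h : (1 - δ) ^ 2 = 1 - ε) (a b : Γ) :
    ∑ c : Γ, ((1 - δ) * (if a = c then (1 : ℝ) else 0) + δ / Fintype.card Γ) *
        ((1 - δ) * (if b = c then (1 : ℝ) else 0) + δ / Fintype.card Γ) =
      (1 - ε) * (if a = b then (1 : ℝ) else 0) + ε / Fintype.card Γ := by
  have hrow : ∑ c : Γ, ((1 - δ) * (if a = c then (1 : ℝ) else 0) + δ / Fintype.card Γ) = 1 :=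
    rsp_coord_sum_eq_one δ a
  have hpick : ∑ c : Γ, (if b = c then (1 : ℝ) else 0) *
      ((1 - δ) * (if a = c then (1 : ℝ) else 0) + δ / Fintype.card Γ) =
      (1 - δ) * (if a = b then (1 : ℝ) else 0) + δ / Fintype.card Γ := by
    simp_rw [boole_mul]
    rw [Finset.sum_ite_eq, if_pos (Finset.mem_univ b)]
  have hε : ε = 1 - (1 - δ) ^ 2 := by linarith
  calc ∑ c : Γ, ((1 - δ) * (if a = c then (1 : ℝ) else 0) + δ / Fintype.card Γ) *
        ((1 - δ) * (if b = c then (1 : ℝ) else 0) + δ / Fintype.card Γ)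
      = ∑ c : Γ, ((1 - δ) * ((if b = c then (1 : ℝ) else 0) *
          ((1 - δ) * (if a = c then (1 : ℝ) else 0) + δ / Fintype.card Γ)) +
          δ / Fintype.card Γ *
            ((1 - δ) * (if a = c then (1 : ℝ) else 0) + δ / Fintype.card Γ)) :=
        Finset.sum_congr rfl fun c _ => by ring
    _ = (1 - δ) * ∑ c : Γ, (if b = c then (1 : ℝ) else 0) *
          ((1 - δ) * (if a = c then (1 : ℝ) else 0) + δ / Fintype.card Γ) +
          δ / Fintype.card Γ *
            ∑ c : Γ, ((1 - δ) * (if a = c then (1 : ℝ) else 0) + δ / Fintype.card Γ) := by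
        rw [Finset.sum_add_distrib, ← Finset.mul_sum, ← Finset.mul_sum]
    _ = (1 - δ) * ((1 - δ) * (if a = b then (1 : ℝ) else 0) + δ / Fintype.card Γ) +
          δ / Fintype.card Γ * 1 := by rw [hpick, hrow]
    _ = (1 - ε) * (if a = b then (1 : ℝ) else 0) + ε / Fintype.card Γ := by
        rw [hε]; ring

/-- **Gram form of the product kernel**: if `(1 − δ)² = 1 − ε` then
`P_ε(y, y') = Σ_{z : ι → Γ} P_δ(y, z) · P_δ(y', z)` — the `ε`-resampling kernel on `ι → Γ` is one
`δ`-resampling half-step followed by a reversed one (coordinatewise `rsp_coord_gram`, then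
`Fintype.prod_sum`). [cite: HuangSellke2025, §3.3.2, Lemma 3.22 (resample positivity)] -/
theorem rsp_kernel_gram {ι Γ : Type*} [Fintype ι] [DecidableEq ι] [Fintype Γ] [DecidableEq Γ]
    [Nonempty Γ] (ε δ : ℝ) (h : (1 - δ) ^ 2 = 1 - ε) (y y' : ι → Γ) :
    (∏ i, ((1 - ε) * (if y i = y' i then (1 : ℝ) else 0) + ε / Fintype.card Γ)) =
      ∑ z : ι → Γ,
        (∏ i, ((1 - δ) * (if y i = z i then (1 : ℝ) else 0) + δ / Fintype.card Γ)) *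
          ∏ i, ((1 - δ) * (if y' i = z i then (1 : ℝ) else 0) + δ / Fintype.card Γ) := by
  simp_rw [← Finset.prod_mul_distrib]
  rw [← Fintype.prod_sum fun i (c : Γ) =>
    ((1 - δ) * (if y i = c then (1 : ℝ) else 0) + δ / Fintype.card Γ) *
      ((1 - δ) * (if y' i = c then (1 : ℝ) else 0) + δ / Fintype.card Γ)]
  exact Finset.prod_congr rfl fun i _ => (rsp_coord_gram ε δ h (y i) (y' i)).symm

/-- **Positivity of a Gram kernel with a stochastic factor** (abstract Cauchy–Schwarz step): if
`P y y' = Σ_z G y z · G y' z` and every row of `G` sums to `1`, then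
`(Σ_y f y)² ≤ #β · Σ_{y,y'} P y y' · f y · f y'`. Indeed `Σ_{y,y'} P f f' = Σ_z (Σ_y G y z f y)²`
and `Σ_z Σ_y G y z f y = Σ_y f y`. [cite: HuangSellke2025, §3.3.2, Lemma 3.22 (resample positivity)] -/
theorem rsp_sq_sum_le_of_gram {α β : Type*} [Fintype α] [Fintype β] (P : α → α → ℝ)
    (G : α → β → ℝ) (f : α → ℝ) (hP : ∀ y y', P y y' = ∑ z, G y z * G y' z)
    (hG : ∀ y, ∑ z, G y z = 1) :
    (∑ y, f y) ^ 2 ≤ Fintype.card β * ∑ y, ∑ y', P y y' * (f y * f y') := by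
  have hL : ∑ z, ∑ y, G y z * f y = ∑ y, f y := by
    rw [Finset.sum_comm]
    refine Finset.sum_congr rfl fun y _ => ?_
    rw [← Finset.sum_mul, hG y, one_mul]
  have hR : ∑ y, ∑ y', P y y' * (f y * f y') = ∑ z, (∑ y, G y z * f y) ^ 2 := by
    calc ∑ y, ∑ y', P y y' * (f y * f y')
        = ∑ y, ∑ y', ∑ z, (G y z * f y) * (G y' z * f y') := by
          refine Finset.sum_congr rfl fun y _ => Finset.sum_congr rfl fun y' _ => ?_
          rw [hP, Finset.sum_mul]
          exact Finset.sum_congr rfl fun z _ => by ring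
      _ = ∑ y, ∑ z, ∑ y', (G y z * f y) * (G y' z * f y') :=
          Finset.sum_congr rfl fun y _ => Finset.sum_comm
      _ = ∑ z, ∑ y, ∑ y', (G y z * f y) * (G y' z * f y') := Finset.sum_comm
      _ = ∑ z, (∑ y, G y z * f y) ^ 2 := by
          refine Finset.sum_congr rfl fun z _ => ?_
          rw [sq, Finset.sum_mul_sum]
  calc (∑ y, f y) ^ 2 = (∑ z, ∑ y, G y z * f y) ^ 2 := by rw [hL]
    _ ≤ #(univ : Finset β) * ∑ z, (∑ y, G y z * f y) ^ 2 := sq_sum_le_card_mul_sum_sq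
    _ = Fintype.card β * ∑ y, ∑ y', P y y' * (f y * f y') := by rw [Finset.card_univ, hR]

/-- **One-step positivity of the `ε`-resampling kernel** (O'Donnell 2014 §8.3–8.4; Huang–Sellke
2025 §3.3, proof of Lemma 3.15): for `0 ≤ ε ≤ 1` and every `f : (ι → Γ) → ℝ`,
`(Σ_y f y)² ≤ #(ι → Γ) · Σ_{y,y'} P_ε(y, y') · f y · f y'` with
`P_ε(y, y') = ∏_i ((1 − ε)·[y i = y' i] + ε/|Γ|)`. Proof: `P_ε = P_δ P_δᵀ` for the half-step
resampling parameter `δ ∈ [0, 1]`, `1 − δ = √(1 − ε)` (`rsp_kernel_gram`), `P_δ` is stochastic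
(`rsp_kernel_sum_eq_one`), and Cauchy–Schwarz (`rsp_sq_sum_le_of_gram`).
[cite: HuangSellke2025, §3.3.2, Lemma 3.22 (resample positivity)] -/
theorem stub_resamplePositivity {ι Γ : Type*} [Fintype ι] [DecidableEq ι] [Fintype Γ]
    [DecidableEq Γ] [Nonempty Γ] (ε : ℝ) (hε0 : 0 ≤ ε) (hε1 : ε ≤ 1) (f : (ι → Γ) → ℝ) :
    (∑ y, f y) ^ 2 ≤ Fintype.card (ι → Γ) *
      ∑ y : ι → Γ, ∑ y' : ι → Γ,
        (∏ i, ((1 - ε) * (if y i = y' i then (1 : ℝ) else 0) + ε / Fintype.card Γ)) *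
          (f y * f y') := by
  -- the half-step resampling parameter `δ = 1 − √(1 − ε) ∈ [0, 1]`, `(1 − δ)² = 1 − ε`
  -- (only the last property is consumed below: positivity needs `ε ≤ 1` alone)
  obtain ⟨δ, -, -, hsq⟩ : ∃ δ : ℝ, 0 ≤ δ ∧ δ ≤ 1 ∧ (1 - δ) ^ 2 = 1 - ε := by
    refine ⟨1 - Real.sqrt (1 - ε), ?_, ?_, ?_⟩
    · exact sub_nonneg.mpr (Real.sqrt_le_one.mpr (by linarith))
    · linarith [Real.sqrt_nonneg (1 - ε)]
    · rw [sub_sub_cancel, Real.sq_sqrt (sub_nonneg.mpr hε1)]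
  exact rsp_sq_sum_le_of_gram
    (fun y y' : ι → Γ => ∏ i, ((1 - ε) * (if y i = y' i then (1 : ℝ) else 0) + ε / Fintype.card Γ))
    (fun y z : ι → Γ => ∏ i, ((1 - δ) * (if y i = z i then (1 : ℝ) else 0) + δ / Fintype.card Γ))
    f (fun y y' => rsp_kernel_gram ε δ hsq y y') (fun y => rsp_kernel_sum_eq_one δ y)

end Literature.Computability.Complexity.HuangSellke2025Chain

end Part3

/-!
## Part 4 — port of `Summits/PneNP/PneNP/Theorems/OverlapGapAlgebraSearchHardWindowResampleStability.lean` (13 declarations kept)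

# Route OverlapGapAlgebra, crux `SearchHardWindow` (stmt-PneNP-2460): `L²`-stability of low
# coordinate-degree functions under the `ε`-resampling kernel (Huang–Sellke 2025, Prop. 3.14)

On the finite product space `ι → Γ` (uniform measure, counting form) the `ε`-resampling kernel
`P_ε(y, y') = ∏_i ((1 − ε)·[y i = y' i] + ε/|Γ|)` keeps each coordinate with probability `1 − ε`
and resamples it uniformly from `Γ` with probability `ε`, independently over the coordinates
(O'Donnell 2014 Def. 8.26; Huang–Sellke 2025, arXiv:2501.06427 §3.3). `stub_resampleStability` is
Huang–Sellke's Prop. 3.14 in second-moment form: a function `F` of coordinate (Efron–Stein) degree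
`≤ D` (`IsCoordDegreeLE D F`: a finite sum of `D`-juntas) satisfies
`Σ_{y,y'} P_ε(y,y') (F y − F y')² ≤ 2ε(1 + ε|ι|)·D·Σ_y F y²` for `0 ≤ ε ≤ 1` (we prove the sharp
`2εD Σ F²` and weaken).

Proof (the spectral route of O'Donnell 2014 §8.3–8.4 through the tree's Hoeffding decomposition
`Literature.Probability.Moments.hoeffdingComp`, all steps proved here):
* expanding the product over the set `J` of kept coordinates (`Fintype.prod_add`) writes the
  kernel as a mixture of "agree on `J`" indicators (`rss_kernel_expand`), and counting the fibres
  of the gluing map `z ↦ Jᶜ.piecewise z y` (`Fintype.prod_sum`, `rss_fibre`, `rss_push`) turns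
  each of them into the coordinate averaging `E_{Jᶜ} = coordAvg Jᶜ`:
  `Σ_{y'} P_ε(y,y') H y' = Σ_J (1−ε)^{#J} ε^{#Jᶜ} · E_{Jᶜ} H y` (`rss_action`);
* hence the quadratic form is diagonal in the Hoeffding components (`rss_quad`):
  `Σ_{y,y'} P_ε F y F y' = Σ_J (1−ε)^{#J} ε^{#Jᶜ} ‖E_{Jᶜ} F‖²
  = Σ_S (Σ_{J ⊇ S} (1−ε)^{#J} ε^{#Jᶜ}) ‖F^{=S}‖² = Σ_S (1−ε)^{#S} ‖F^{=S}‖²`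
  (`sum_coordAvg_sq`, `sum_hoeffdingComp_powerset`, `sum_sq_sum_hoeffdingComp`, and the
  binomial theorem on `Sᶜ`, `rss_binom`);
* the kernel is symmetric and stochastic (`rss_kernel_symm`, `rss_kernel_rowsum`), so
  `Σ P_ε (F y − F y')² = 2 Σ_S (1 − (1−ε)^{#S}) ‖F^{=S}‖²`, and Bernoulli's inequality
  (`one_add_mul_le_pow`) together with `F^{=S} = 0` for `#S > D`
  (`hoeffdingComp_eq_zero_of_degree`) bounds this by `2εD Σ_S ‖F^{=S}‖² = 2εD Σ_y F y²`
  (Parseval, `sum_sq_eq_sum_hoeffdingComp_sq`), which is at most the registered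
  `2ε(1 + ε|ι|) D Σ_y F y²` (`rss_main_abstract`, `stub_resampleStability`).

References: B. Huang, M. Sellke, arXiv:2501.06427 (2025), §3.3 Prop. 3.14 [HuangSellke2025];
R. O'Donnell, *Analysis of Boolean Functions*, CUP 2014, §8.3–8.4 [ODonnell2014].
-/

section Part4

namespace Literature.Computability.Complexity.HuangSellke2025Chain

open _root_.Finset Literature.Probability.Moments
open Literature.Computability.Complexity (IsCoordDegreeLE)

section Helpers

variable {ι Γ : Type*} [Fintype ι] [DecidableEq ι] [Fintype Γ] [DecidableEq Γ]

/-! ### The kernel: one coordinate, stochasticity, symmetry, expansion over kept coordinates -/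

/-- One coordinate of the resampling kernel is a probability vector:
`∑_{c : Γ} ((1 − ε)·[a = c] + ε/|Γ|) = 1`. [cite: HuangSellke2025, §3.3.2, Lemma 3.22 (resample stability)] -/
theorem rss_coord_sum_eq_one [Nonempty Γ] (ε : ℝ) (a : Γ) :
    ∑ c : Γ, ((1 - ε) * (if a = c then (1 : ℝ) else 0) + ε / Fintype.card Γ) = 1 := by
  have hcard : (Fintype.card Γ : ℝ) ≠ 0 := by exact_mod_cast Fintype.card_ne_zero
  rw [Finset.sum_add_distrib, ← Finset.mul_sum, Finset.sum_ite_eq, if_pos (Finset.mem_univ a),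
    Finset.sum_const, Finset.card_univ, nsmul_eq_mul, mul_div_cancel₀ _ hcard]
  ring

/-- The resampling kernel is stochastic: `∑_{y'} P_ε(y, y') = 1` (`Fintype.prod_sum` read right
to left, then the one-coordinate identity `rss_coord_sum_eq_one`).
[cite: HuangSellke2025, §3.3.2, Lemma 3.22 (resample stability)] -/
theorem rss_kernel_rowsum [Nonempty Γ] (ε : ℝ) (y : ι → Γ) :
    ∑ y' : ι → Γ, ∏ i, ((1 - ε) * (if y i = y' i then (1 : ℝ) else 0) + ε / Fintype.card Γ)
      = 1 := by
  rw [← Fintype.prod_sum (fun i (c : Γ) =>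
    (1 - ε) * (if y i = c then (1 : ℝ) else 0) + ε / Fintype.card Γ)]
  exact Finset.prod_eq_one fun i _ => rss_coord_sum_eq_one ε (y i)

omit [DecidableEq ι] in
/-- The resampling kernel is symmetric in `(y, y')`.
[cite: HuangSellke2025, §3.3.2, Lemma 3.22 (resample stability)] -/
theorem rss_kernel_symm (ε : ℝ) (y y' : ι → Γ) :
    (∏ i, ((1 - ε) * (if y i = y' i then (1 : ℝ) else 0) + ε / Fintype.card Γ)) =
      ∏ i, ((1 - ε) * (if y' i = y i then (1 : ℝ) else 0) + ε / Fintype.card Γ) :=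
  Finset.prod_congr rfl fun i _ => by simp only [eq_comm]

/-- Expansion of the kernel over the set `J` of kept coordinates (`Fintype.prod_add`):
`P_ε(y, y') = Σ_J (1−ε)^{#J} (ε/|Γ|)^{#Jᶜ} ∏_{i ∈ J} [y i = y' i]`.
[cite: HuangSellke2025, §3.3.2, Lemma 3.22 (resample stability)] -/
theorem rss_kernel_expand (ε : ℝ) (y y' : ι → Γ) :
    (∏ i, ((1 - ε) * (if y i = y' i then (1 : ℝ) else 0) + ε / Fintype.card Γ)) =
      ∑ J : Finset ι, (1 - ε) ^ J.card * (ε / Fintype.card Γ) ^ Jᶜ.card *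
        ∏ i ∈ J, (if y i = y' i then (1 : ℝ) else 0) := by
  rw [Fintype.prod_add]
  refine Finset.sum_congr rfl fun J _ => ?_
  rw [Finset.prod_mul_distrib, Finset.prod_const, Finset.prod_const]
  ring

/-! ### The gluing map `z ↦ Jᶜ.piecewise z y` and the action of the kernel -/

/-- Fibre count of the gluing map `z ↦ Jᶜ.piecewise z y` (coordinates in `J` taken from `y`, the
others from `z`): it hits `y'` exactly `|Γ|^{#J} · [y' agrees with y on J]` times
(`Fintype.prod_sum`: the indicator of `Jᶜ.piecewise z y = y'` factors over the coordinates).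
[cite: HuangSellke2025, §3.3.2, Lemma 3.22 (resample stability)] -/
theorem rss_fibre (J : Finset ι) (y y' : ι → Γ) :
    ∑ z : ι → Γ, (if Jᶜ.piecewise z y = y' then (1 : ℝ) else 0) =
      (Fintype.card Γ : ℝ) ^ J.card * ∏ i ∈ J, (if y i = y' i then (1 : ℝ) else 0) := by
  -- the indicator of `Jᶜ.piecewise z y = y'` factors over the coordinates
  have h1 : ∀ z : ι → Γ, (if Jᶜ.piecewise z y = y' then (1 : ℝ) else 0) =
      ∏ i, (if (if i ∈ Jᶜ then z i else y i) = y' i then (1 : ℝ) else 0) := by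
    intro z
    rw [Fintype.prod_boole]
    exact if_congr (by simp only [funext_iff, Finset.piecewise]) rfl rfl
  simp only [h1]
  rw [← Fintype.prod_sum (fun i (a : Γ) =>
    if (if i ∈ Jᶜ then a else y i) = y' i then (1 : ℝ) else 0)]
  -- one coordinate at a time
  have h2 : ∀ i : ι, (∑ a : Γ, if (if i ∈ Jᶜ then a else y i) = y' i then (1 : ℝ) else 0) =
      if i ∈ J then (Fintype.card Γ : ℝ) * (if y i = y' i then (1 : ℝ) else 0) else 1 := by
    intro i
    by_cases hi : i ∈ J
    · have hi' : i ∉ Jᶜ := fun h => (Finset.mem_compl.1 h) hi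
      simp only [hi', if_false, hi, if_true, Finset.sum_const, Finset.card_univ, nsmul_eq_mul]
    · have hi' : i ∈ Jᶜ := Finset.mem_compl.2 hi
      simp only [hi', if_true, hi, if_false, Finset.sum_ite_eq', Finset.mem_univ]
  simp only [h2]
  rw [Fintype.prod_ite_mem, Finset.prod_mul_distrib, Finset.prod_const]

/-- Pushing a sum forward along the gluing map:
`Σ_z H (Jᶜ.piecewise z y) = |Γ|^{#J} · Σ_{y'} [y' agrees with y on J] · H y'`.
[cite: HuangSellke2025, §3.3.2, Lemma 3.22 (resample stability)] -/
theorem rss_push (J : Finset ι) (H : (ι → Γ) → ℝ) (y : ι → Γ) :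
    ∑ z : ι → Γ, H (Jᶜ.piecewise z y) =
      (Fintype.card Γ : ℝ) ^ J.card *
        ∑ y' : ι → Γ, (∏ i ∈ J, (if y i = y' i then (1 : ℝ) else 0)) * H y' := by
  calc ∑ z : ι → Γ, H (Jᶜ.piecewise z y)
      = ∑ z : ι → Γ, ∑ y' : ι → Γ, (if Jᶜ.piecewise z y = y' then H y' else 0) := by
        refine Finset.sum_congr rfl fun z _ => ?_
        rw [Fintype.sum_ite_eq]
    _ = ∑ y' : ι → Γ, ∑ z : ι → Γ, (if Jᶜ.piecewise z y = y' then H y' else 0) := Finset.sum_comm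
    _ = ∑ y' : ι → Γ, (∑ z : ι → Γ, (if Jᶜ.piecewise z y = y' then (1 : ℝ) else 0)) * H y' := by
        refine Finset.sum_congr rfl fun y' _ => ?_
        rw [Finset.sum_mul]
        exact Finset.sum_congr rfl fun z _ => (boole_mul _ _).symm
    _ = (Fintype.card Γ : ℝ) ^ J.card *
          ∑ y' : ι → Γ, (∏ i ∈ J, (if y i = y' i then (1 : ℝ) else 0)) * H y' := by
        rw [Finset.mul_sum]
        refine Finset.sum_congr rfl fun y' _ => ?_
        rw [rss_fibre, mul_assoc]

/-- **The kernel as a mixture of coordinate averagings** (the `ε`-noise operator is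
`∏_i ((1−ε)·id + ε·E_i) = Σ_J (1−ε)^{#J} ε^{#Jᶜ} E_{Jᶜ}`, O'Donnell 2014 §8.3): for every `H`
and `y`, `Σ_{y'} P_ε(y, y') H y' = Σ_J (1−ε)^{#J} ε^{#Jᶜ} · E_{Jᶜ} H y`.
[cite: HuangSellke2025, §3.3.2, Lemma 3.22 (resample stability)] -/
theorem rss_action [Nonempty Γ] (ε : ℝ) (H : (ι → Γ) → ℝ) (y : ι → Γ) :
    ∑ y' : ι → Γ,
        (∏ i, ((1 - ε) * (if y i = y' i then (1 : ℝ) else 0) + ε / Fintype.card Γ)) * H y' =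
      ∑ J : Finset ι, (1 - ε) ^ J.card * ε ^ Jᶜ.card * coordAvg Jᶜ H y := by
  have hΓ : (Fintype.card Γ : ℝ) ≠ 0 := by exact_mod_cast Fintype.card_ne_zero
  simp only [rss_kernel_expand ε, Finset.sum_mul]
  rw [Finset.sum_comm]
  refine Finset.sum_congr rfl fun J _ => ?_
  have hS : ∑ y' : ι → Γ, (1 - ε) ^ J.card * (ε / Fintype.card Γ) ^ Jᶜ.card *
        (∏ i ∈ J, (if y i = y' i then (1 : ℝ) else 0)) * H y' =
      ((1 - ε) ^ J.card * (ε / Fintype.card Γ) ^ Jᶜ.card) *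
        ∑ y' : ι → Γ, (∏ i ∈ J, (if y i = y' i then (1 : ℝ) else 0)) * H y' := by
    rw [Finset.mul_sum]
    exact Finset.sum_congr rfl fun y' _ => by ring
  rw [hS, coordAvg_apply, rss_push, Fintype.card_fun, ← Finset.card_add_card_compl J, pow_add,
    div_pow]
  push_cast
  rw [mul_div_mul_left _ _ (pow_ne_zero _ hΓ)]
  ring

/-! ### The quadratic form through the Hoeffding components -/

/-- The marginal of the mixture weights (binomial theorem on `Sᶜ` after the reindexing
`J = S ∪ T`, `T ⊆ Sᶜ`): `Σ_{J ⊇ S} (1−ε)^{#J} ε^{#Jᶜ} = (1−ε)^{#S}`.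
[cite: HuangSellke2025, §3.3.2, Lemma 3.22 (resample stability)] -/
theorem rss_binom (ε : ℝ) (S : Finset ι) :
    ∑ J ∈ (univ : Finset (Finset ι)).filter (fun J => S ⊆ J), (1 - ε) ^ J.card * ε ^ Jᶜ.card =
      (1 - ε) ^ S.card := by
  have hre : ∑ J ∈ (univ : Finset (Finset ι)).filter (fun J => S ⊆ J),
      (1 - ε) ^ J.card * ε ^ Jᶜ.card =
      ∑ T ∈ Sᶜ.powerset, (1 - ε) ^ S.card * ((∏ _i ∈ T, (1 - ε)) * ∏ _i ∈ Sᶜ \ T, ε) := by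
    refine Finset.sum_nbij' (fun J => J \ S) (fun T => S ∪ T) ?_ ?_ ?_ ?_ ?_
    · intro J _
      rw [mem_powerset]
      intro i hi
      exact Finset.mem_compl.2 (Finset.mem_sdiff.1 hi).2
    · intro T _
      simp only [mem_filter, mem_univ, true_and]
      exact subset_union_left
    · intro J hJ
      simp only [mem_filter, mem_univ, true_and] at hJ
      exact union_sdiff_of_subset hJ
    · intro T hT
      rw [mem_powerset] at hT
      rw [union_sdiff_left, Finset.sdiff_eq_self_iff_disjoint]
      exact disjoint_compl_left.mono_left hT
    · intro J hJ
      simp only [mem_filter, mem_univ, true_and] at hJ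
      have h1 : Sᶜ \ (J \ S) = Jᶜ := by
        ext i
        have := @hJ i
        simp only [mem_sdiff, mem_compl]
        tauto
      rw [prod_const, prod_const, h1, ← mul_assoc, ← pow_add, add_comm,
        card_sdiff_add_card_eq_card hJ]
  rw [hre, ← Finset.mul_sum, ← Finset.prod_add]
  simp

/-- Swapping a weighted sum over the pairs `S ⊆ J`:
`Σ_J w_J Σ_{S ⊆ J} a_S = Σ_S (Σ_{J ⊇ S} w_J) a_S`. [cite: HuangSellke2025, §3.3.2, Lemma 3.22 (resample stability)] -/
theorem rss_swap (w a : Finset ι → ℝ) :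
    ∑ J : Finset ι, w J * ∑ S ∈ J.powerset, a S =
      ∑ S : Finset ι, (∑ J ∈ (univ : Finset (Finset ι)).filter (fun J => S ⊆ J), w J) * a S := by
  simp_rw [Finset.mul_sum, Finset.sum_mul]
  exact Finset.sum_comm' fun J S => by
    simp only [mem_univ, mem_powerset, mem_filter, true_and, and_true]

/-- **The quadratic form of the kernel is diagonal in the Hoeffding components**, with
eigenvalue `(1−ε)^{#S}` at level `S` (O'Donnell 2014 §8.3, noise stability):
`Σ_{y,y'} P_ε(y,y') F y F y' = Σ_S (1−ε)^{#S} ‖F^{=S}‖²`.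
[cite: HuangSellke2025, §3.3.2, Lemma 3.22 (resample stability)] -/
theorem rss_quad [Nonempty Γ] (ε : ℝ) (F : (ι → Γ) → ℝ) :
    ∑ y : ι → Γ, ∑ y' : ι → Γ,
        (∏ i, ((1 - ε) * (if y i = y' i then (1 : ℝ) else 0) + ε / Fintype.card Γ)) *
          (F y * F y') =
      ∑ S : Finset ι, (1 - ε) ^ S.card * ∑ y, hoeffdingComp S F y ^ 2 := by
  -- let the kernel act on `F` and pull out `F y`
  have h1 : ∀ y : ι → Γ, ∑ y' : ι → Γ,
      (∏ i, ((1 - ε) * (if y i = y' i then (1 : ℝ) else 0) + ε / Fintype.card Γ)) *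
        (F y * F y') =
      F y * ∑ J : Finset ι, (1 - ε) ^ J.card * ε ^ Jᶜ.card * coordAvg Jᶜ F y := by
    intro y
    rw [← rss_action ε F y, Finset.mul_sum]
    exact Finset.sum_congr rfl fun y' _ => by ring
  simp only [h1]
  -- `Σ_y F y · E_{Jᶜ} F y = ‖E_{Jᶜ} F‖² = Σ_{S ⊆ J} ‖F^{=S}‖²`
  have h2 : ∀ J : Finset ι, ∑ y : ι → Γ, F y * coordAvg Jᶜ F y =
      ∑ S ∈ J.powerset, ∑ y, hoeffdingComp S F y ^ 2 := by
    intro J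
    rw [← sum_coordAvg_sq Jᶜ F, ← sum_sq_sum_hoeffdingComp J.powerset F]
    simp only [sum_hoeffdingComp_powerset]
  calc ∑ y : ι → Γ, F y * ∑ J : Finset ι, (1 - ε) ^ J.card * ε ^ Jᶜ.card * coordAvg Jᶜ F y
      = ∑ y : ι → Γ, ∑ J : Finset ι,
          (1 - ε) ^ J.card * ε ^ Jᶜ.card * (F y * coordAvg Jᶜ F y) := by
        refine Finset.sum_congr rfl fun y _ => ?_
        rw [Finset.mul_sum]
        exact Finset.sum_congr rfl fun J _ => by ring
    _ = ∑ J : Finset ι, (1 - ε) ^ J.card * ε ^ Jᶜ.card * ∑ y : ι → Γ, F y * coordAvg Jᶜ F y := by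
        rw [Finset.sum_comm]
        exact Finset.sum_congr rfl fun J _ => by rw [Finset.mul_sum]
    _ = ∑ J : Finset ι, ((1 - ε) ^ J.card * ε ^ Jᶜ.card) *
          ∑ S ∈ J.powerset, ∑ y, hoeffdingComp S F y ^ 2 :=
        Finset.sum_congr rfl fun J _ => by rw [h2]
    _ = ∑ S : Finset ι, (∑ J ∈ (univ : Finset (Finset ι)).filter (fun J => S ⊆ J),
          (1 - ε) ^ J.card * ε ^ Jᶜ.card) * ∑ y, hoeffdingComp S F y ^ 2 :=
        rss_swap (fun J => (1 - ε) ^ J.card * ε ^ Jᶜ.card) (fun S => ∑ y, hoeffdingComp S F y ^ 2)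
    _ = ∑ S : Finset ι, (1 - ε) ^ S.card * ∑ y, hoeffdingComp S F y ^ 2 :=
        Finset.sum_congr rfl fun S _ => by rw [rss_binom]

/-! ### Bernoulli and the abstract second-moment bound -/

/-- Bernoulli's inequality in the form `1 − (1 − ε)^n ≤ n ε` (for `ε ≤ 1`; in fact `ε ≤ 2`
suffices, `one_add_mul_le_pow`). [cite: HuangSellke2025, §3.3.2, Lemma 3.22 (resample stability)] -/
theorem rss_bernoulli (ε : ℝ) (hε1 : ε ≤ 1) (n : ℕ) : 1 - (1 - ε) ^ n ≤ n * ε := by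
  have h := one_add_mul_le_pow (show (-2 : ℝ) ≤ -ε by linarith) n
  have h' : (1 : ℝ) + -ε = 1 - ε := by ring
  rw [h'] at h
  linarith

omit [DecidableEq Γ] in
/-- **Abstract second-moment stability**: if a kernel `P` on `ι → Γ` is stochastic in both
arguments and its quadratic form on `F` is `Σ_S (1−ε)^{#S} ‖F^{=S}‖²`, where `F` is a finite sum
of `D`-juntas, then `Σ_{y,y'} P(y,y') (F y − F y')² ≤ 2εD · Σ_y F y²` (expand the square, Parseval
`sum_sq_eq_sum_hoeffdingComp_sq`, Bernoulli, and `F^{=S} = 0` for `#S > D`).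
[cite: HuangSellke2025, §3.3.2, Lemma 3.22 (resample stability)] -/
theorem rss_main_abstract [Nonempty Γ] (ε : ℝ) (hε0 : 0 ≤ ε) (hε1 : ε ≤ 1) {D : ℕ}
    {F : (ι → Γ) → ℝ}
    (hF : ∃ (𝒮 : Finset (Finset ι)) (G : Finset ι → (ι → Γ) → ℝ),
      (∀ T ∈ 𝒮, T.card ≤ D ∧ DependsOn (G T) (↑T : Set ι)) ∧ ∀ y, F y = ∑ T ∈ 𝒮, G T y)
    (P : (ι → Γ) → (ι → Γ) → ℝ) (hrow : ∀ y, ∑ y', P y y' = 1) (hcol : ∀ y', ∑ y, P y y' = 1)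
    (hquad : ∑ y, ∑ y', P y y' * (F y * F y') =
      ∑ S : Finset ι, (1 - ε) ^ S.card * ∑ y, hoeffdingComp S F y ^ 2) :
    ∑ y, ∑ y', P y y' * (F y - F y') ^ 2 ≤ 2 * ε * D * ∑ y, F y ^ 2 := by
  -- expand the square using stochasticity in both arguments
  have hexp : ∑ y, ∑ y', P y y' * (F y - F y') ^ 2 =
      2 * ∑ y, F y ^ 2 - 2 * ∑ y, ∑ y', P y y' * (F y * F y') := by
    have h1 : ∀ y, ∑ y', F y ^ 2 * P y y' = F y ^ 2 := fun y => by
      rw [← Finset.mul_sum, hrow, mul_one]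
    have h2 : ∑ y, ∑ y', P y y' * F y' ^ 2 = ∑ y', F y' ^ 2 := by
      rw [Finset.sum_comm]
      refine Finset.sum_congr rfl fun y' _ => ?_
      rw [← Finset.sum_mul, hcol, one_mul]
    calc ∑ y, ∑ y', P y y' * (F y - F y') ^ 2
        = ∑ y, ∑ y', (F y ^ 2 * P y y' + P y y' * F y' ^ 2 - 2 * (P y y' * (F y * F y'))) :=
          Finset.sum_congr rfl fun y _ => Finset.sum_congr rfl fun y' _ => by ring
      _ = ∑ y, (F y ^ 2 + ∑ y', P y y' * F y' ^ 2 - 2 * ∑ y', P y y' * (F y * F y')) := by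
          refine Finset.sum_congr rfl fun y _ => ?_
          rw [Finset.sum_sub_distrib, Finset.sum_add_distrib, h1, Finset.mul_sum]
      _ = 2 * ∑ y, F y ^ 2 - 2 * ∑ y, ∑ y', P y y' * (F y * F y') := by
          rw [Finset.sum_sub_distrib, Finset.sum_add_distrib, h2, ← Finset.mul_sum]
          ring
  rw [hexp, hquad, sum_sq_eq_sum_hoeffdingComp_sq F, Finset.powerset_univ, Finset.mul_sum,
    Finset.mul_sum, Finset.mul_sum, ← Finset.sum_sub_distrib]
  refine Finset.sum_le_sum fun S _ => ?_
  have ha : 0 ≤ ∑ y, hoeffdingComp S F y ^ 2 := Finset.sum_nonneg fun y _ => sq_nonneg _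
  by_cases hS : S.card ≤ D
  · have hb : 1 - (1 - ε) ^ S.card ≤ D * ε :=
      (rss_bernoulli ε hε1 S.card).trans (mul_le_mul_of_nonneg_right (by exact_mod_cast hS) hε0)
    have key := mul_le_mul_of_nonneg_right hb ha
    linarith
  · have hz : ∑ y, hoeffdingComp S F y ^ 2 = 0 := by
      simp [hoeffdingComp_eq_zero_of_degree hF (not_le.1 hS)]
    simp [hz]

end Helpers

/-- **`L²`-stability of low coordinate-degree functions under the `ε`-resampling kernel**
(Huang–Sellke 2025, arXiv:2501.06427, Prop. 3.14, second-moment form; O'Donnell 2014 §8.3–8.4):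
on the finite product space `ι → Γ` with the uniform measure, for `0 ≤ ε ≤ 1` and every `F` of
coordinate (Efron–Stein) degree `≤ D`,
`Σ_{y,y'} P_ε(y,y') (F y − F y')² ≤ 2ε(1 + ε|ι|)·D·Σ_y F y²`, where
`P_ε(y,y') = ∏_i ((1−ε)·[y i = y' i] + ε/|Γ|)`. (The sharp constant `2εD` is proved in
`rss_main_abstract`; `1 ≤ 1 + ε|ι|` gives the registered form.)
[cite: HuangSellke2025, §3.3.2, Lemma 3.22 (resample stability)] -/
theorem stub_resampleStability {ι Γ : Type*} [Fintype ι] [DecidableEq ι] [Fintype Γ]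
    [DecidableEq Γ] [Nonempty Γ] (ε : ℝ) (hε0 : 0 ≤ ε) (hε1 : ε ≤ 1) {D : ℕ} {F : (ι → Γ) → ℝ}
    (hF : IsCoordDegreeLE D F) :
    ∑ y : ι → Γ, ∑ y' : ι → Γ,
        (∏ i, ((1 - ε) * (if y i = y' i then (1 : ℝ) else 0) + ε / Fintype.card Γ)) *
          (F y - F y') ^ 2
      ≤ 2 * ε * (1 + ε * Fintype.card ι) * D * ∑ y, F y ^ 2 := by
  have hcol : ∀ y' : ι → Γ,
      ∑ y : ι → Γ, (∏ i, ((1 - ε) * (if y i = y' i then (1 : ℝ) else 0) + ε / Fintype.card Γ))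
        = 1 :=
    fun y' => (Finset.sum_congr rfl fun y _ => rss_kernel_symm ε y y').trans
      (rss_kernel_rowsum ε y')
  have hmain := rss_main_abstract ε hε0 hε1 hF
    (fun y y' => ∏ i, ((1 - ε) * (if y i = y' i then (1 : ℝ) else 0) + ε / Fintype.card Γ))
    (rss_kernel_rowsum ε) hcol (rss_quad ε F)
  have hX : 0 ≤ ∑ y, F y ^ 2 := Finset.sum_nonneg fun y _ => sq_nonneg _
  have hD : (0 : ℝ) ≤ D := Nat.cast_nonneg D
  have hextra : 0 ≤ 2 * ε * (ε * Fintype.card ι) * D * ∑ y, F y ^ 2 := by positivity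
  calc _ ≤ 2 * ε * D * ∑ y, F y ^ 2 := hmain
    _ = 2 * ε * (1 + ε * Fintype.card ι) * D * ∑ y, F y ^ 2
          - 2 * ε * (ε * Fintype.card ι) * D * ∑ y, F y ^ 2 := by ring
    _ ≤ 2 * ε * (1 + ε * Fintype.card ι) * D * ∑ y, F y ^ 2 := by linarith

end Literature.Computability.Complexity.HuangSellke2025Chain

end Part4

/-!
## Part 5 — port of `Summits/PneNP/PneNP/Theorems/OverlapGapAlgebraSearchHardWindowInstability.lean` (2 declarations kept)

# Route OverlapGapAlgebra, crux `SearchHardWindow` (stmt-PneNP-2460): the one-step instability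
# bound of the `ε`-resampling chain (Markov on top of `L²`-stability)

Instances of random `k`-SAT are literal arrays; the resampling chain lives on the UNCURRIED space
`S = (Fin m × Fin k → Fin n × Bool)` with the `ε`-resampling kernel
`P_ε(y, y') = ∏_i ((1 − ε)·[y i = y' i] + ε/|Γ|)`
(`Literature.Computability.Complexity.resampleKernel`), and a (low-degree) algorithm outputs the
real vector `F (curry y) : Fin n → ℝ`.

`stub_instability` (Huang–Sellke 2025, arXiv:2501.06427 §3.3, the Markov step of the proof of
Cor. 3.21): if every output coordinate is `L²`-stable under the kernel,
`Σ_{y,y'} P_ε(y,y') (F_v y − F_v y')² ≤ 2ε(1 + ε·#(Fin m × Fin k))·D·Σ_y F_v y²` (hypothesis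
`hStab`, the landed `stub_resampleStability` instantiated), and the energy is bounded,
`Σ_Φ Σ_v F Φ v² ≤ C·n·#Φ` (hypothesis `hener`, over the CURRIED instance space), then the kernel
mass of the pairs `(y, y')` whose outputs move by MORE than `θ·n` in squared Euclidean norm is at
most `(2ε(1 + ε m k) D C / θ)·#S`.

Proof: pointwise Markov `[s > θ n] ≤ s/(θ n)` for `s = Σ_v (F_v y − F_v y')² ≥ 0` against the
nonnegative kernel weights (`cmb_kernel_nonneg` of the landed chain-mass module
`OverlapGapAlgebraSearchHardWindowChainMassBasic`, and `ins_indicator_le`); swap the sums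
(`Finset.sum_comm`), apply `hStab` coordinatewise, reindex the energy along the currying bijection
`Equiv.curry` (`Fintype.sum_equiv`, `Fintype.card_congr`), apply `hener`, and simplify
`#(Fin m × Fin k) = m k`, `(1/(θ n))·(C n #S) = (C/θ)·#S`.
-/

section Part5

namespace Literature.Computability.Complexity.HuangSellke2025Chain

open _root_.Finset
open Literature.Computability.Complexity
open scoped _root_.Classical

/-- Pointwise Markov: the indicator of `s > t` is at most `s / t` for `s ≥ 0`, `t > 0`.
[cite: HuangSellke2025, §3.3.2, Lemma 3.22 (the instability leg)] -/
theorem ins_indicator_le {s t : ℝ} [Decidable (s ≤ t)] (hs : 0 ≤ s) (ht : 0 < t) :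
    (if s ≤ t then (0 : ℝ) else 1) ≤ s / t := by
  split_ifs with h
  · exact div_nonneg hs ht.le
  · exact (one_le_div ht).2 (not_le.1 h).le

/-- **One-step instability bound of the resampling chain** (Markov on top of the `L²`-stability
`hStab` of each output coordinate; Huang–Sellke 2025, arXiv:2501.06427 §3.3): for a vector-valued
`F` on literal arrays with energy `Σ_Φ Σ_v F Φ v² ≤ C n #Φ`, the kernel mass of the pairs `(y, y')`
whose outputs move by more than `θ n` in squared Euclidean norm is
`≤ (2ε(1 + ε m k) D C / θ) · #(Fin m × Fin k → Fin n × Bool)`.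
[cite: HuangSellke2025, §3.3.2, Lemma 3.22 (the instability leg)] -/
theorem stub_instability (n m k : ℕ) (hn : 1 ≤ n) (ε θ C : ℝ) (hε0 : 0 ≤ ε) (hε1 : ε ≤ 1)
    (hθ : 0 < θ) (D : ℕ) (F : (Fin m → Fin k → Fin n × Bool) → Fin n → ℝ)
    (hener : ∑ Φ : Fin m → Fin k → Fin n × Bool, ∑ v : Fin n, F Φ v ^ 2
      ≤ C * n * Fintype.card (Fin m → Fin k → Fin n × Bool))
    (hStab : ∀ v : Fin n,
      ∑ y : Fin m × Fin k → Fin n × Bool, ∑ y' : Fin m × Fin k → Fin n × Bool,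
          resampleKernel ε y y' * (F (Function.curry y) v - F (Function.curry y') v) ^ 2
        ≤ 2 * ε * (1 + ε * Fintype.card (Fin m × Fin k)) * D *
            ∑ y : Fin m × Fin k → Fin n × Bool, F (Function.curry y) v ^ 2) :
    ∑ y : Fin m × Fin k → Fin n × Bool, ∑ y' : Fin m × Fin k → Fin n × Bool,
        resampleKernel ε y y' *
          (if ∑ v, (F (Function.curry y) v - F (Function.curry y') v) ^ 2 ≤ θ * n then (0 : ℝ)
            else 1)
      ≤ 2 * ε * (1 + ε * (m * k)) * D * C / θ * Fintype.card (Fin m × Fin k → Fin n × Bool) := by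
  -- the denominators are positive
  have hn' : (0 : ℝ) < n := by exact_mod_cast hn
  have hθn : 0 < θ * n := mul_pos hθ hn'
  -- `#(Fin m × Fin k) = m k`, and currying is a bijection between the two instance spaces
  have hmk : (Fintype.card (Fin m × Fin k) : ℝ) = m * k := by
    rw [Fintype.card_prod, Fintype.card_fin, Fintype.card_fin, Nat.cast_mul]
  have hcard : (Fintype.card (Fin m → Fin k → Fin n × Bool) : ℝ) =
      Fintype.card (Fin m × Fin k → Fin n × Bool) := by
    exact_mod_cast (Fintype.card_congr (Equiv.curry (Fin m) (Fin k) (Fin n × Bool))).symm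
  -- the energy bound, transported to the uncurried instance space
  have hener' : ∑ y : Fin m × Fin k → Fin n × Bool, ∑ v : Fin n, F (Function.curry y) v ^ 2 ≤
      C * n * Fintype.card (Fin m × Fin k → Fin n × Bool) := by
    rw [← hcard, Fintype.sum_equiv (Equiv.curry (Fin m) (Fin k) (Fin n × Bool))
      (fun y => ∑ v : Fin n, F (Function.curry y) v ^ 2) (fun Φ => ∑ v : Fin n, F Φ v ^ 2)
      (fun y => rfl)]
    exact hener
  calc ∑ y : Fin m × Fin k → Fin n × Bool, ∑ y' : Fin m × Fin k → Fin n × Bool,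
        resampleKernel ε y y' *
          (if ∑ v, (F (Function.curry y) v - F (Function.curry y') v) ^ 2 ≤ θ * n then (0 : ℝ)
            else 1)
      ≤ ∑ y : Fin m × Fin k → Fin n × Bool, ∑ y' : Fin m × Fin k → Fin n × Bool,
          resampleKernel ε y y' *
            ((∑ v, (F (Function.curry y) v - F (Function.curry y') v) ^ 2) / (θ * n)) :=
        -- pointwise Markov against the nonnegative kernel weights
        Finset.sum_le_sum fun y _ => Finset.sum_le_sum fun y' _ =>
          mul_le_mul_of_nonneg_left
            (ins_indicator_le (Finset.sum_nonneg fun v _ => sq_nonneg _) hθn)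
            (cmb_kernel_nonneg ε hε0 hε1 y y')
    _ = ∑ v : Fin n, (∑ y : Fin m × Fin k → Fin n × Bool, ∑ y' : Fin m × Fin k → Fin n × Bool,
          resampleKernel ε y y' * (F (Function.curry y) v - F (Function.curry y') v) ^ 2) /
            (θ * n) := by
        -- distribute and swap the order of summation
        simp only [Finset.sum_div, Finset.mul_sum, mul_div_assoc]
        exact (Finset.sum_congr rfl fun y _ => Finset.sum_comm).trans Finset.sum_comm
    _ ≤ ∑ v : Fin n, (2 * ε * (1 + ε * Fintype.card (Fin m × Fin k)) * D *
          ∑ y : Fin m × Fin k → Fin n × Bool, F (Function.curry y) v ^ 2) / (θ * n) :=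
        -- `L²`-stability of each output coordinate
        Finset.sum_le_sum fun v _ => div_le_div_of_nonneg_right (hStab v) hθn.le
    _ = ∑ v : Fin n, (2 * ε * (1 + ε * Fintype.card (Fin m × Fin k)) * D / (θ * n)) *
          ∑ y : Fin m × Fin k → Fin n × Bool, F (Function.curry y) v ^ 2 :=
        Finset.sum_congr rfl fun v _ => by ring
    _ = (2 * ε * (1 + ε * Fintype.card (Fin m × Fin k)) * D / (θ * n)) *
          ∑ y : Fin m × Fin k → Fin n × Bool, ∑ v : Fin n, F (Function.curry y) v ^ 2 := by
        rw [← Finset.mul_sum, Finset.sum_comm]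
    _ ≤ (2 * ε * (1 + ε * Fintype.card (Fin m × Fin k)) * D / (θ * n)) *
          (C * n * Fintype.card (Fin m × Fin k → Fin n × Bool)) :=
        -- the energy bound, against the nonnegative constant
        mul_le_mul_of_nonneg_left hener' (by positivity)
    _ = 2 * ε * (1 + ε * (m * k)) * D * C / θ * Fintype.card (Fin m × Fin k → Fin n × Bool) := by
        rw [hmk]
        field_simp

end Literature.Computability.Complexity.HuangSellke2025Chain

end Part5

/-!
## Part 6 — port of `Summits/PneNP/PneNP/Theorems/OverlapGapAlgebraSearchHardWindowHsAsymptotics.lean` (3 declarations kept)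

# Route OverlapGapAlgebra, crux `SearchHardWindow` (stmt-PneNP-2460), line `Sketch`: the parameter
# asymptotics of Huang–Sellke 2025 §3.3.2

Stub `stub_hsAsymptotics` of the skeleton
`Summits/PneNP/PneNP/Cruxes/SearchHardWindow/Lines/Sketch.lean` (section `HS25`): the pure
real-analysis bookkeeping of the parameters in the proof of Huang–Sellke 2025 (arXiv:2501.06427)
Cor. 3.21 (§3.3.2, p. 23), as consumed verbatim by the lead's assembly `stub_hsAssembly`.

With a degree sequence `1 ≤ D n = o(n)` put `x_n := D n / n → 0⁺`, `y_n := n / D n → ∞`, the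
resampling rate `ε_n := log(n / D n) / n`, the instability level
`u_n := 2 ε_n (1 + ε_n ⌊α n⌋ k) · D n · C / θ`, the gap `W_n := ⌈1 / (b k ε_n)⌉` and the chain length
`T_n := k W_n`. Then eventually in `n`:

1. `D n < n` (as `x_n → 0`);
2. `ε_n > 0` (as `n / D n > 1`);
3. `u_n ≤ p² / 2`: `ε_n D n = log(y_n) / y_n` and `ε_n ⌊α n⌋ k ≤ α k log(y_n)`, so
   `u_n ≤ (2C/θ) (log y_n / y_n + α k log² y_n / y_n) → 0` (`Real.isLittleO_log_id_atTop`,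
   `Real.isLittleO_pow_log_id_atTop` along `y_n → ∞`);
4. `T_n ≤ n²`: `T_n ≤ k (1/(b k ε_n) + 1) = n / (b log y_n) + k ≤ n + k ≤ n²` once
   `b log y_n ≥ 1` and `n ≥ k + 1`;
5. `2 e^{-c n} < (p²/2)^{2 T_n}`: taking logarithms, with `A := |log (p²/2)|` it suffices that
   `2 A T_n + log 2 < c n`, which follows from `T_n ≤ n / (b log y_n) + k`, `1 / (b log y_n) → 0`
   and `n → ∞`.
-/

section Part6

namespace Literature.Computability.Complexity.HuangSellke2025Chain

open _root_.Finset _root_.Filter _root_.Asymptotics _root_.Topology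

/-- `n / D n → ∞` for a positive sequence `D = o(n)` of naturals.
[cite: HuangSellke2025, §3.3.2, Lemma 3.22 (asymptotics of the assembly)] -/
theorem hsa_tendsto_div_atTop (D : ℕ → ℕ)
    (hD : (fun n : ℕ => (D n : ℝ)) =o[atTop] (fun n : ℕ => (n : ℝ))) (hD1 : ∀ n, 1 ≤ D n) :
    Tendsto (fun n : ℕ => (n : ℝ) / D n) atTop atTop := by
  have hx : Tendsto (fun n : ℕ => (D n : ℝ) / n) atTop (𝓝 0) := hD.tendsto_div_nhds_zero
  have hx' : Tendsto (fun n : ℕ => (D n : ℝ) / n) atTop (𝓝[>] 0) := by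
    refine tendsto_nhdsWithin_iff.2 ⟨hx, ?_⟩
    filter_upwards [eventually_gt_atTop 0] with n hn
    have h1 : (0 : ℝ) < D n := Nat.cast_pos.2 (hD1 n)
    have h2 : (0 : ℝ) < n := Nat.cast_pos.2 hn
    exact div_pos h1 h2
  exact hx'.inv_tendsto_nhdsGT_zero.congr fun n => by simp [inv_div]

/-- The majorant of the instability level tends to `0`:
`(2C/θ) (log y_n / y_n + α k log² y_n / y_n) → 0` along `y_n = n / D n → ∞`.
[cite: HuangSellke2025, §3.3.2, Lemma 3.22 (asymptotics of the assembly)] -/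
theorem hsa_tendsto_majorant (D : ℕ → ℕ) (α C θ : ℝ) (k : ℕ)
    (hy : Tendsto (fun n : ℕ => (n : ℝ) / D n) atTop atTop) :
    Tendsto (fun n : ℕ => 2 * C / θ * (Real.log ((n : ℝ) / D n) / ((n : ℝ) / D n) +
      α * k * (Real.log ((n : ℝ) / D n) ^ 2 / ((n : ℝ) / D n)))) atTop (𝓝 0) := by
  have h1 : Tendsto (fun n : ℕ => Real.log ((n : ℝ) / D n) / ((n : ℝ) / D n)) atTop (𝓝 0) := by
    have := Real.isLittleO_log_id_atTop.tendsto_div_nhds_zero.comp hy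
    simpa [Function.comp_def] using this
  have h2 : Tendsto (fun n : ℕ => Real.log ((n : ℝ) / D n) ^ 2 / ((n : ℝ) / D n)) atTop (𝓝 0) := by
    have := (Real.isLittleO_pow_log_id_atTop (n := 2)).tendsto_div_nhds_zero.comp hy
    simpa [Function.comp_def] using this
  have := (h1.add (h2.const_mul (α * k))).const_mul (2 * C / θ)
  simpa using this

/-- **The parameter asymptotics of HS25 §3.3.2** (Huang–Sellke 2025, arXiv:2501.06427, proof of
Cor. 3.21; real analysis only): with `ε_n = log(n / D n)/n` for `1 ≤ D = o(n)`, eventually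
`D n < n`, `ε_n > 0`, the instability level `2ε_n(1 + ε_n ⌊αn⌋ k) D n · C/θ ≤ p²/2`, the chain
length `T_n = k ⌈1/(b k ε_n)⌉ ≤ n²`, and `2 e^{−cn} < (p²/2)^{2 T_n}` (because `T_n = o(n)` as
`log(n/D n) → ∞`). [cite: HuangSellke2025, §3.3.2, Lemma 3.22 (asymptotics of the assembly)] -/
theorem stub_hsAsymptotics (k : ℕ) (hk : 1 ≤ k) (α b c C θ p : ℝ) (hα : 0 < α) (hb : 0 < b)
    (hc : 0 < c) (hC : 0 < C) (hθ : 0 < θ) (hp : 0 < p) (D : ℕ → ℕ)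
    (hD : (fun n : ℕ => (D n : ℝ)) =o[atTop] (fun n : ℕ => (n : ℝ))) (hD1 : ∀ n, 1 ≤ D n) :
    ∀ᶠ n : ℕ in atTop, (D n : ℝ) < n ∧ 0 < Real.log (n / D n) / n ∧
      2 * (Real.log (n / D n) / n) * (1 + Real.log (n / D n) / n * (⌊α * n⌋₊ * k)) * D n * C / θ
        ≤ p ^ 2 / 2 ∧
      k * ⌈1 / (b * k * (Real.log (n / D n) / n))⌉₊ ≤ n ^ 2 ∧
      2 * Real.exp (-(c * n)) <
        (p ^ 2 / 2) ^ (2 * (k * ⌈1 / (b * k * (Real.log (n / D n) / n))⌉₊)) := by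
  have _hα := hα
  have _hC := hC
  have hk0 : (0 : ℝ) < k := Nat.cast_pos.2 hk
  have hq : 0 < p ^ 2 / 2 := by positivity
  -- `A := |log (p²/2)|`
  obtain ⟨A, hA0, hAq⟩ : ∃ A : ℝ, 0 ≤ A ∧ -A ≤ Real.log (p ^ 2 / 2) :=
    ⟨|Real.log (p ^ 2 / 2)|, abs_nonneg _, neg_abs_le _⟩
  -- the basic limits
  have hx : Tendsto (fun n : ℕ => (D n : ℝ) / n) atTop (𝓝 0) := hD.tendsto_div_nhds_zero
  have hy : Tendsto (fun n : ℕ => (n : ℝ) / D n) atTop atTop := hsa_tendsto_div_atTop D hD hD1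
  have hlog : Tendsto (fun n : ℕ => Real.log ((n : ℝ) / D n)) atTop atTop :=
    Real.tendsto_log_atTop.comp hy
  have hM := hsa_tendsto_majorant D α C θ k hy
  have hinv : Tendsto (fun n : ℕ => 1 / (b * Real.log ((n : ℝ) / D n))) atTop (𝓝 0) :=
    tendsto_const_nhds.div_atTop (hlog.const_mul_atTop hb)
  have hinvA : Tendsto (fun n : ℕ => 2 * A * (1 / (b * Real.log ((n : ℝ) / D n)))) atTop (𝓝 0) := by
    simpa using hinv.const_mul (2 * A)
  have hlin : Tendsto (fun n : ℕ => c / 2 * (n : ℝ)) atTop atTop :=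
    tendsto_natCast_atTop_atTop.const_mul_atTop (by positivity)
  -- the eventual facts
  have e1 : ∀ᶠ n : ℕ in atTop, (D n : ℝ) / n < 1 := (tendsto_order.1 hx).2 1 one_pos
  have e3 : ∀ᶠ n : ℕ in atTop, 2 * C / θ * (Real.log ((n : ℝ) / D n) / ((n : ℝ) / D n) +
      α * k * (Real.log ((n : ℝ) / D n) ^ 2 / ((n : ℝ) / D n))) < p ^ 2 / 2 :=
    (tendsto_order.1 hM).2 _ hq
  have e4 : ∀ᶠ n : ℕ in atTop, 1 / (b * Real.log ((n : ℝ) / D n)) < 1 :=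
    (tendsto_order.1 hinv).2 1 one_pos
  have e5 : ∀ᶠ n : ℕ in atTop, 2 * A * (1 / (b * Real.log ((n : ℝ) / D n))) < c / 2 :=
    (tendsto_order.1 hinvA).2 _ (by positivity)
  have e6 : ∀ᶠ n : ℕ in atTop, 2 * A * k + Real.log 2 < c / 2 * (n : ℝ) :=
    hlin.eventually_gt_atTop _
  filter_upwards [eventually_gt_atTop 0, e1, e3, e4, e5, e6, eventually_ge_atTop (k + 1)] with n hn0
    h1n h3n h4n h5n h6n h7n
  set L := Real.log ((n : ℝ) / D n) with hL_def
  have hn : (0 : ℝ) < n := Nat.cast_pos.2 hn0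
  have hDn : (0 : ℝ) < D n := Nat.cast_pos.2 (hD1 n)
  have hlt : (D n : ℝ) < n := (div_lt_one hn).1 h1n
  have hy1 : 1 < (n : ℝ) / D n := (one_lt_div hDn).2 hlt
  have hL : 0 < L := Real.log_pos hy1
  have hε : 0 < L / n := div_pos hL hn
  have hk1 : (k : ℝ) + 1 ≤ n := by exact_mod_cast h7n
  -- the chain length `T_n = k ⌈1/(b k ε_n)⌉ ≤ n / (b log y_n) + k`
  have hr : 0 ≤ 1 / (b * k * (L / n)) := by positivity
  have hceil : (⌈1 / (b * k * (L / n))⌉₊ : ℝ) < 1 / (b * k * (L / n)) + 1 := Nat.ceil_lt_add_one hr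
  have hT : (k : ℝ) * ⌈1 / (b * k * (L / n))⌉₊ ≤ n * (1 / (b * L)) + k := by
    calc (k : ℝ) * ⌈1 / (b * k * (L / n))⌉₊ ≤ k * (1 / (b * k * (L / n)) + 1) := by gcongr
      _ = n * (1 / (b * L)) + k := by
        field_simp
  refine ⟨hlt, hε, ?_, ?_, ?_⟩
  · -- the instability level
    have hfl : (⌊α * (n : ℝ)⌋₊ : ℝ) ≤ α * n := Nat.floor_le (by positivity)
    calc 2 * (L / n) * (1 + L / n * (⌊α * (n : ℝ)⌋₊ * k)) * D n * C / θ
        ≤ 2 * (L / n) * (1 + L / n * (α * n * k)) * D n * C / θ := by gcongr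
      _ = 2 * C / θ * (L / ((n : ℝ) / D n) + α * k * (L ^ 2 / ((n : ℝ) / D n))) := by
        field_simp
      _ ≤ p ^ 2 / 2 := h3n.le
  · -- `T_n ≤ n²`
    have h' : (n : ℝ) * (1 / (b * L)) + k ≤ (n : ℝ) ^ 2 := by
      nlinarith [mul_nonneg hn.le (sub_nonneg.2 h4n.le), mul_nonneg hn.le (sub_nonneg.2 hk1),
        mul_nonneg hk0.le (show (0 : ℝ) ≤ n - 1 by linarith)]
    exact_mod_cast hT.trans h'
  · -- `2 e^{-cn} < (p²/2)^{2 T_n}`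
    have hmain : 2 * A * ((k : ℝ) * ⌈1 / (b * k * (L / n))⌉₊) + Real.log 2 < c * n := by
      have i1 := mul_le_mul_of_nonneg_left hT (by positivity : (0 : ℝ) ≤ 2 * A)
      have i2 := mul_le_mul_of_nonneg_right h5n.le hn.le
      nlinarith [i1, i2, h6n]
    rw [← Real.log_lt_log_iff (by positivity) (by positivity),
      Real.log_mul two_ne_zero (Real.exp_pos _).ne', Real.log_exp, Real.log_pow]
    push_cast
    have i3 : 2 * ((k : ℝ) * ⌈1 / (b * k * (L / n))⌉₊) * -A ≤
        2 * ((k : ℝ) * ⌈1 / (b * k * (L / n))⌉₊) * Real.log (p ^ 2 / 2) :=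
      mul_le_mul_of_nonneg_left hAq (by positivity)
    linarith [hmain, i3]

end Literature.Computability.Complexity.HuangSellke2025Chain

end Part6

/-!
## Part 7 — port of `Summits/PneNP/PneNP/Theorems/OverlapGapAlgebraSearchHardWindowHsAssembly.lean` (6 declarations kept)

# Route OverlapGapAlgebra, crux `SearchHardWindow` (stmt-PneNP-2460), line `Sketch`: assembly of
# Huang–Sellke 2025 Cor. 3.21 (deterministic saturated form) from the resampling-chain obstructions

Stub `stub_hsAssembly` of the skeleton `Summits/PneNP/PneNP/Cruxes/SearchHardWindow/Lines/Sketch.lean`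
(section `HS25`): the named fact `HuangSellke2025KSat` (Huang–Sellke 2025, arXiv:2501.06427,
Cor. 3.21, `κ = 5`, deterministic saturated special case) DERIVED from the first-moment named fact
`HuangSellke2025KSatObstructions` (HS25 Lemmas 3.22–3.23: OGP and CHAOS structures on the
`ε`-resampling chain have mass `≤ e^{-cn}`) by Huang–Sellke's argument (§3.3.2), using the landed
pieces of the line:

* `stub_grandCorrelation` — the grand correlation inequality (HS25 Lemma 3.15): the paths of the
  chain that are good at all times and close at all steps have mass `≥ (p² − u)₊^{2T}`;
* `stub_resampleKernelBasic`, `stub_resamplePositivity` — the resampling kernel is nonnegative,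
  symmetric, stochastic and one-step positive;
* `stub_resampleStability` + `stub_instability` — `L²`-stability of coordinate-degree-`D` functions
  (HS25 Prop. 3.14) and Markov: the one-step mass of "the output moves by more than `θ n`" is
  `≤ u = 2ε(1 + ε m k) D C / θ`;
* `stub_chainMassBasic` — monotonicity / subadditivity of the chain mass, and the identification of
  the all-good-all-close mass with the path sum of the grand correlation lemma;
* `stub_moat` + `stub_moatTransfer` — the deterministic moat (HS25 Lemmas 3.24–3.25): an
  all-good-all-close path carries an OGP structure unless it carries a CHAOS structure;
* `stub_hsAsymptotics` — the parameter bookkeeping: with `1 ≤ D' = o(n)`, `ε = log(n/D')/n`,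
  `W = ⌈1/(b k ε)⌉`, `T = k W`, eventually `ε > 0`, `u ≤ p²/2`, `T ≤ n²` and
  `2 e^{-cn} < (p²/2)^{2T}`.

The proof (`hsA_core`, at one large `n`, by contradiction): if more than `p · #Φ` literal arrays are
"good" (every output coordinate saturated, `|F_v| ≥ 1`, and the sign vector satisfies the
instance), then with `close y y' := ‖F y − F y'‖² ≤ θ n` (`h₂(θ) ≤ η`, `θ ≤ 1/2`,
`hsA_exists_theta`) grand correlation and the chain-mass identity give
`(p²/2)^{2T} ≤ mass(all good ∧ all close)`, the moat gives
`mass(all good ∧ all close) ≤ mass(OGP) + mass(CHAOS) ≤ 2 e^{-cn}`, contradicting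
`2 e^{-cn} < (p²/2)^{2T}`. The final theorem applies the obstructions fact with `b = b₁`,
`D' = D + 1`, the saturated sign map as the output map and chain-length exponent `A = 2`.

References: B. Huang, M. Sellke, *Strong low degree hardness for stable local optima in spin
glasses*, arXiv:2501.06427 (2025), §3.3.2, Cor. 3.21, Lemmas 3.15, 3.22–3.25 [HuangSellke2025];
G. Bresler, B. Huang, FOCS 2021 / arXiv:2106.02129 [BreslerHuang2022].
-/

section Part7

namespace Literature.Computability.Complexity.HuangSellke2025Chain

open _root_.Finset _root_.Filter _root_.Asymptotics _root_.Topology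
open Literature.Computability.Complexity
open scoped _root_.Classical

/-! ## Small helpers -/

/-- A small parameter `θ ∈ (0, 1/2]` with binary entropy `h₂(θ) ≤ η`, for any `η > 0`
(continuity of `h₂` at `0`, where `h₂(0) = 0`).
[cite: HuangSellke2025, §3.3.2, Lemma 3.22 (the assembly of Lemma 3.22)] -/
theorem hsA_exists_theta {η : ℝ} (hη : 0 < η) :
    ∃ θ : ℝ, 0 < θ ∧ θ ≤ 1 / 2 ∧ Real.binEntropy θ ≤ η := by
  have h : ∀ᶠ x in 𝓝 (0 : ℝ), Real.binEntropy x < η := by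
    have ht : Tendsto Real.binEntropy (𝓝 0) (𝓝 0) := by
      simpa only [Real.binEntropy_zero] using Real.binEntropy_continuous.tendsto 0
    exact ht.eventually_lt_const hη
  obtain ⟨δ, hδ, hball⟩ := Metric.eventually_nhds_iff.1 h
  have hθ0 : 0 < min (1 / 2 : ℝ) (δ / 2) := lt_min (by norm_num) (by linarith)
  refine ⟨min (1 / 2) (δ / 2), hθ0, min_le_left _ _, (hball ?_).le⟩
  rw [Real.dist_eq, sub_zero, abs_of_pos hθ0]
  exact (min_le_right _ _).trans_lt (by linarith)

/-- The resampling rate `ε = log(n / D)/n` is at most `1` for `n, D ≥ 1` (`log x ≤ x - 1`).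
[cite: HuangSellke2025, §3.3.2, Lemma 3.22 (the assembly of Lemma 3.22)] -/
theorem hsA_eps_le_one (n D : ℕ) (hn : 1 ≤ n) (hD : 1 ≤ D) : Real.log (n / D) / n ≤ 1 := by
  have hn' : (0 : ℝ) < n := by exact_mod_cast hn
  have hD' : (1 : ℝ) ≤ D := by exact_mod_cast hD
  have h1 : (n : ℝ) / D ≤ n := div_le_self hn'.le hD'
  have h2 : Real.log (n / D) ≤ (n : ℝ) / D - 1 :=
    Real.log_le_sub_one_of_pos (div_pos hn' (by linarith))
  rw [div_le_one hn']
  linarith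

/-- `D n + 1 = o(n)` when `D n = o(n)`. [cite: HuangSellke2025, §3.3.2, Lemma 3.22 (the assembly of Lemma 3.22)] -/
theorem hsA_isLittleO_succ (D : ℕ → ℕ)
    (hD : (fun n : ℕ => (D n : ℝ)) =o[atTop] (fun n : ℕ => (n : ℝ))) :
    (fun n : ℕ => ((D n + 1 : ℕ) : ℝ)) =o[atTop] (fun n : ℕ => (n : ℝ)) := by
  have h1 : (fun _ : ℕ => ((1 : ℕ) : ℝ)) =o[atTop] (fun n : ℕ => (n : ℝ)) := by
    have := (isLittleO_const_id_atTop (1 : ℝ)).comp_tendsto tendsto_natCast_atTop_atTop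
    simpa [Function.comp_def] using this
  simpa [Nat.cast_add] using hD.add h1

/-- The failure indicator of a decided proposition: `[decide P = true ↦ 0; 1] = [P ↦ 0; 1]`, for
any `Decidable` instances. [cite: HuangSellke2025, §3.3.2, Lemma 3.22 (the assembly of Lemma 3.22)] -/
theorem hsA_ite_decide {P : Prop} {hP : Decidable P} {hd : Decidable (@decide P hP = true)}
    {hP' : Decidable P} : @ite ℝ (@decide P hP = true) hd 0 1 = @ite ℝ P hP' 0 1 := by
  by_cases h : P
  · have h' : @decide P hP = true := @decide_eq_true P hP h
    rw [if_pos h', if_pos h]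
  · have h' : ¬ @decide P hP = true := fun h'' => h (@of_decide_eq_true P hP h'')
    rw [if_neg h', if_neg h]

/-! ## The core: one large `n`, by contradiction -/

/-- **The core of the assembly at one instance size** (Huang–Sellke 2025 §3.3.2, proof of
Cor. 3.21, deterministic saturated form). Data: a vector-valued `F` on literal arrays
`Fin m → Fin k → Fin n × Bool` whose output coordinates have coordinate degree `≤ D` and whose energy
is `≤ C n #Φ`; a resampling rate `0 < ε ≤ 1`, a closeness scale `θ ∈ (0, 1/2]` with `h₂(θ) ≤ η`,
the band `0 < η < β`, a gap `W ≥ 1/(b k ε)`, `W > 0`, a horizon `T ≥ k W`, `T ≥ 1`; the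
instability level `2ε(1 + ε m k) D C/θ ≤ p²/2`; `2 e^{-cn} < (p²/2)^{2T}`; and the two obstruction
bounds of `HuangSellke2025KSatObstructions` at chain length `T` (OGP and CHAOS masses `≤ e^{-cn}`,
the CHAOS event read with the saturated sign map of `F` as output map). Conclusion: at most
`p · #Φ` literal arrays are saturated-and-sign-solved by `F`.
[cite: HuangSellke2025, §3.3.2, Lemma 3.22 (the assembly of Lemma 3.22)] -/
theorem hsA_core (n m k : ℕ) (hn : 1 ≤ n) (F : (Fin m → Fin k → Fin n × Bool) → Fin n → ℝ)
    (ε θ C β η b c p : ℝ) (D W T : ℕ)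
    (hε0 : 0 < ε) (hε1 : ε ≤ 1) (hθ0 : 0 < θ) (hθ : θ ≤ 1 / 2) (hθη : Real.binEntropy θ ≤ η)
    (hη : 0 < η) (hηβ : η < β) (hp : 0 < p) (hW : 0 < W) (hWb : 1 / (b * k * ε) ≤ W)
    (hT : k * W ≤ T) (hT1 : 1 ≤ T)
    (hdeg : ∀ v : Fin n, IsCoordDegreeLE D
      (fun y : Fin m × Fin k → Fin n × Bool => F (Function.curry y) v))
    (hener : ∑ Φ : Fin m → Fin k → Fin n × Bool, ∑ v : Fin n, F Φ v ^ 2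
      ≤ C * n * Fintype.card (Fin m → Fin k → Fin n × Bool))
    (hu : 2 * ε * (1 + ε * (m * k)) * D * C / θ ≤ p ^ 2 / 2)
    (hfin : 2 * Real.exp (-(c * n)) < (p ^ 2 / 2) ^ (2 * T))
    (hOGP : resampleChainMass ε T (fun y : ℕ → (Fin m × Fin k → Fin n × Bool) =>
        ∃ (t : ℕ → ℕ) (x : ℕ → Fin n → Bool), (∀ ℓ < k, t ℓ ≤ t (ℓ + 1)) ∧ t k ≤ T ∧
          (∀ ℓ ≤ k, ∀ i : Fin m, ∃ j : Fin k, x ℓ (y (t ℓ) (i, j)).1 = (y (t ℓ) (i, j)).2) ∧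
          ∀ ℓ, 1 ≤ ℓ → ℓ ≤ k → overlapCondEnt x ℓ ∈ Set.Icc (β - η) β)
      ≤ Real.exp (-(c * n)))
    (hCHAOS : resampleChainMass ε T (fun y : ℕ → (Fin m × Fin k → Fin n × Bool) =>
        ∃ (j : ℕ) (t : ℕ → ℕ) (x : Fin n → Bool), 1 ≤ j ∧ j ≤ k ∧
          (∀ ℓ < j, t ℓ ≤ t (ℓ + 1)) ∧ t j ≤ T ∧ (t (j - 1) : ℝ) + 1 / (b * k * ε) ≤ t j ∧
          (∀ i : Fin m, ∃ j' : Fin k, x (y (t j) (i, j')).1 = (y (t j) (i, j')).2) ∧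
          overlapCondEnt
            (fun ℓ => if ℓ < j then (fun v => decide (0 ≤ F (Function.curry (y (t ℓ))) v)) else x)
            j ≤ β)
      ≤ Real.exp (-(c * n)))
    {hdec : DecidablePred fun Φ : Fin m → Fin k → Fin n × Bool =>
      (∀ v : Fin n, 1 ≤ |F Φ v|) ∧
        ∀ i : Fin m, ∃ j : Fin k, decide (0 ≤ F Φ (Φ i j).1) = (Φ i j).2} :
    ((@Finset.filter _ (fun Φ : Fin m → Fin k → Fin n × Bool =>
        (∀ v : Fin n, 1 ≤ |F Φ v|) ∧
        ∀ i : Fin m, ∃ j : Fin k, decide (0 ≤ F Φ (Φ i j).1) = (Φ i j).2) hdec univ).card : ℝ)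
      ≤ p * Fintype.card (Fin m → Fin k → Fin n × Bool) := by
  haveI : Nonempty (Fin n × Bool) := ⟨(⟨0, hn⟩, true)⟩
  by_contra hcon
  rw [not_le] at hcon
  -- the good set and the closeness relation on the UNCURRIED instance space
  set good : (Fin m × Fin k → Fin n × Bool) → Bool := fun y =>
    decide ((∀ v, 1 ≤ |F (Function.curry y) v|) ∧
      ∀ i : Fin m, ∃ j : Fin k, decide (0 ≤ F (Function.curry y) (y (i, j)).1) = (y (i, j)).2)
    with hgood_def
  set close : (Fin m × Fin k → Fin n × Bool) → (Fin m × Fin k → Fin n × Bool) → Bool :=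
    fun y y' => decide (∑ v, (F (Function.curry y) v - F (Function.curry y') v) ^ 2 ≤ θ * n)
    with hclose_def
  have hcs : ∀ y y', close y y' = close y' y := by
    intro y y'
    have hs : ∑ v, (F (Function.curry y) v - F (Function.curry y') v) ^ 2 =
        ∑ v, (F (Function.curry y') v - F (Function.curry y) v) ^ 2 :=
      Finset.sum_congr rfl fun v _ => by ring
    simp only [hclose_def, hs]
  -- (1) density of the good set: the violated target bound, read through currying
  have hcardS : Fintype.card (Fin m × Fin k → Fin n × Bool) =
      Fintype.card (Fin m → Fin k → Fin n × Bool) :=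
    Fintype.card_congr (Equiv.curry _ _ _)
  have hfilt : (univ.filter fun y : Fin m × Fin k → Fin n × Bool => good y = true).card =
      (@Finset.filter _ (fun Φ : Fin m → Fin k → Fin n × Bool =>
        (∀ v : Fin n, 1 ≤ |F Φ v|) ∧
        ∀ i : Fin m, ∃ j : Fin k, decide (0 ≤ F Φ (Φ i j).1) = (Φ i j).2) hdec univ).card := by
    refine Finset.card_equiv (Equiv.curry (Fin m) (Fin k) (Fin n × Bool)) fun y => ?_
    simp only [Finset.mem_filter, Finset.mem_univ, true_and, hgood_def, decide_eq_true_eq,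
      Equiv.curry_apply, Function.curry_apply]
    exact Iff.rfl
  have hpS : p * Fintype.card (Fin m × Fin k → Fin n × Bool) ≤
      ((univ.filter fun y : Fin m × Fin k → Fin n × Bool => good y = true).card : ℝ) := by
    rw [hcardS, hfilt]
    exact hcon.le
  -- (2) the one-step instability bound (Markov on top of `L²`-stability)
  have hinst := stub_instability n m k hn ε θ C hε0.le hε1 hθ0 D F hener
    (fun v => stub_resampleStability ε hε0.le hε1 (hdeg v))
  have hu' : ∑ y : Fin m × Fin k → Fin n × Bool, ∑ y' : Fin m × Fin k → Fin n × Bool,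
      resampleKernel ε y y' * (if close y y' = true then (0 : ℝ) else 1) ≤
      (2 * ε * (1 + ε * (m * k)) * D * C / θ) * Fintype.card (Fin m × Fin k → Fin n × Bool) := by
    refine le_of_eq_of_le ?_ hinst
    refine Finset.sum_congr rfl fun y _ => Finset.sum_congr rfl fun y' _ => ?_
    simp only [hclose_def]
    congr 1
    exact hsA_ite_decide
  -- (3) grand correlation for the resampling kernel
  obtain ⟨hK0, hKs, hKst⟩ :=
    stub_resampleKernelBasic (ι := Fin m × Fin k) (Γ := Fin n × Bool) ε hε0.le hε1
  have hGC := stub_grandCorrelation (resampleKernel (ι := Fin m × Fin k) (Γ := Fin n × Bool) ε)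
    (fun y y' => hK0 y y') (fun y y' => hKs y y') (fun y => hKst y)
    (fun f => stub_resamplePositivity ε hε0.le hε1 f) good close hcs p
    (2 * ε * (1 + ε * (m * k)) * D * C / θ) hp.le hpS hu' T hT1
  -- (4) chain-mass bookkeeping: `(p²/2)^{2T} ≤ mass(all good ∧ all close)`
  obtain ⟨hmono, hsub, hall⟩ :=
    stub_chainMassBasic (ι := Fin m × Fin k) (Γ := Fin n × Bool) ε hε0.le hε1 T
  have hcardpos : (0 : ℝ) < Fintype.card (Fin m × Fin k → Fin n × Bool) :=
    Nat.cast_pos.2 Fintype.card_pos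
  have hq0 : (0 : ℝ) ≤ p ^ 2 / 2 := by positivity
  have hq : p ^ 2 / 2 ≤ max 0 (p ^ 2 - 2 * ε * (1 + ε * (m * k)) * D * C / θ) :=
    le_max_of_le_right (by linarith)
  have hlow : (p ^ 2 / 2) ^ (2 * T) ≤ resampleChainMass ε T
      (fun z : ℕ → (Fin m × Fin k → Fin n × Bool) =>
        (∀ t ≤ T, good (z t) = true) ∧ ∀ t < T, close (z t) (z (t + 1)) = true) := by
    have h1 := (mul_le_mul_of_nonneg_left (pow_le_pow_left₀ hq0 hq (2 * T)) hcardpos.le).trans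
      (hGC.trans_eq (hall good close).symm)
    exact le_of_mul_le_mul_right (by linarith [h1]) hcardpos
  -- (5) the moat: an all-good-all-close path carries an OGP or a CHAOS structure
  have hincl : ∀ z : ℕ → (Fin m × Fin k → Fin n × Bool),
      ((∀ t ≤ T, good (z t) = true) ∧ ∀ t < T, close (z t) (z (t + 1)) = true) →
      (∃ (t : ℕ → ℕ) (x : ℕ → Fin n → Bool), (∀ ℓ < k, t ℓ ≤ t (ℓ + 1)) ∧ t k ≤ T ∧
          (∀ ℓ ≤ k, ∀ i : Fin m, ∃ j : Fin k, x ℓ (z (t ℓ) (i, j)).1 = (z (t ℓ) (i, j)).2) ∧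
          ∀ ℓ, 1 ≤ ℓ → ℓ ≤ k → overlapCondEnt x ℓ ∈ Set.Icc (β - η) β) ∨
      (∃ (j : ℕ) (t : ℕ → ℕ) (x : Fin n → Bool), 1 ≤ j ∧ j ≤ k ∧
          (∀ ℓ < j, t ℓ ≤ t (ℓ + 1)) ∧ t j ≤ T ∧ (t (j - 1) : ℝ) + 1 / (b * k * ε) ≤ t j ∧
          (∀ i : Fin m, ∃ j' : Fin k, x (z (t j) (i, j')).1 = (z (t j) (i, j')).2) ∧
          overlapCondEnt
            (fun ℓ => if ℓ < j then (fun v => decide (0 ≤ F (Function.curry (z (t ℓ))) v)) else x)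
            j ≤ β) := by
    rintro z ⟨hg, hc⟩
    refine or_iff_not_imp_right.2 fun hch => ?_
    push Not at hch
    have hgood' : ∀ t ≤ T, (∀ v, 1 ≤ |F (Function.curry (z t)) v|) ∧
        ∀ i : Fin m, ∃ j : Fin k,
          decide (0 ≤ F (Function.curry (z t)) (z t (i, j)).1) = (z t (i, j)).2 := by
      intro t ht
      simpa only [hgood_def, decide_eq_true_eq] using hg t ht
    have hclose' : ∀ t < T,
        ∑ v, (F (Function.curry (z t)) v - F (Function.curry (z (t + 1))) v) ^ 2 ≤ θ * n := by
      intro t ht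
      simpa only [hclose_def, decide_eq_true_eq] using hc t ht
    refine stub_moatTransfer stub_moat n m k W T β η θ hW hη hηβ hT hθ hθη hn F z hgood' hclose'
      (fun j t x h1 h2 h3 h4 h5 h6 => hch j t x h1 h2 h3 h4 ?_ h6)
    have h5' : ((t (j - 1) + W : ℕ) : ℝ) ≤ t j := by exact_mod_cast h5
    push_cast at h5'
    linarith [hWb]
  -- (6) conclusion: `(p²/2)^{2T} ≤ mass ≤ mass(OGP) + mass(CHAOS) ≤ 2 e^{-cn} < (p²/2)^{2T}`
  have hupp := (hmono _ _ hincl).trans ((hsub _ _).trans (add_le_add hOGP hCHAOS))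
  linarith [hlow, hupp, hfin]

/-! ## The stub -/

/-- **Huang–Sellke 2025, Cor. 3.21 (deterministic saturated form) from Lemmas 3.22–3.23**
(stub `stub_hsAssembly` of line `Sketch`): the named fact `HuangSellke2025KSat` follows from the
resampling-chain obstructions `HuangSellke2025KSatObstructions` by grand correlation, positivity
and `L²`-stability of the resampling kernel, the moat, and the parameter asymptotics
(`b = b₁`, `D' = D + 1`, output map = saturated sign map, `A = 2`; `ε = log(n/D')/n`,
`W = ⌈1/(b k ε)⌉`, `T = k W`, `p = ε₀`). [cite: HuangSellke2025, §3.3.2, Lemma 3.22 (the assembly of Lemma 3.22)] -/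
theorem stub_hsAssembly (hObs : HuangSellke2025KSatObstructions) : HuangSellke2025KSat := by
  obtain ⟨k₀, hk₀⟩ := hObs
  refine ⟨max k₀ 2, fun k hk C hC D hD F hdeg hener ε₀ hε₀ => ?_⟩
  have hk₀k : k₀ ≤ k := le_of_max_le_left hk
  have hk2 : 2 ≤ k := le_of_max_le_right hk
  have hk1 : 1 ≤ k := le_trans one_le_two hk2
  have hkpos : (0 : ℝ) < k := by exact_mod_cast hk1
  have hα : 0 < 5 * 2 ^ k * Real.log k / k := by
    have hlog : 0 < Real.log k := Real.log_pos (by exact_mod_cast hk2)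
    exact div_pos (mul_pos (by positivity) hlog) hkpos
  obtain ⟨β, η, hη, hηβ, b₁, hb₁, hfact⟩ := hk₀ k hk₀k
  obtain ⟨θ, hθ0, hθ, hθη⟩ := hsA_exists_theta hη
  -- the shifted degree sequence `D' = D + 1 ≥ 1`, still `o(n)`
  obtain ⟨D', hD'D, hD'1, hD'o⟩ : ∃ D' : ℕ → ℕ, (∀ n, D n ≤ D' n) ∧ (∀ n, 1 ≤ D' n) ∧
      (fun n : ℕ => (D' n : ℝ)) =o[atTop] (fun n : ℕ => (n : ℝ)) :=
    ⟨fun n => D n + 1, fun n => Nat.le_succ _, fun n => Nat.le_add_left 1 (D n),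
      hsA_isLittleO_succ D hD⟩
  -- the obstructions for the saturated sign map of `F`, chain lengths `≤ n ^ 2`
  obtain ⟨c, hc, hEv⟩ := hfact b₁ hb₁ le_rfl D' hD'o hD'1
    (fun n m y v => decide (0 ≤ F n m (Function.curry y) v)) 2
  -- the parameter asymptotics
  have hAsy := stub_hsAsymptotics k hk1 (5 * 2 ^ k * Real.log k / k) b₁ c C θ ε₀ hα hb₁ hc hC
    hθ0 hε₀ D' hD'o hD'1
  filter_upwards [hEv, hAsy, eventually_ge_atTop 1] with n hEvn hAsyn hn m hm
  obtain ⟨ε, hεdef⟩ : ∃ ε : ℝ, ε = Real.log (n / D' n) / n := ⟨_, rfl⟩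
  rw [← hεdef] at hAsyn
  obtain ⟨-, hεpos, hu, hT2, hfin⟩ := hAsyn
  obtain ⟨hOGP, hCHAOS⟩ := hEvn m hm ε hεdef _ hT2
  subst hm
  have hε1 : ε ≤ 1 := by
    rw [hεdef]
    exact hsA_eps_le_one n (D' n) hn (hD'1 n)
  have hW : 0 < ⌈1 / (b₁ * k * ε)⌉₊ :=
    Nat.ceil_pos.2 (div_pos one_pos (mul_pos (mul_pos hb₁ hkpos) hεpos))
  have hT1 : 1 ≤ k * ⌈1 / (b₁ * k * ε)⌉₊ :=
    Nat.one_le_iff_ne_zero.2 (Nat.mul_ne_zero (by omega) hW.ne')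
  exact hsA_core n _ k hn (F n _) ε θ C β η b₁ c ε₀ (D' n) ⌈1 / (b₁ * k * ε)⌉₊
    (k * ⌈1 / (b₁ * k * ε)⌉₊) hεpos hε1 hθ0 hθ hθη hη hηβ hε₀ hW (Nat.le_ceil _) le_rfl hT1
    (fun v => (hdeg n _ v).mono (hD'D n)) (hener n _ rfl) hu hfin hOGP hCHAOS

end Literature.Computability.Complexity.HuangSellke2025Chain

end Part7

/-!
## Part 8 — port of `Summits/PneNP/PneNP/Theorems/OverlapGapAlgebraSearchHardWindowObstructionsOfOGP.lean` (2 declarations kept)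

# Route OverlapGapAlgebra, crux `SearchHardWindow` (stmt-PneNP-2460): `EnsembleOGP → Obstructions`

Logic glue of line `Sketch` (Line A). The named fact `HuangSellke2025KSatObstructions`
(`Literature/Computability/Complexity/RandomKSatEnsembleOGP.lean`; Huang–Sellke 2025,
arXiv:2501.06427 §3.3.2, Lemmas 3.22–3.23) is the conjunction, eventually in `n`, of two first-moment
bounds on the `ε`-resampling chain of random `k`-SAT literal arrays: the ensemble OGP (Lemma 3.22) and
the chaos bound (Lemma 3.23). The chaos half is proved summit-side as a theorem for every
`β < 5 log k / k` (hypothesis `hChaos`); the OGP half is the smaller named fact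
`HuangSellke2025KSatEnsembleOGP`, which records `β < 5 log k / k` (hypothesis `hOGP`, inlined
verbatim).

`stub_obstructionsOfOGP` assembles the two: take the threshold `max k₀ 2`, the OGP's constants
`β, η`, the chaos's `b₁`, and for the rate the minimum `c = min c₁ c₂` of the two rates, using
`exp (-(cᵢ n)) ≤ exp (-(min c₁ c₂ · n))`.
-/

section Part8

namespace Literature.Computability.Complexity.HuangSellke2025Chain

open _root_.Finset _root_.Filter _root_.Asymptotics
open Literature.Computability.Complexity
open scoped _root_.Classical

/-- Weakening an exponential rate: if `c ≤ c'` and `0 ≤ x` then `exp (-(c' x)) ≤ exp (-(c x))`.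
[cite: HuangSellke2025, §3.3.2, Lemma 3.23 (Lemma 3.23: the obstructions from the ensemble OGP)] -/
theorem oog_exp_neg_mul_le {c c' x : ℝ} (hcc' : c ≤ c') (hx : 0 ≤ x) :
    Real.exp (-(c' * x)) ≤ Real.exp (-(c * x)) := by
  apply Real.exp_le_exp.2
  have : c * x ≤ c' * x := mul_le_mul_of_nonneg_right hcc' hx
  linarith

/-- **`EnsembleOGP → Obstructions`** (glue of line `Sketch`, crux `SearchHardWindow`): the ensemble
OGP half (Huang–Sellke 2025 Lemma 3.22, hypothesis `hOGP`, recording `β < 5 log k / k`) and the chaos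
half as a theorem for every `β < 5 log k / k` (Lemma 3.23, hypothesis `hChaos`) together give the named
fact `HuangSellke2025KSatObstructions`: threshold `max k₀ 2`, the OGP's `β, η`, the chaos's `b₁`, and
rate `c = min c₁ c₂`.
[cite: HuangSellke2025, §3.3.2, Lemma 3.23 (Lemma 3.23: the obstructions from the ensemble OGP)] -/
theorem stub_obstructionsOfOGP
    (hOGP : (∃ k₀ : ℕ, ∀ k : ℕ, k₀ ≤ k → ∃ β η : ℝ, 0 < η ∧ η < β ∧ β < 5 * Real.log k / k ∧
      ∀ D : ℕ → ℕ, (fun n : ℕ => (D n : ℝ)) =o[atTop] (fun n : ℕ => (n : ℝ)) → (∀ n, 1 ≤ D n) →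
        ∀ A : ℕ, ∃ c : ℝ, 0 < c ∧ ∀ᶠ n : ℕ in atTop, ∀ m : ℕ, m = ⌊5 * 2 ^ k * Real.log k / k * n⌋₊ →
          ∀ ε : ℝ, ε = Real.log (n / D n) / n → ∀ K : ℕ, K ≤ n ^ A →
          resampleChainMass ε K (fun y : ℕ → (Fin m × Fin k → Fin n × Bool) =>
              ∃ (t : ℕ → ℕ) (x : ℕ → Fin n → Bool), (∀ ℓ < k, t ℓ ≤ t (ℓ + 1)) ∧ t k ≤ K ∧
                (∀ ℓ ≤ k, ∀ i : Fin m, ∃ j : Fin k, x ℓ (y (t ℓ) (i, j)).1 = (y (t ℓ) (i, j)).2) ∧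
                ∀ ℓ, 1 ≤ ℓ → ℓ ≤ k → overlapCondEnt x ℓ ∈ Set.Icc (β - η) β)
            ≤ Real.exp (-(c * n))))
    (hChaos : ∀ k : ℕ, 2 ≤ k → ∀ β : ℝ, β < 5 * Real.log k / k →
      ∃ b₁ : ℝ, 0 < b₁ ∧ ∀ b : ℝ, 0 < b → b ≤ b₁ → ∀ D : ℕ → ℕ,
        (fun n : ℕ => (D n : ℝ)) =o[atTop] (fun n : ℕ => (n : ℝ)) → (∀ n, 1 ≤ D n) →
        ∀ (a : (n m : ℕ) → (Fin m × Fin k → Fin n × Bool) → (Fin n → Bool)) (A : ℕ),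
        ∃ c : ℝ, 0 < c ∧ ∀ᶠ n : ℕ in atTop, ∀ m : ℕ, m = ⌊5 * 2 ^ k * Real.log k / k * n⌋₊ →
          ∀ ε : ℝ, ε = Real.log (n / D n) / n → ∀ K : ℕ, K ≤ n ^ A →
          resampleChainMass ε K (fun y : ℕ → (Fin m × Fin k → Fin n × Bool) =>
              ∃ (j : ℕ) (t : ℕ → ℕ) (x : Fin n → Bool), 1 ≤ j ∧ j ≤ k ∧
                (∀ ℓ < j, t ℓ ≤ t (ℓ + 1)) ∧ t j ≤ K ∧ (t (j - 1) : ℝ) + 1 / (b * k * ε) ≤ t j ∧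
                (∀ i : Fin m, ∃ j' : Fin k, x (y (t j) (i, j')).1 = (y (t j) (i, j')).2) ∧
                overlapCondEnt (fun ℓ => if ℓ < j then a n m (y (t ℓ)) else x) j ≤ β)
            ≤ Real.exp (-(c * n))) :
    HuangSellke2025KSatObstructions := by
  obtain ⟨k₀, hk₀⟩ := hOGP
  refine ⟨max k₀ 2, fun k hk => ?_⟩
  have hk₀k : k₀ ≤ k := le_trans (le_max_left k₀ 2) hk
  have hk2 : 2 ≤ k := le_trans (le_max_right k₀ 2) hk
  obtain ⟨β, η, hη, hηβ, hβ5, hO⟩ := hk₀ k hk₀k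
  obtain ⟨b₁, hb₁, hC⟩ := hChaos k hk2 β hβ5
  refine ⟨β, η, hη, hηβ, b₁, hb₁, fun b hb hbb D hD hD1 a A => ?_⟩
  obtain ⟨c₁, hc₁, hev₁⟩ := hO D hD hD1 A
  obtain ⟨c₂, hc₂, hev₂⟩ := hC b hb hbb D hD hD1 a A
  refine ⟨min c₁ c₂, lt_min hc₁ hc₂, ?_⟩
  filter_upwards [hev₁, hev₂] with n h₁ h₂
  intro m hm ε hε K hK
  exact ⟨(h₁ m hm ε hε K hK).trans (oog_exp_neg_mul_le (min_le_left c₁ c₂) (Nat.cast_nonneg n)),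
    (h₂ m hm ε hε K hK).trans (oog_exp_neg_mul_le (min_le_right c₁ c₂) (Nat.cast_nonneg n))⟩

end Literature.Computability.Complexity.HuangSellke2025Chain

end Part8

/-!
## Part 9 — port of `Summits/PneNP/PneNP/Theorems/OverlapGapAlgebraSearchHardWindowChaosTupleBound.lean` (3 declarations kept)

# Route OverlapGapAlgebra, crux `SearchHardWindow` (stmt-PneNP-2460), line `Sketch`: the chaos
# first moment for ONE time tuple

Stub `stub_chaosTupleBound` of the skeleton
`Summits/PneNP/PneNP/Cruxes/SearchHardWindow/Lines/Sketch.lean` (section `Chaos`), the per-time-tuple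
first moment behind the CHAOS lemma of Huang–Sellke 2025 (arXiv:2501.06427, proof of Lemma 3.23;
Bresler–Huang 2021, arXiv:2106.02129, §4.6, `P(S_indep^c)`) for random `k`-SAT on the `ε`-resampling
chain `z 0, z 1, …` of literal arrays `V = (Fin m × Fin k → Fin n × Bool)` (vocabulary
`resampleKernel`, `resampleChainMass`, `overlapCondEnt` of
`Literature/Computability/Complexity/RandomKSatEnsembleOGP.lean`).

Fix earlier rung times `τ 0, …, τ (j-1) ≤ s`, outputs `a (z (τ ℓ))`, and the candidate time
`s + Δ ≤ K`. The event is `E z = ∃ x, Sat x (z (s+Δ)) ∧ Ent z x ≤ β` with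
`Ent z x = overlapCondEnt (a (z (τ 0)), …, a (z (τ (j-1))), x, x, …) j`. The generic inputs are
hypotheses of the stub (they are the already landed theorems `stub_kernelPowPaths`,
`stub_chainTwoBlock`, `stub_chainMassUnion`, `stub_satProbBound`, `stub_lowEntropyCount`,
`stub_chainMassTotal`.2 of the same section), and the proof is the chain
`mass E ≤ Σ_x mass (Sat_x ∧ Ent_x ≤ β) ≤ Σ_x q · mass (Ent_x ≤ β) = q · Σ_x mass (Ent_x ≤ β) ≤ q · M`
with `q = (1 − (E_Δ/2)^k)^m`, `E_Δ = 1 − (1−ε)^Δ ∈ [0, 1]`, `M = (n+1)^{2^j} e^{nβ}`: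
* the union bound over the finitely many candidates `x` (`hUnion`);
* for each `x`, the two-block Markov bound (`hTwoBlock`): the entropy event only reads the path at the
  times `τ ℓ ≤ s`, and every length-`Δ` segment started at `w` carries a satisfying endpoint with
  weight `Σ_{y'} P_{E_Δ}(w, y') [Sat x y'] ≤ q` — insert the sum over the endpoint `y'`
  (`ctu_sum_endpoint`), use the closed form of the `Δ`-step path sums (`hPow`) and the satisfaction
  probability of a fixed assignment (`hSat`) (`ctu_segment_bound`);
* the weighted count `Σ_x mass (Ent_x ≤ β) ≤ M` (`hTotal`), every path carrying at most `M` candidates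
  of low conditional overlap entropy (`hCount`).
-/

section Part9

namespace Literature.Computability.Complexity.HuangSellke2025Chain

open _root_.Finset _root_.Filter _root_.Asymptotics
open Literature.Computability.Complexity
open scoped _root_.Classical

/-- **Inserting the sum over the endpoint of a segment.** For segments `y : P` with start `first y`
and end `last y`, weights `W`, and an endpoint observable `G y = g (last y)`:
`Σ_y [first y = w] W y G y = Σ_{y'} (Σ_y [first y = w ∧ last y = y'] W y) · g y'`.
Stated for arbitrary `Decidable` instances of the two indicator conditions.
[cite: HuangSellke2025, §3.3.2, Lemma 3.22 (the per-tuple chaos bound)] -/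
theorem ctu_sum_endpoint {P V : Type*} {instP : Fintype P} {instV : Fintype V}
    (first last : P → V) (w : V) (W G : P → ℝ) (g : V → ℝ) (hG : ∀ y, G y = g (last y))
    {d1 : ∀ y, Decidable (first y = w)} {d2 : ∀ y y', Decidable (first y = w ∧ last y = y')} :
    ∑ y, @ite ℝ (first y = w) (d1 y) (W y * G y) 0 =
      ∑ y', (∑ y, @ite ℝ (first y = w ∧ last y = y') (d2 y y') (W y) 0) * g y' := by
  calc ∑ y, @ite ℝ (first y = w) (d1 y) (W y * G y) 0
      = ∑ y, ∑ y', @ite ℝ (first y = w ∧ last y = y') (d2 y y') (W y) 0 * g y' := by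
        refine Finset.sum_congr rfl fun y _ => ?_
        rw [Finset.sum_eq_single_of_mem (last y) (Finset.mem_univ _) ?_]
        · rw [hG y]
          by_cases h : first y = w
          · rw [if_pos h, if_pos ⟨h, rfl⟩]
          · rw [if_neg h, if_neg (fun h' => h h'.1), zero_mul]
        · intro y' _ hy'
          rw [if_neg (fun h' => hy' h'.2.symm), zero_mul]
    _ = ∑ y', ∑ y, @ite ℝ (first y = w ∧ last y = y') (d2 y y') (W y) 0 * g y' :=
        Finset.sum_comm
    _ = ∑ y', (∑ y, @ite ℝ (first y = w ∧ last y = y') (d2 y y') (W y) 0) * g y' :=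
        Finset.sum_congr rfl fun y' _ => (Finset.sum_mul _ _ _).symm

/-- **The segment bound of the two-block step.** If the segments from `w` to `y'` have total weight
`R y'` (`hPow`, the closed form of the `Δ`-step path sums) and `Σ_{y'} R y' · g y' ≤ q` (`hSat`, the
satisfaction probability of a fixed assignment under one resampling step of rate `E_Δ`), then the
segments started at `w` carry the endpoint observable with weight `Σ_y [first y = w] W y G y ≤ q`.
Stated for arbitrary `Decidable` instances of the indicator conditions.
[cite: HuangSellke2025, §3.3.2, Lemma 3.22 (the per-tuple chaos bound)] -/
theorem ctu_segment_bound {P V : Type*} {instP : Fintype P} {instV : Fintype V}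
    (first last : P → V) (w : V) (W G : P → ℝ) (g R : V → ℝ) (q : ℝ)
    {d1 : ∀ y, Decidable (first y = w)} {d2 : ∀ y y', Decidable (first y = w ∧ last y = y')}
    (hG : ∀ y, G y = g (last y))
    (hPow : ∀ y', ∑ y, @ite ℝ (first y = w ∧ last y = y') (d2 y y') (W y) 0 = R y')
    (hSat : ∑ y', R y' * g y' ≤ q) :
    ∑ y, @ite ℝ (first y = w) (d1 y) (W y * G y) 0 ≤ q := by
  rw [ctu_sum_endpoint first last w W G g hG (d2 := d2)]
  calc ∑ y', (∑ y, @ite ℝ (first y = w ∧ last y = y') (d2 y y') (W y) 0) * g y'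
      = ∑ y', R y' * g y' := Finset.sum_congr rfl fun y' _ => by rw [hPow y']
    _ ≤ q := hSat

/-- **The chaos first moment for ONE time tuple** (stub `stub_chaosTupleBound` of line `Sketch`,
section `Chaos`; Huang–Sellke 2025, proof of Lemma 3.23 / Bresler–Huang 2021 §4.6 `P(S_indep^c)`):
earlier rung times `τ 0, …, τ (j−1) ≤ s`, candidate time `s + Δ ≤ K`; the paths carrying a candidate
`x` that satisfies the instance at time `s + Δ` and has conditional overlap entropy `≤ β` given the
outputs `a` at the earlier rung times have mass `≤ (1 − (E_Δ/2)^k)^m · (n+1)^{2^j} e^{nβ}`,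
`E_Δ = 1 − (1−ε)^Δ`. The generic inputs are hypotheses: `hPow` = `stub_kernelPowPaths`,
`hTwoBlock` = `stub_chainTwoBlock`, `hUnion` = `stub_chainMassUnion`, `hSat` = `stub_satProbBound`,
`hCount` = `stub_lowEntropyCount`, `hTotal` = `stub_chainMassTotal`.2. Proof: union bound over `x`,
two-block bound for each `x` (the entropy event reads the path only at times `≤ s`; the segment bound
is `ctu_segment_bound`), then the weighted count of low-entropy candidates.
[cite: HuangSellke2025, §3.3.2, Lemma 3.22 (the per-tuple chaos bound)] -/
theorem stub_chaosTupleBound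
    (hPow : ∀ {ι Γ : Type} [Fintype ι] [DecidableEq ι] [Fintype Γ] [DecidableEq Γ] [Nonempty Γ]
      (ε : ℝ) (Δ : ℕ) (w y' : ι → Γ),
      ∑ y : Fin (Δ + 1) → ι → Γ,
          (if y 0 = w ∧ y (Fin.last Δ) = y' then
            ∏ t : Fin Δ, resampleKernel ε (y t.castSucc) (y t.succ) else 0)
        = resampleKernel (1 - (1 - ε) ^ Δ) w y')
    (hTwoBlock : ∀ {ι Γ : Type} [Fintype ι] [DecidableEq ι] [Fintype Γ] [DecidableEq Γ] [Nonempty Γ]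
      (ε : ℝ), 0 ≤ ε → ε ≤ 1 → ∀ (K s Δ : ℕ), s + Δ ≤ K → ∀ (A : (ℕ → ι → Γ) → Prop),
      (∀ z z' : ℕ → ι → Γ, (∀ t ≤ s, z t = z' t) → (A z ↔ A z')) →
      ∀ (B : (ι → Γ) → Prop) (q : ℝ),
      (∀ w : ι → Γ, ∑ y : Fin (Δ + 1) → ι → Γ,
          (if y 0 = w then (∏ t : Fin Δ, resampleKernel ε (y t.castSucc) (y t.succ)) *
            (if B (y (Fin.last Δ)) then (1 : ℝ) else 0) else 0) ≤ q) →
      resampleChainMass ε K (fun z => A z ∧ B (z (s + Δ))) ≤ q * resampleChainMass ε K A)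
    (hUnion : ∀ {ι Γ X : Type} [Fintype ι] [DecidableEq ι] [Fintype Γ] [DecidableEq Γ] [Nonempty Γ]
      [Fintype X] (ε : ℝ), 0 ≤ ε → ε ≤ 1 → ∀ (K : ℕ) (E : X → (ℕ → ι → Γ) → Prop),
      resampleChainMass ε K (fun z => ∃ x, E x z) ≤ ∑ x, resampleChainMass ε K (E x))
    (hSat : ∀ (n m k : ℕ), 1 ≤ n → ∀ (E : ℝ), 0 ≤ E → E ≤ 1 → ∀ (x : Fin n → Bool)
      (w : Fin m × Fin k → Fin n × Bool),
      ∑ y' : Fin m × Fin k → Fin n × Bool, resampleKernel E w y' *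
          (if (∀ i : Fin m, ∃ j : Fin k, x (y' (i, j)).1 = (y' (i, j)).2) then (1 : ℝ) else 0)
        ≤ (1 - (E / 2) ^ k) ^ m)
    (hCount : ∀ (n j : ℕ), 1 ≤ j → ∀ (prev : ℕ → Fin n → Bool) (β : ℝ),
      ((univ.filter fun x : Fin n → Bool =>
          overlapCondEnt (fun ℓ => if ℓ < j then prev ℓ else x) j ≤ β).card : ℝ)
        ≤ ((n : ℝ) + 1) ^ (2 ^ j) * Real.exp (n * β))
    (hTotal : ∀ {ι Γ : Type} [Fintype ι] [DecidableEq ι] [Fintype Γ] [DecidableEq Γ] [Nonempty Γ]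
      (ε : ℝ), 0 ≤ ε → ε ≤ 1 → ∀ (K : ℕ) (X : Type) [Fintype X] (E : X → (ℕ → ι → Γ) → Prop)
      (M : ℝ), (∀ z : ℕ → ι → Γ, ((univ.filter fun x : X => E x z).card : ℝ) ≤ M) →
      ∑ x : X, resampleChainMass ε K (E x) ≤ M)
    (n m k : ℕ) (hn : 1 ≤ n) (ε : ℝ) (hε0 : 0 ≤ ε) (hε1 : ε ≤ 1)
    (K j s Δ : ℕ) (hj : 1 ≤ j) (hsΔ : s + Δ ≤ K) (τ : ℕ → ℕ) (hτ : ∀ ℓ < j, τ ℓ ≤ s)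
    (a : (Fin m × Fin k → Fin n × Bool) → (Fin n → Bool)) (β : ℝ) :
    resampleChainMass ε K (fun z : ℕ → (Fin m × Fin k → Fin n × Bool) =>
        ∃ x : Fin n → Bool,
          (∀ i : Fin m, ∃ j' : Fin k, x (z (s + Δ) (i, j')).1 = (z (s + Δ) (i, j')).2) ∧
          overlapCondEnt (fun ℓ => if ℓ < j then a (z (τ ℓ)) else x) j ≤ β)
      ≤ (1 - ((1 - (1 - ε) ^ Δ) / 2) ^ k) ^ m * (((n : ℝ) + 1) ^ (2 ^ j) * Real.exp (n * β)) := by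
  -- the literal alphabet is nonempty (`n ≥ 1`)
  haveI : Nonempty (Fin n × Bool) := ⟨(⟨0, hn⟩, true)⟩
  -- the `Δ`-step resampling rate `E_Δ = 1 − (1−ε)^Δ ∈ [0, 1]` and `q = (1 − (E_Δ/2)^k)^m ≥ 0`
  have h1ε0 : (0 : ℝ) ≤ 1 - ε := sub_nonneg.mpr hε1
  have h1ε1 : (1 : ℝ) - ε ≤ 1 := sub_le_self _ hε0
  have hE0 : (0 : ℝ) ≤ 1 - (1 - ε) ^ Δ := sub_nonneg.mpr (pow_le_one₀ h1ε0 h1ε1)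
  have hE1 : (1 : ℝ) - (1 - ε) ^ Δ ≤ 1 := sub_le_self _ (pow_nonneg h1ε0 Δ)
  have hq0 : (0 : ℝ) ≤ (1 - ((1 - (1 - ε) ^ Δ) / 2) ^ k) ^ m := by
    refine pow_nonneg (sub_nonneg.mpr (pow_le_one₀ ?_ ?_)) m
    · linarith
    · linarith
  -- Step 2: for each candidate `x`, the two-block Markov bound
  have h2 : ∀ x : Fin n → Bool,
      resampleChainMass ε K (fun z : ℕ → (Fin m × Fin k → Fin n × Bool) =>
          (∀ i : Fin m, ∃ j' : Fin k, x (z (s + Δ) (i, j')).1 = (z (s + Δ) (i, j')).2) ∧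
            overlapCondEnt (fun ℓ => if ℓ < j then a (z (τ ℓ)) else x) j ≤ β)
        ≤ (1 - ((1 - (1 - ε) ^ Δ) / 2) ^ k) ^ m *
          resampleChainMass ε K (fun z : ℕ → (Fin m × Fin k → Fin n × Bool) =>
            overlapCondEnt (fun ℓ => if ℓ < j then a (z (τ ℓ)) else x) j ≤ β) := by
    intro x
    have hev : (fun z : ℕ → (Fin m × Fin k → Fin n × Bool) =>
          (∀ i : Fin m, ∃ j' : Fin k, x (z (s + Δ) (i, j')).1 = (z (s + Δ) (i, j')).2) ∧
            overlapCondEnt (fun ℓ => if ℓ < j then a (z (τ ℓ)) else x) j ≤ β) =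
        (fun z : ℕ → (Fin m × Fin k → Fin n × Bool) =>
          overlapCondEnt (fun ℓ => if ℓ < j then a (z (τ ℓ)) else x) j ≤ β ∧
            (∀ i : Fin m, ∃ j' : Fin k, x (z (s + Δ) (i, j')).1 = (z (s + Δ) (i, j')).2)) :=
      funext fun z => propext and_comm
    rw [hev]
    refine hTwoBlock ε hε0 hε1 K s Δ hsΔ
      (fun z : ℕ → (Fin m × Fin k → Fin n × Bool) =>
        overlapCondEnt (fun ℓ => if ℓ < j then a (z (τ ℓ)) else x) j ≤ β) ?_
      (fun v : Fin m × Fin k → Fin n × Bool =>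
        ∀ i : Fin m, ∃ j' : Fin k, x (v (i, j')).1 = (v (i, j')).2)
      ((1 - ((1 - (1 - ε) ^ Δ) / 2) ^ k) ^ m) ?_
    · -- the entropy event reads the path only at the times `τ ℓ ≤ s`, `ℓ < j`
      intro z z' hzz'
      have hfun : (fun ℓ => if ℓ < j then a (z (τ ℓ)) else x) =
          (fun ℓ => if ℓ < j then a (z' (τ ℓ)) else x) := by
        funext ℓ
        by_cases h : ℓ < j
        · rw [if_pos h, if_pos h, hzz' (τ ℓ) (hτ ℓ h)]
        · rw [if_neg h, if_neg h]
      rw [hfun]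
    · -- the segment bound: `Σ_{y'} P_{E_Δ}(w, y') [Sat x y'] ≤ q`
      intro w
      refine ctu_segment_bound (fun y : Fin (Δ + 1) → (Fin m × Fin k → Fin n × Bool) => y 0)
        (fun y => y (Fin.last Δ)) w
        (fun y => ∏ t : Fin Δ, resampleKernel ε (y t.castSucc) (y t.succ)) _
        (fun v : Fin m × Fin k → Fin n × Bool =>
          if (∀ i : Fin m, ∃ j' : Fin k, x (v (i, j')).1 = (v (i, j')).2) then (1 : ℝ) else 0)
        (fun y' => resampleKernel (1 - (1 - ε) ^ Δ) w y')
        ((1 - ((1 - (1 - ε) ^ Δ) / 2) ^ k) ^ m) ?_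
        (fun y' => hPow ε Δ w y') (hSat n m k hn _ hE0 hE1 x w)
      intro y
      exact cmb_ite_congr Iff.rfl
  -- Step 3: the weighted count of low-entropy candidates
  have h3 : ∑ x : Fin n → Bool, resampleChainMass ε K
        (fun z : ℕ → (Fin m × Fin k → Fin n × Bool) =>
          overlapCondEnt (fun ℓ => if ℓ < j then a (z (τ ℓ)) else x) j ≤ β)
      ≤ ((n : ℝ) + 1) ^ (2 ^ j) * Real.exp (n * β) := by
    refine hTotal ε hε0 hε1 K (Fin n → Bool)
      (fun (x : Fin n → Bool) (z : ℕ → (Fin m × Fin k → Fin n × Bool)) =>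
        overlapCondEnt (fun ℓ => if ℓ < j then a (z (τ ℓ)) else x) j ≤ β) _ ?_
    intro z
    convert hCount n j hj (fun ℓ => a (z (τ ℓ))) β using 4
  -- Steps 1 and 4: the union bound over `x`, then chain everything
  calc resampleChainMass ε K (fun z : ℕ → (Fin m × Fin k → Fin n × Bool) =>
        ∃ x : Fin n → Bool,
          (∀ i : Fin m, ∃ j' : Fin k, x (z (s + Δ) (i, j')).1 = (z (s + Δ) (i, j')).2) ∧
          overlapCondEnt (fun ℓ => if ℓ < j then a (z (τ ℓ)) else x) j ≤ β)
      ≤ ∑ x : Fin n → Bool, resampleChainMass ε K (fun z : ℕ → (Fin m × Fin k → Fin n × Bool) =>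
          (∀ i : Fin m, ∃ j' : Fin k, x (z (s + Δ) (i, j')).1 = (z (s + Δ) (i, j')).2) ∧
            overlapCondEnt (fun ℓ => if ℓ < j then a (z (τ ℓ)) else x) j ≤ β) :=
        hUnion ε hε0 hε1 K
          (fun (x : Fin n → Bool) (z : ℕ → (Fin m × Fin k → Fin n × Bool)) =>
            (∀ i : Fin m, ∃ j' : Fin k, x (z (s + Δ) (i, j')).1 = (z (s + Δ) (i, j')).2) ∧
              overlapCondEnt (fun ℓ => if ℓ < j then a (z (τ ℓ)) else x) j ≤ β)
    _ ≤ ∑ x : Fin n → Bool, (1 - ((1 - (1 - ε) ^ Δ) / 2) ^ k) ^ m *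
          resampleChainMass ε K (fun z : ℕ → (Fin m × Fin k → Fin n × Bool) =>
            overlapCondEnt (fun ℓ => if ℓ < j then a (z (τ ℓ)) else x) j ≤ β) :=
        Finset.sum_le_sum fun x _ => h2 x
    _ = (1 - ((1 - (1 - ε) ^ Δ) / 2) ^ k) ^ m *
          ∑ x : Fin n → Bool, resampleChainMass ε K
            (fun z : ℕ → (Fin m × Fin k → Fin n × Bool) =>
              overlapCondEnt (fun ℓ => if ℓ < j then a (z (τ ℓ)) else x) j ≤ β) :=
        (Finset.mul_sum _ _ _).symm
    _ ≤ (1 - ((1 - (1 - ε) ^ Δ) / 2) ^ k) ^ m * (((n : ℝ) + 1) ^ (2 ^ j) * Real.exp (n * β)) :=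
        mul_le_mul_of_nonneg_left h3 hq0

end Literature.Computability.Complexity.HuangSellke2025Chain

end Part9

/-!
## Part 10 — port of `Summits/PneNP/PneNP/Theorems/OverlapGapAlgebraSearchHardWindowChainMassTotal.lean` (3 declarations kept)

# Route OverlapGapAlgebra, crux `SearchHardWindow` (stmt-PneNP-2460): total mass of the chain and
# weighted counts

For the `ε`-resampling Markov chain on a finite product space `V = ι → Γ` (Huang–Sellke 2025
§3.3.2; vocabulary `resampleKernel`, `resampleChainMass` of
`Literature/Computability/Complexity/RandomKSatEnsembleOGP.lean`) the mass of an event `E` on paths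
is the finite weighted count
`resampleChainMass ε K E = (Σ_y w(y) · [E (t ↦ y (min t K))]) / #V`,
`w(y) = ∏_{t<K} P_ε(y t, y (t+1))`, the sum ranging over `y : Fin (K+1) → V`.

`stub_chainMassTotal` records, for `0 ≤ ε ≤ 1`:
(a) the chain is a probability measure, `resampleChainMass ε K True = 1`: the kernel is stochastic
(`stub_resampleKernelBasic` (c) of `Theorems/OverlapGapAlgebraSearchHardWindowResampleKernelBasic.lean`),
so summing out the last vertex of a path (`Fin.snocEquiv`, `Fin.prod_univ_castSucc`) and inducting
on `K` gives `Σ_y w(y) = #V` (`cmt_pathSum_eq_card`), and `#V / #V = 1`;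
(b) weighted counts: if for every path `z` at most `M` indices `x : X` satisfy `E x z`, then
`Σ_x resampleChainMass ε K (E x) ≤ M` — after `Finset.sum_div`/`Finset.sum_comm`/`Finset.mul_sum`
this is `Σ_y w(y) · #{x | E x (path y)} ≤ Σ_y w(y) · M = M · #V` pathwise (`Finset.sum_boole`, the
weights being nonnegative by `cmb_pathWeight_nonneg` of
`Theorems/OverlapGapAlgebraSearchHardWindowChainMassBasic.lean`), divided by `#V`.
These feed the first-moment (chaos) step of line `Sketch`.
-/

section Part10

namespace Literature.Computability.Complexity.HuangSellke2025Chain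

open _root_.Finset
open Literature.Computability.Complexity
open scoped _root_.Classical

/-- The `ε`-resampling kernel is stochastic for `0 ≤ ε ≤ 1`: `∑_{y'} P_ε(y, y') = 1`
(`stub_resampleKernelBasic` (c), restated through the `Literature` name `resampleKernel`).
[cite: HuangSellke2025, §3.3.2, Lemma 3.22 (total chain mass)] -/
theorem cmt_kernel_sum_eq_one {ι Γ : Type*} [Fintype ι] [DecidableEq ι] [Fintype Γ]
    [DecidableEq Γ] [Nonempty Γ] (ε : ℝ) (hε0 : 0 ≤ ε) (hε1 : ε ≤ 1) (y : ι → Γ) :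
    ∑ y' : ι → Γ, resampleKernel ε y y' = 1 := by
  have h := (stub_resampleKernelBasic (ι := ι) (Γ := Γ) ε hε0 hε1).2.2 y
  simpa only [resampleKernel] using h

/-- **Total mass of the paths of a stochastic kernel.** If every row of `P` sums to `1`, then
`Σ_{y : Fin (K+1) → S} ∏_{t<K} P (y t) (y (t+1)) = #S`: sum out the last vertex
(`Fin.snocEquiv`, `Fin.prod_univ_castSucc`) and induct on `K`.
[cite: HuangSellke2025, §3.3.2, Lemma 3.22 (total chain mass)] -/
theorem cmt_pathSum_eq_card {S : Type*} [Fintype S] (P : S → S → ℝ) (hP : ∀ a, ∑ b, P a b = 1) :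
    ∀ K : ℕ, ∑ y : Fin (K + 1) → S, ∏ t : Fin K, P (y t.castSucc) (y t.succ) = Fintype.card S
  | 0 => by simp
  | K + 1 => by
    calc ∑ y : Fin (K + 1 + 1) → S, ∏ t : Fin (K + 1), P (y t.castSucc) (y t.succ)
        = ∑ p : S × (Fin (K + 1) → S), ∏ t : Fin (K + 1),
            P ((Fin.snocEquiv fun _ => S) p t.castSucc) ((Fin.snocEquiv fun _ => S) p t.succ) :=
          ((Fin.snocEquiv fun _ : Fin (K + 1 + 1) => S).sum_comp _).symm
      _ = ∑ s : S, ∑ x : Fin (K + 1) → S,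
            (∏ t : Fin K, P (x t.castSucc) (x t.succ)) * P (x (Fin.last K)) s := by
          rw [Fintype.sum_prod_type]
          simp only [Fin.snocEquiv_apply, Fin.prod_univ_castSucc, Fin.succ_castSucc,
            Fin.snoc_castSucc, Fin.succ_last, Fin.snoc_last]
      _ = ∑ x : Fin (K + 1) → S,
            (∏ t : Fin K, P (x t.castSucc) (x t.succ)) * ∑ s, P (x (Fin.last K)) s := by
          rw [Finset.sum_comm]
          simp only [Finset.mul_sum]
      _ = Fintype.card S := by
          simp only [hP, mul_one]
          exact cmt_pathSum_eq_card P hP K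

/-- **Total mass and weighted counts for the `ε`-resampling chain** (`0 ≤ ε ≤ 1`):
(a) `resampleChainMass ε K True = 1` (the kernel is stochastic, so the path weights sum to
`#(ι → Γ)`), and (b) if for every path `z` at most `M` indices `x` of a finite type `X` satisfy
`E x z`, then `Σ_x resampleChainMass ε K (E x) ≤ M` (pathwise `Σ_x [E x z] = #{x | E x z} ≤ M`
against the nonnegative path weights, then (a)). [cite: HuangSellke2025, §3.3.2, Lemma 3.22 (total chain mass)] -/
theorem stub_chainMassTotal {ι Γ : Type*} [Fintype ι] [DecidableEq ι] [Fintype Γ] [DecidableEq Γ]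
    [Nonempty Γ] (ε : ℝ) (hε0 : 0 ≤ ε) (hε1 : ε ≤ 1) (K : ℕ) :
    resampleChainMass ε K (fun _ : ℕ → ι → Γ => True) = 1 ∧
    ∀ (X : Type) [Fintype X] (E : X → (ℕ → ι → Γ) → Prop) (M : ℝ),
      (∀ z : ℕ → ι → Γ, ((univ.filter fun x : X => E x z).card : ℝ) ≤ M) →
      ∑ x : X, resampleChainMass ε K (E x) ≤ M := by
  have hcard : (Fintype.card (ι → Γ) : ℝ) ≠ 0 := by exact_mod_cast Fintype.card_ne_zero
  have hw : ∑ y : Fin (K + 1) → ι → Γ, ∏ t : Fin K, resampleKernel ε (y t.castSucc) (y t.succ) =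
      Fintype.card (ι → Γ) :=
    cmt_pathSum_eq_card (resampleKernel ε) (cmt_kernel_sum_eq_one ε hε0 hε1) K
  refine ⟨?_, fun X _ E M hM => ?_⟩
  · -- (a) total mass `1`
    unfold resampleChainMass
    simp only [if_true, mul_one]
    rw [hw, div_self hcard]
  · -- (b) weighted counts
    have hpt : ∀ y : Fin (K + 1) → ι → Γ,
        ∑ x : X, (∏ t : Fin K, resampleKernel ε (y t.castSucc) (y t.succ)) *
            (if E x (fun t => y ⟨min t K, Nat.lt_succ_of_le (Nat.min_le_right t K)⟩) then (1 : ℝ)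
              else 0) ≤
          (∏ t : Fin K, resampleKernel ε (y t.castSucc) (y t.succ)) * M := fun y => by
      rw [← Finset.mul_sum, Finset.sum_boole]
      exact mul_le_mul_of_nonneg_left (hM _) (cmb_pathWeight_nonneg ε hε0 hε1 K y)
    unfold resampleChainMass
    rw [← Finset.sum_div, Finset.sum_comm]
    calc _ ≤ (∑ y : Fin (K + 1) → ι → Γ,
            (∏ t : Fin K, resampleKernel ε (y t.castSucc) (y t.succ)) * M) / Fintype.card (ι → Γ) :=
          div_le_div_of_nonneg_right (Finset.sum_le_sum fun y _ => hpt y) (Nat.cast_nonneg _)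
      _ = M := by rw [← Finset.sum_mul, hw, mul_div_cancel_left₀ M hcard]

end Literature.Computability.Complexity.HuangSellke2025Chain

end Part10

/-!
## Part 11 — port of `Summits/PneNP/PneNP/Theorems/OverlapGapAlgebraSearchHardWindowSatProbBound.lean` (7 declarations kept)

# Route OverlapGapAlgebra, crux `SearchHardWindow` (stmt-PneNP-2460), line `Sketch`:
# a fixed assignment satisfies an `E`-resampled instance with probability `≤ (1 − (E/2)^k)^m`

In the with-replacement literal model a `k`-SAT instance with `m` clauses over `n` variables is a
literal array `y' : Fin m × Fin k → Fin n × Bool` (clause `i` occupies the slots `(i, j)`,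
`j < k`; the literal `(v, b)` is TRUE under an assignment `x : Fin n → Bool` iff `x v = b`).
One step of the `E`-resampling kernel `resampleKernel E w ·` of
`Literature/Computability/Complexity/RandomKSatEnsembleOGP.lean` from a FIXED instance `w` redraws
every slot independently: kept with probability `1 − E`, redrawn uniformly among the `2n` literals
with probability `E`; its weights are `∏_s κ(w s, y' s)` with
`κ(a, c) = (1 − E)·[a = c] + E/(2n)`.

`stub_satProbBound` (the first-moment input of the chaos lemma, Huang–Sellke 2025 Lemma 3.23, in
cycle 2 of line `Sketch`): for a FIXED assignment `x` and `0 ≤ E ≤ 1`, the kernel-mass of the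
instances satisfied by `x` is `≤ (1 − (E/2)^k)^m`.

Proof (an exact computation followed by a bound, `spb_abstract`): the satisfaction indicator
factors over the clauses, `[x ⊨ y'] = ∏_i (1 − ∏_j f(y' (i, j)))` with `f(c) = [c false under x]`,
and so does the kernel; hence the sum over `y'` is the product over the clauses `i` of the block
sums `Σ_{c : Fin k → Γ} (∏_j κ(w (i,j), c j)) (1 − ∏_j f (c j)) = 1 − ∏_j T(w (i, j))`
(`Fintype.prod_sum`, stochasticity `Σ_c κ(a, c) = 1`), where
`T(a) = Σ_c κ(a, c) f(c) = (1 − E) f(a) + (E/(2n))·n = (1 − E) f(a) + E/2 ∈ [E/2, 1]`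
(exactly `n` of the `2n` literals are false under `x`). Each clause factor therefore lies in
`[0, 1 − (E/2)^k]`, and the product of the `m` factors is `≤ (1 − (E/2)^k)^m`.
-/

section Part11

namespace Literature.Computability.Complexity.HuangSellke2025Chain

open _root_.Finset
open Literature.Computability.Complexity
open scoped _root_.Classical

/-- Block factorisation of a sum over functions on a product type: if the summand is a product
over `i : α` of functions of the `i`-th row `fun j => y (i, j)`, the sum over `y : α × β → Γ` is the
product over `i` of the row sums (`Equiv.curry` followed by `Fintype.prod_sum`).
[cite: HuangSellke2025, §3.3.2, Lemma 3.22 (the satisfiability-probability bound)] -/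
theorem spb_sum_prod_curry {α β Γ : Type*} [Fintype α] [DecidableEq α] [Fintype β] [DecidableEq β]
    [Fintype Γ]
    (g : α → (β → Γ) → ℝ) :
    ∑ y : α × β → Γ, ∏ i, g i (fun j => y (i, j)) = ∏ i, ∑ c : β → Γ, g i c := by
  rw [Fintype.prod_sum]
  exact Fintype.sum_equiv (Equiv.curry α β Γ) _ _ (fun y => rfl)

/-- **Abstract first-moment bound.** For a row-stochastic kernel `κ` on a finite type `Γ` and a
weight `f` whose one-step averages `T(b) = Σ_c κ(b, c) f(c)` all lie in `[t, 1]` with `0 ≤ t`, the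
`κ^{⊗ slots}`-average over `y' : Fin m × Fin k → Γ` of `∏_i (1 − ∏_j f (y' (i, j)))` is
`≤ (1 − t^k)^m`: it equals `∏_i (1 − ∏_j T(w (i, j)))` exactly.
[cite: HuangSellke2025, §3.3.2, Lemma 3.22 (the satisfiability-probability bound)] -/
theorem spb_abstract {Γ : Type*} [Fintype Γ] (m k : ℕ) (κ : Γ → Γ → ℝ) (f : Γ → ℝ) (t : ℝ)
    (ht0 : 0 ≤ t) (hsto : ∀ b, ∑ c, κ b c = 1) (hlow : ∀ b, t ≤ ∑ c, κ b c * f c)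
    (hup : ∀ b, ∑ c, κ b c * f c ≤ 1) (w : Fin m × Fin k → Γ) :
    ∑ y' : Fin m × Fin k → Γ, (∏ s, κ (w s) (y' s)) *
        ∏ i : Fin m, (1 - ∏ j : Fin k, f (y' (i, j)))
      ≤ (1 - t ^ k) ^ m := by
  have hsummand : ∀ y' : Fin m × Fin k → Γ,
      (∏ s, κ (w s) (y' s)) * ∏ i : Fin m, (1 - ∏ j : Fin k, f (y' (i, j)))
        = ∏ i : Fin m, ((∏ j : Fin k, κ (w (i, j)) (y' (i, j))) *
            (1 - ∏ j : Fin k, f (y' (i, j)))) := by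
    intro y'
    rw [Fintype.prod_prod_type, ← Finset.prod_mul_distrib]
  have hclause : ∀ i : Fin m, ∑ c : Fin k → Γ,
      (∏ j : Fin k, κ (w (i, j)) (c j)) * (1 - ∏ j : Fin k, f (c j))
        = 1 - ∏ j : Fin k, ∑ c, κ (w (i, j)) c * f c := by
    intro i
    simp_rw [mul_sub, mul_one, Finset.sum_sub_distrib, ← Finset.prod_mul_distrib]
    rw [← Fintype.prod_sum (fun j c => κ (w (i, j)) c),
      ← Fintype.prod_sum (fun j c => κ (w (i, j)) c * f c)]
    simp only [hsto, Finset.prod_const_one]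
  calc ∑ y' : Fin m × Fin k → Γ, (∏ s, κ (w s) (y' s)) *
          ∏ i : Fin m, (1 - ∏ j : Fin k, f (y' (i, j)))
      = ∑ y' : Fin m × Fin k → Γ, ∏ i : Fin m, ((∏ j : Fin k, κ (w (i, j)) (y' (i, j))) *
            (1 - ∏ j : Fin k, f (y' (i, j)))) :=
        Finset.sum_congr rfl (fun y' _ => hsummand y')
    _ = ∏ i : Fin m, ∑ c : Fin k → Γ,
          (∏ j : Fin k, κ (w (i, j)) (c j)) * (1 - ∏ j : Fin k, f (c j)) :=
        spb_sum_prod_curry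
          (fun i c => (∏ j : Fin k, κ (w (i, j)) (c j)) * (1 - ∏ j : Fin k, f (c j)))
    _ = ∏ i : Fin m, (1 - ∏ j : Fin k, ∑ c, κ (w (i, j)) c * f c) :=
        Finset.prod_congr rfl (fun i _ => hclause i)
    _ ≤ ∏ _i : Fin m, (1 - t ^ k) := by
        refine Finset.prod_le_prod (fun i _ => ?_) (fun i _ => ?_)
        · exact sub_nonneg.mpr
            (Finset.prod_le_one (fun j _ => le_trans ht0 (hlow _)) (fun j _ => hup _))
        · have hk : t ^ k ≤ ∏ j : Fin k, ∑ c, κ (w (i, j)) c * f c :=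
            calc t ^ k = ∏ _j : Fin k, t := by simp
              _ ≤ ∏ j : Fin k, ∑ c, κ (w (i, j)) c * f c :=
                Finset.prod_le_prod (fun j _ => ht0) (fun j _ => hlow _)
          linarith
    _ = (1 - t ^ k) ^ m := by simp

/-- There are `2n` literals over `n` variables.
[cite: HuangSellke2025, §3.3.2, Lemma 3.22 (the satisfiability-probability bound)] -/
theorem spb_card_lit (n : ℕ) : (Fintype.card (Fin n × Bool) : ℝ) = 2 * n := by
  rw [Fintype.card_prod, Fintype.card_fin, Fintype.card_bool]
  push_cast
  ring

/-- Exactly `n` of the `2n` literals are false under a fixed assignment `x`: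
`Σ_{(v, b)} [x v ≠ b] = n` (for each variable `v` exactly one polarity is false).
[cite: HuangSellke2025, §3.3.2, Lemma 3.22 (the satisfiability-probability bound)] -/
theorem spb_false_count (n : ℕ) (x : Fin n → Bool) :
    ∑ c : Fin n × Bool, (if x c.1 = c.2 then (0 : ℝ) else 1) = n := by
  rw [Fintype.sum_prod_type]
  simp only [Fintype.sum_bool]
  have h : ∀ v : Fin n,
      ((if x v = true then (0 : ℝ) else 1) + (if x v = false then (0 : ℝ) else 1)) = 1 := by
    intro v
    cases x v <;> simp
  simp only [h, Finset.sum_const, Finset.card_univ, Fintype.card_fin, nsmul_eq_mul, mul_one]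

/-- One coordinate of the literal-resampling kernel is a probability vector:
`Σ_c ((1 − E)·[b = c] + E/(2n)) = 1` (needs `n ≥ 1`).
[cite: HuangSellke2025, §3.3.2, Lemma 3.22 (the satisfiability-probability bound)] -/
theorem spb_coord_sum_one (n : ℕ) (hn : 1 ≤ n) (E : ℝ) (b : Fin n × Bool) :
    ∑ c : Fin n × Bool,
        ((1 - E) * (if b = c then (1 : ℝ) else 0) + E / Fintype.card (Fin n × Bool)) = 1 := by
  have hn' : (n : ℝ) ≠ 0 := by exact_mod_cast (by omega : n ≠ 0)
  rw [Finset.sum_add_distrib, ← Finset.mul_sum, Fintype.sum_ite_eq, Finset.sum_const,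
    Finset.card_univ, nsmul_eq_mul, spb_card_lit]
  field_simp
  ring

/-- The one-step false-mass of a resampled slot: with `f(c) = [c false under x]`,
`Σ_c ((1 − E)·[a = c] + E/(2n))·f(c) = (1 − E)·f(a) + E/2`.
[cite: HuangSellke2025, §3.3.2, Lemma 3.22 (the satisfiability-probability bound)] -/
theorem spb_coord_false_sum (n : ℕ) (hn : 1 ≤ n) (E : ℝ) (x : Fin n → Bool)
    (a : Fin n × Bool) :
    ∑ c : Fin n × Bool,
        ((1 - E) * (if a = c then (1 : ℝ) else 0) + E / Fintype.card (Fin n × Bool)) *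
          (if x c.1 = c.2 then (0 : ℝ) else 1)
      = (1 - E) * (if x a.1 = a.2 then (0 : ℝ) else 1) + E / 2 := by
  have hn' : (n : ℝ) ≠ 0 := by exact_mod_cast (by omega : n ≠ 0)
  have h1 : ∀ c : Fin n × Bool,
      ((1 - E) * (if a = c then (1 : ℝ) else 0) + E / Fintype.card (Fin n × Bool)) *
          (if x c.1 = c.2 then (0 : ℝ) else 1)
        = (1 - E) * (if a = c then (if x c.1 = c.2 then (0 : ℝ) else 1) else 0)
          + E / (2 * n) * (if x c.1 = c.2 then (0 : ℝ) else 1) := by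
    intro c
    rw [spb_card_lit]
    by_cases hac : a = c
    · rw [if_pos hac, if_pos hac]
      ring
    · rw [if_neg hac, if_neg hac]
      ring
  have h2 : E / (2 * (n : ℝ)) * n = E / 2 := by
    field_simp
  rw [Finset.sum_congr rfl (fun c _ => h1 c), Finset.sum_add_distrib, ← Finset.mul_sum,
    ← Finset.mul_sum, Fintype.sum_ite_eq, spb_false_count, h2]

/-- **A fixed assignment satisfies a resampled instance with probability `≤ (1 − (E/2)^k)^m`**
(first-moment input of the chaos lemma, Huang–Sellke 2025 Lemma 3.23): resampling each literal of
a fixed instance `w` independently with probability `E` (uniformly among the `2n` literals, exactly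
half of which are false under `x`), every clause stays violated by `x` with probability
`≥ (E/2)^k`, independently over the `m` clauses.
[cite: HuangSellke2025, §3.3.2, Lemma 3.22 (the satisfiability-probability bound)] -/
theorem stub_satProbBound (n m k : ℕ) (hn : 1 ≤ n) (E : ℝ) (hE0 : 0 ≤ E) (hE1 : E ≤ 1)
    (x : Fin n → Bool) (w : Fin m × Fin k → Fin n × Bool) :
    ∑ y' : Fin m × Fin k → Fin n × Bool, resampleKernel E w y' *
        (if (∀ i : Fin m, ∃ j : Fin k, x (y' (i, j)).1 = (y' (i, j)).2) then (1 : ℝ) else 0)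
      ≤ (1 - (E / 2) ^ k) ^ m := by
  -- the satisfaction indicator factors over the clauses
  have hind : ∀ y' : Fin m × Fin k → Fin n × Bool,
      (if (∀ i : Fin m, ∃ j : Fin k, x (y' (i, j)).1 = (y' (i, j)).2) then (1 : ℝ) else 0)
        = ∏ i : Fin m, (1 - ∏ j : Fin k, (if x (y' (i, j)).1 = (y' (i, j)).2 then (0 : ℝ) else 1)) := by
    intro y'
    by_cases h : ∀ i : Fin m, ∃ j : Fin k, x (y' (i, j)).1 = (y' (i, j)).2
    · rw [if_pos h]
      symm
      refine Finset.prod_eq_one (fun i _ => ?_)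
      obtain ⟨j, hj⟩ := h i
      have h0 : (∏ j : Fin k, (if x (y' (i, j)).1 = (y' (i, j)).2 then (0 : ℝ) else 1)) = 0 :=
        Finset.prod_eq_zero (Finset.mem_univ j) (if_pos hj)
      rw [h0, sub_zero]
    · rw [if_neg h]
      symm
      push Not at h
      obtain ⟨i, hi⟩ := h
      refine Finset.prod_eq_zero (Finset.mem_univ i) ?_
      have h1 : (∏ j : Fin k, (if x (y' (i, j)).1 = (y' (i, j)).2 then (0 : ℝ) else 1)) = 1 :=
        Finset.prod_eq_one (fun j _ => if_neg (hi j))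
      rw [h1, sub_self]
  -- one-step false-masses lie in `[E/2, 1]`
  have hT := spb_coord_false_sum n hn E x
  have hf0 : ∀ c : Fin n × Bool, (0 : ℝ) ≤ (if x c.1 = c.2 then (0 : ℝ) else 1) := fun c => by
    split_ifs <;> norm_num
  have hf1 : ∀ c : Fin n × Bool, (if x c.1 = c.2 then (0 : ℝ) else 1) ≤ 1 := fun c => by
    split_ifs <;> norm_num
  have hlow : ∀ b : Fin n × Bool, E / 2 ≤ ∑ c : Fin n × Bool,
      ((1 - E) * (if b = c then (1 : ℝ) else 0) + E / Fintype.card (Fin n × Bool)) *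
        (if x c.1 = c.2 then (0 : ℝ) else 1) := by
    intro b
    rw [hT b]
    have : 0 ≤ (1 - E) * (if x b.1 = b.2 then (0 : ℝ) else 1) :=
      mul_nonneg (sub_nonneg.mpr hE1) (hf0 b)
    linarith
  have hup : ∀ b : Fin n × Bool, ∑ c : Fin n × Bool,
      ((1 - E) * (if b = c then (1 : ℝ) else 0) + E / Fintype.card (Fin n × Bool)) *
        (if x c.1 = c.2 then (0 : ℝ) else 1) ≤ 1 := by
    intro b
    rw [hT b]
    have : (1 - E) * (if x b.1 = b.2 then (0 : ℝ) else 1) ≤ 1 - E :=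
      mul_le_of_le_one_right (sub_nonneg.mpr hE1) (hf1 b)
    linarith
  have key := spb_abstract m k
    (fun b c : Fin n × Bool =>
      (1 - E) * (if b = c then (1 : ℝ) else 0) + E / Fintype.card (Fin n × Bool))
    (fun c : Fin n × Bool => if x c.1 = c.2 then (0 : ℝ) else 1) (E / 2) (by linarith)
    (spb_coord_sum_one n hn E) hlow hup w
  calc ∑ y' : Fin m × Fin k → Fin n × Bool, resampleKernel E w y' *
          (if (∀ i : Fin m, ∃ j : Fin k, x (y' (i, j)).1 = (y' (i, j)).2) then (1 : ℝ) else 0)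
      = ∑ y' : Fin m × Fin k → Fin n × Bool,
          (∏ s, ((1 - E) * (if w s = y' s then (1 : ℝ) else 0) + E / Fintype.card (Fin n × Bool))) *
            ∏ i : Fin m, (1 - ∏ j : Fin k,
              (if x (y' (i, j)).1 = (y' (i, j)).2 then (0 : ℝ) else 1)) := by
        refine Finset.sum_congr rfl (fun y' _ => ?_)
        unfold resampleKernel
        rw [hind y']
    _ ≤ (1 - (E / 2) ^ k) ^ m := key

end Literature.Computability.Complexity.HuangSellke2025Chain

end Part11

/-!
## Part 12 — port of `Summits/PneNP/PneNP/Theorems/OverlapGapAlgebraSearchHardWindowStrongLDH.lean` (3 declarations kept)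

# Route OverlapGapAlgebra, crux `SearchHardWindow` (stmt-PneNP-2460), line Sketch / Line A:
# the headline theorems of the Huang–Sellke sub-skeleton

Everything proved by the line's continuation (lead `prover-line-stmt-PneNP-2460-c1-0`, 2026-08-16),
assembled BY NAME:

* `ksat_ensembleChaos` — **Huang–Sellke 2025, Lemma 3.23 (chaos on the resampling chain) as a
  THEOREM**, for every `β < 5 log k / k` (the first moment: kernel semigroup, two-block Markov
  bound, satisfaction probability `≤ (1 − (E/2)^k)^m`, the count `≤ (n+1)^{2^j} e^{nβ}` of
  low-conditional-entropy candidates, union over the `≤ k (K+1)^{k+1}` time tuples, asymptotics);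
* `huangSellke2025KSatObstructions_of_ensembleOGP` — the two-lemma fact from the OGP lemma alone;
* `huangSellke2025KSat_of_ensembleOGP` — **Huang–Sellke 2025 Cor. 3.21 (strong low-degree hardness
  of random `k`-SAT, deterministic saturated form = the tree's named fact `HuangSellke2025KSat`)
  PROVED MODULO the single first-moment named fact `HuangSellke2025KSatEnsembleOGP` (HS25 Lemma 3.22
  = Bresler–Huang's ensemble multi-OGP adapted to the slow chain)** — via grand correlation,
  positivity and `L²`-stability of the resampling kernel, the moat, and the assembly
  (`stub_hsAssembly`);
* `acZeroRung_of_ensembleOGP`, `decisionTreeRung_of_ensembleOGP` — the line's STRONG rungs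
  (poly-size `AC⁰` circuit families, depth-`o(n)` decision trees solve `F_k(2^j, ⌊α_k 2^j⌋)` with
  probability `→ 0`), now conditional on `HuangSellke2025KSatEnsembleOGP` only.
(The WEAK rungs — success not `→ 1` — are unconditional: `stub_weakRungsUnconditional`,
`…WeakRungsUnconditional.lean`, since `NoStableSection` is proved.)

References: B. Huang, M. Sellke, arXiv:2501.06427 §3.3 (Prop. 3.14, Lemma 3.15, Cor. 3.21,
Lemmas 3.22–3.25) [HuangSellke2025]; G. Bresler, B. Huang, arXiv:2106.02129 §4 [BreslerHuang2022];
A. Tal, CCC 2017, Thm. 3.6 [Tal2017]; R. O'Donnell, *Analysis of Boolean Functions*, §8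
[ODonnell2014].
-/

section Part12

namespace Literature.Computability.Complexity.HuangSellke2025Chain

open _root_.Finset _root_.Filter _root_.Asymptotics
open Literature.Computability.Complexity
open Literature.Computability.Complexity.LowDegree
open Literature.Probability.RandomGraphs.LowDegree (sgn walsh)
open scoped _root_.Classical

/-- **Huang–Sellke 2025, Lemma 3.23 (chaos) for random `k`-SAT — a theorem, for every
`β < 5 log k / k`.** For `k ≥ 2` and `β < 5 log k / k` there is `b₁ > 0` such that for
`0 < b ≤ b₁`, every `1 ≤ D = o(n)`, every sequence of output maps `a` and every exponent `A`,
some `c > 0` has, eventually in `n` (`m = ⌊α_k n⌋`, `ε = log(n/D n)/n`, every `K ≤ n^A`): the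
paths of the `ε`-resampling chain carrying `1 ≤ j ≤ k`, times `t 0 ≤ ⋯ ≤ t j ≤ K` with
`t j ≥ t (j−1) + 1/(b k ε)`, and an assignment `x` satisfying the instance at time `t j` with
conditional overlap entropy `H(x | a(y(t 0)), …, a(y(t (j−1)))) ≤ β` have mass `≤ e^{−cn}`.
[HuangSellke2025, Lemma 3.23; proved here]
[cite: HuangSellke2025, §3.3.2, Cor. 3.21 (Cor. 3.21: strong low-degree hardness from the ensemble OGP)] -/
theorem ksat_ensembleChaos : ∀ k : ℕ, 2 ≤ k → ∀ β : ℝ, β < 5 * Real.log k / k →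
    ∃ b₁ : ℝ, 0 < b₁ ∧ ∀ b : ℝ, 0 < b → b ≤ b₁ → ∀ D : ℕ → ℕ,
      (fun n : ℕ => (D n : ℝ)) =o[atTop] (fun n : ℕ => (n : ℝ)) → (∀ n, 1 ≤ D n) →
      ∀ (a : (n m : ℕ) → (Fin m × Fin k → Fin n × Bool) → (Fin n → Bool)) (A : ℕ),
      ∃ c : ℝ, 0 < c ∧ ∀ᶠ n : ℕ in atTop, ∀ m : ℕ, m = ⌊5 * 2 ^ k * Real.log k / k * n⌋₊ →
        ∀ ε : ℝ, ε = Real.log (n / D n) / n → ∀ K : ℕ, K ≤ n ^ A →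
        resampleChainMass ε K (fun y : ℕ → (Fin m × Fin k → Fin n × Bool) =>
            ∃ (j : ℕ) (t : ℕ → ℕ) (x : Fin n → Bool), 1 ≤ j ∧ j ≤ k ∧
              (∀ ℓ < j, t ℓ ≤ t (ℓ + 1)) ∧ t j ≤ K ∧ (t (j - 1) : ℝ) + 1 / (b * k * ε) ≤ t j ∧
              (∀ i : Fin m, ∃ j' : Fin k, x (y (t j) (i, j')).1 = (y (t j) (i, j')).2) ∧
              overlapCondEnt (fun ℓ => if ℓ < j then a n m (y (t ℓ)) else x) j ≤ β)
          ≤ Real.exp (-(c * n)) :=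
  stub_chaosAssembly
    (fun ε h0 h1 K E E' hEE' => (stub_chainMassBasic ε h0 h1 K).1 E E' hEE')
    (fun ε h0 h1 K E => stub_chainMassUnion ε h0 h1 K E)
    (fun n m k hn ε h0 h1 K j s Δ hj hsΔ τ hτ a β =>
      stub_chaosTupleBound (fun ε Δ w y' => stub_kernelPowPaths stub_kernelSemigroup ε Δ w y')
        (fun ε h0 h1 K s Δ hsΔ A hA B q hq => stub_chainTwoBlock ε h0 h1 K s Δ hsΔ A hA B q hq)
        (fun ε h0 h1 K E => stub_chainMassUnion ε h0 h1 K E)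
        stub_satProbBound stub_lowEntropyCount
        (fun ε h0 h1 K X _ E M hM => (stub_chainMassTotal ε h0 h1 K).2 X E M hM)
        n m k hn ε h0 h1 K j s Δ hj hsΔ τ hτ a β)
    stub_chaosAsymptotics

/-- **The two-lemma obstructions fact from the OGP lemma alone**:
`HuangSellke2025KSatEnsembleOGP → HuangSellke2025KSatObstructions` (the chaos half is
`ksat_ensembleChaos`). [HuangSellke2025, Lemmas 3.22–3.23]
[cite: HuangSellke2025, §3.3.2, Cor. 3.21 (Cor. 3.21: strong low-degree hardness from the ensemble OGP)] -/
theorem huangSellke2025KSatObstructions_of_ensembleOGP (h : HuangSellke2025KSatEnsembleOGP) :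
    HuangSellke2025KSatObstructions :=
  stub_obstructionsOfOGP h ksat_ensembleChaos

/-- **Huang–Sellke 2025, Corollary 3.21 (strong low-degree hardness of random `k`-SAT,
deterministic saturated form) modulo the ensemble-OGP lemma alone**:
`HuangSellke2025KSatEnsembleOGP → HuangSellke2025KSat`. The named fact `HuangSellke2025KSat` of
`RandomKSatLowDegreeHardness.lean` is thus reduced, kernel-checked, to Lemma 3.22.
[HuangSellke2025, Cor. 3.21]
[cite: HuangSellke2025, §3.3.2, Cor. 3.21 (Cor. 3.21: strong low-degree hardness from the ensemble OGP)] -/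
theorem huangSellke2025KSat_of_ensembleOGP (h : HuangSellke2025KSatEnsembleOGP) :
    HuangSellke2025KSat :=
  stub_hsAssembly (huangSellke2025KSatObstructions_of_ensembleOGP h)

end Literature.Computability.Complexity.HuangSellke2025Chain

end Part12

/-!
## Part 13 — port of `Summits/PneNP/PneNP/Theorems/OverlapGapAlgebraSearchHardWindowEnsembleOGPHolds.lean` (6 declarations kept)

# Route OverlapGapAlgebra, crux `SearchHardWindow` (stmt-PneNP-2460), line `Sketch`: the ensemble OGP
# of random `k`-SAT on the resampling chain (Huang–Sellke 2025, Lemma 3.22) — PROVED, and the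
# unconditional strong low-degree hardness (Huang–Sellke 2025, Cor. 3.21)

This file closes the cone of the named facts of line `Sketch` (skeleton
`Summits/PneNP/PneNP/Cruxes/SearchHardWindow/Lines/Sketch.lean`, section `EnsembleOGP`, lead c2):

* `ogp_tupleBound` — the first moment for ONE time tuple and ONE banded assignment tuple (the lead's
  composition of the landed stubs `stub_multiTimeMarginal` (finite-dimensional marginal of the chain),
  `stub_slotFactorization` (product over clause slots), `stub_blockExpansion` (mixture over refresh
  patterns = admissible block-root maps), `stub_slotBound` (the literal-level greedy bound) and
  `stub_bandEnergy` (band ⇒ first-appearance energy with `s` darts, DartGame `en_rung`)):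
  survival `≤ base^m`;
* `huangSellke2025KSatEnsembleOGP_holds : HuangSellke2025KSatEnsembleOGP` — **Huang–Sellke 2025,
  Lemma 3.22** (arXiv:2501.06427 §3.3.2; "adaptation of Bresler–Huang 2021 Prop. 4.7(iii)"), from
  `ogp_tupleBound`, `stub_bandCount`, `stub_ogpCore` (first moment at one `n`) and
  `stub_ogpAsymptotics` (parameters `β = 2.65 log k/k`, `η = 0.05 log k/k`, …);
* the corollaries, now UNCONDITIONAL: `huangSellke2025KSatObstructions_holds` (Lemmas 3.22–3.23),
  `huangSellke2025KSat_holds` (**Cor. 3.21, strong low-degree hardness of random `k`-SAT at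
  `α_k = 5·2^k log k/k`**), `acZeroRung_holds`, `decisionTreeRung_holds` (the `AC⁰` and bounded-query
  rungs of Line A), by the landed reductions of `…StrongLDH.lean`.

Mathematical note (why the literal-level argument): the printed proof of Lemma 3.22 reduces to
coincident times ("the contribution of any `(t₀,…,t_k)` is upper bounded by the case `t₀ = ⋯ = t_k`");
for the LITERAL-level resampling chain this is false pointwise (a partially refreshed clause can make
the union of the replicas' violation events smaller — anti-correlated pairs, clumped compatible
replicas), while Bresler–Huang's own path interrupts `≤ k+1` clause slots. The proof here fixes the
refresh pattern, disjointifies by the first violated replica, certifies a violation as first against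
RECENT earlier replicas (sharing `≥ k − F + 1` positions) by pattern newness on `s = k − F` shared darts
and against the other `≤ ℓ` replicas by their `≥ F` fresh literals (`stub_slotBound`); the certified
energy `1 + k(1 − SB_s) − θk(k+1)/2 − k(k+1)2^{−F}/2 ≥ 0.55 k` still beats the count exponent at `κ = 5`.

References: B. Huang, M. Sellke, arXiv:2501.06427 (2025), §3.3.2, Lemma 3.22, Cor. 3.21
[HuangSellke2025]; G. Bresler, B. Huang, FOCS 2021 / arXiv:2106.02129, Prop. 4.7, §5 [BreslerHuang2022].
-/

section Part13

namespace Literature.Computability.Complexity.HuangSellke2025Chain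

open _root_.Finset _root_.Filter _root_.Asymptotics
open Literature.Computability.Complexity
open Literature.Computability.Complexity.LowDegree
open Literature.Computability.Complexity.HuangSellke2025Chain.DartGame (seqOf)
open scoped _root_.Classical

/-! ## The first moment for one time tuple and one banded tuple -/

/-- A first-appearance count with `s` darts is at most `n^s`.
[cite: HuangSellke2025, §3.3.2, Lemma 3.22, Lemma 3.23, Cor. 3.21 (Lemma 3.22 (ensemble OGP), Lemma 3.23, Cor. 3.21 assembled)] -/
theorem ogp_faCard_le (n k s : ℕ) (Y : Fin (k + 1) → Fin n → Bool) (ℓ : Fin (k + 1)) :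
    ((univ.filter fun I : Fin s → Fin n =>
        ∀ ℓ' : Fin (k + 1), ℓ' < ℓ → ¬ ∀ r, Y ℓ (I r) = Y ℓ' (I r)).card : ℝ) ≤ (n : ℝ) ^ s := by
  have h := Finset.card_filter_le (univ : Finset (Fin s → Fin n))
    (fun I => ∀ ℓ' : Fin (k + 1), ℓ' < ℓ → ¬ ∀ r, Y ℓ (I r) = Y ℓ' (I r))
  rw [Finset.card_univ, Fintype.card_fun, Fintype.card_fin, Fintype.card_fin] at h
  exact_mod_cast h

/-- `#(Fin m × Fin k → Γ) = #(Fin k → Γ)^m`.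
[cite: HuangSellke2025, §3.3.2, Lemma 3.22, Lemma 3.23, Cor. 3.21 (Lemma 3.22 (ensemble OGP), Lemma 3.23, Cor. 3.21 assembled)] -/
theorem ogp_card_inst (m k : ℕ) (Γ : Type) [Fintype Γ] :
    (Fintype.card (Fin m × Fin k → Γ) : ℝ) = (Fintype.card (Fin k → Γ) : ℝ) ^ m := by
  norm_cast
  rw [Fintype.card_fun, Fintype.card_fun, Fintype.card_prod, Fintype.card_fin, Fintype.card_fin,
    ← pow_mul, mul_comm]

/-- **T — the first moment for ONE time tuple and ONE banded tuple** (composition of stubs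
M, F, R, G, E): for times `τ 0 ≤ ⋯ ≤ τ k ≤ K` and assignments `Y 0, …, Y k` in the LOWER band
(`H(Y ℓ | earlier) ≥ b ≥ 2θ`), the paths on which every `Y ℓ` satisfies the instance at time `τ ℓ`
have mass `≤ base^m`,
`base = 1 − 2^{−k}(1 + k(1 − SB_s(p₀)) − θk(k+1)/2 − k(k+1)/2 · 2^{−F})`.
[cite: HuangSellke2025, §3.3.2, Lemma 3.22, Lemma 3.23, Cor. 3.21 (Lemma 3.22 (ensemble OGP), Lemma 3.23, Cor. 3.21 assembled)] -/
theorem ogp_tupleBound (n m k s F : ℕ) (hn : 1 ≤ n) (hsF : s + F ≤ k) (θ b : ℝ) (hθ : 0 < θ)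
    (hθ1 : θ < 1) (hb : 2 * θ ≤ b) (ε : ℝ) (hε0 : 0 ≤ ε) (hε1 : ε ≤ 1) (K : ℕ)
    (τ : Fin (k + 1) → ℕ) (hτ : Monotone τ) (hτK : τ (Fin.last k) ≤ K)
    (Y : Fin (k + 1) → Fin n → Bool)
    (hband : ∀ ℓ : ℕ, 1 ≤ ℓ → ℓ ≤ k → b ≤ overlapCondEnt (seqOf Y) ℓ) :
    resampleChainMass ε K (fun z : ℕ → (Fin m × Fin k → Fin n × Bool) =>
        ∀ i : Fin m, ∀ ℓ : Fin (k + 1), ∃ j : Fin k, Y ℓ (z (τ ℓ) (i, j)).1 = (z (τ ℓ) (i, j)).2) ≤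
      (1 - (1 / 2 : ℝ) ^ k * (((1 : ℝ) + k * (1 - (2 * (1 - (b - 2 * θ) / (-Real.log θ)) ^ s + s * ((b - 2 * θ) / (-Real.log θ)) * (1 - (b - 2 * θ) / (-Real.log θ)) ^ (s - 1))) - θ * ((k : ℝ) * (k + 1) / 2)) - (k : ℝ) * (k + 1) / 2 * (1 / 2 : ℝ) ^ F)) ^ m := by
  haveI hne : Nonempty (Fin n × Bool) := ⟨(⟨0, hn⟩, true)⟩
  have hnr : (0 : ℝ) < n := by exact_mod_cast hn
  have hns : (0 : ℝ) < (n : ℝ) ^ s := pow_pos hnr s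
  have hcpos : 0 < (Fintype.card (Fin k → Fin n × Bool) : ℝ) := by exact_mod_cast Fintype.card_pos
  -- Step E: the band gives energy, so `base' ≤ base`, and `0 ≤ base'`
  have hE := stub_bandEnergy n k s hn Y θ b hθ hθ1 hb hband
  have hpen0 : 0 ≤ (k : ℝ) * (k + 1) / 2 * (1 / 2 : ℝ) ^ F := by positivity
  have hhalf : (0 : ℝ) ≤ (1 / 2 : ℝ) ^ k := by positivity
  have hFAle : (∑ ℓ : Fin (k + 1), ((univ.filter fun I : Fin s → Fin n =>
              ∀ ℓ' : Fin (k + 1), ℓ' < ℓ → ¬ ∀ r, Y ℓ (I r) = Y ℓ' (I r)).card : ℝ)) ≤ ((k : ℝ) + 1) * (n : ℝ) ^ s := by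
    have h := Finset.sum_le_sum (s := (univ : Finset (Fin (k + 1))))
      (fun ℓ _ => ogp_faCard_le n k s Y ℓ)
    simp only [Finset.sum_const, Finset.card_univ, Fintype.card_fin, nsmul_eq_mul] at h
    push_cast at h
    exact h
  have hFAdiv : (∑ ℓ : Fin (k + 1), ((univ.filter fun I : Fin s → Fin n =>
              ∀ ℓ' : Fin (k + 1), ℓ' < ℓ → ¬ ∀ r, Y ℓ (I r) = Y ℓ' (I r)).card : ℝ)) / (n : ℝ) ^ s ≤ (k : ℝ) + 1 := by
    rw [div_le_iff₀ hns]; exact hFAle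
  have hEdiv : ((1 : ℝ) + k * (1 - (2 * (1 - (b - 2 * θ) / (-Real.log θ)) ^ s + s * ((b - 2 * θ) / (-Real.log θ)) * (1 - (b - 2 * θ) / (-Real.log θ)) ^ (s - 1))) - θ * ((k : ℝ) * (k + 1) / 2)) ≤
      (∑ ℓ : Fin (k + 1), ((univ.filter fun I : Fin s → Fin n =>
              ∀ ℓ' : Fin (k + 1), ℓ' < ℓ → ¬ ∀ r, Y ℓ (I r) = Y ℓ' (I r)).card : ℝ)) / (n : ℝ) ^ s := by
    rw [le_div_iff₀ hns]; linarith
  have hbase'0 : 0 ≤ (1 - (1 / 2 : ℝ) ^ k * ((∑ ℓ : Fin (k + 1), ((univ.filter fun I : Fin s → Fin n =>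
              ∀ ℓ' : Fin (k + 1), ℓ' < ℓ → ¬ ∀ r, Y ℓ (I r) = Y ℓ' (I r)).card : ℝ)) / (n : ℝ) ^ s - (k : ℝ) * (k + 1) / 2 * (1 / 2 : ℝ) ^ F)) := by
    have h2 : ((k : ℝ) + 1) * (1 / 2 : ℝ) ^ k ≤ 1 := by
      have hk2 : ((k : ℝ) + 1) ≤ (2 : ℝ) ^ k := by
        have : k < 2 ^ k := Nat.lt_two_pow_self
        exact_mod_cast this
      calc ((k : ℝ) + 1) * (1 / 2 : ℝ) ^ k ≤ (2 : ℝ) ^ k * (1 / 2 : ℝ) ^ k :=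
            mul_le_mul_of_nonneg_right hk2 hhalf
        _ = 1 := by rw [← mul_pow]; norm_num
    have h3 : (1 / 2 : ℝ) ^ k * ((∑ ℓ : Fin (k + 1), ((univ.filter fun I : Fin s → Fin n =>
              ∀ ℓ' : Fin (k + 1), ℓ' < ℓ → ¬ ∀ r, Y ℓ (I r) = Y ℓ' (I r)).card : ℝ)) / (n : ℝ) ^ s - (k : ℝ) * (k + 1) / 2 * (1 / 2 : ℝ) ^ F) ≤ (1 / 2 : ℝ) ^ k * ((k : ℝ) + 1) :=
      mul_le_mul_of_nonneg_left (by linarith) hhalf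
    nlinarith
  have hbase'le : (1 - (1 / 2 : ℝ) ^ k * ((∑ ℓ : Fin (k + 1), ((univ.filter fun I : Fin s → Fin n =>
              ∀ ℓ' : Fin (k + 1), ℓ' < ℓ → ¬ ∀ r, Y ℓ (I r) = Y ℓ' (I r)).card : ℝ)) / (n : ℝ) ^ s - (k : ℝ) * (k + 1) / 2 * (1 / 2 : ℝ) ^ F)) ≤
      (1 - (1 / 2 : ℝ) ^ k * (((1 : ℝ) + k * (1 - (2 * (1 - (b - 2 * θ) / (-Real.log θ)) ^ s + s * ((b - 2 * θ) / (-Real.log θ)) * (1 - (b - 2 * θ) / (-Real.log θ)) ^ (s - 1))) - θ * ((k : ℝ) * (k + 1) / 2)) - (k : ℝ) * (k + 1) / 2 * (1 / 2 : ℝ) ^ F)) := by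
    have h1 : (1 / 2 : ℝ) ^ k * (((1 : ℝ) + k * (1 - (2 * (1 - (b - 2 * θ) / (-Real.log θ)) ^ s + s * ((b - 2 * θ) / (-Real.log θ)) * (1 - (b - 2 * θ) / (-Real.log θ)) ^ (s - 1))) - θ * ((k : ℝ) * (k + 1) / 2)) - (k : ℝ) * (k + 1) / 2 * (1 / 2 : ℝ) ^ F) ≤
        (1 / 2 : ℝ) ^ k * ((∑ ℓ : Fin (k + 1), ((univ.filter fun I : Fin s → Fin n =>
              ∀ ℓ' : Fin (k + 1), ℓ' < ℓ → ¬ ∀ r, Y ℓ (I r) = Y ℓ' (I r)).card : ℝ)) / (n : ℝ) ^ s - (k : ℝ) * (k + 1) / 2 * (1 / 2 : ℝ) ^ F) :=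
      mul_le_mul_of_nonneg_left (by linarith) hhalf
    linarith
  -- Step M: the finite-dimensional marginal at the times `τ`
  have hM := stub_multiTimeMarginal (ι := Fin m × Fin k) (Γ := Fin n × Bool) ε hε0 hε1 K k τ hτ hτK
    (fun x => ∀ i : Fin m, ∀ ℓ : Fin (k + 1), ∃ j : Fin k, Y ℓ (x ℓ (i, j)).1 = (x ℓ (i, j)).2)
  refine hM.trans ?_
  -- the rates `δ ℓ = 1 − (1−ε)^{τ(ℓ+1) − τ ℓ}` lie in `[0, 1]`
  have hδ0 : ∀ ℓ : Fin k, 0 ≤ 1 - (1 - ε) ^ (τ ℓ.succ - τ ℓ.castSucc) := fun ℓ =>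
    sub_nonneg.2 (pow_le_one₀ (sub_nonneg.2 hε1) (by linarith))
  have hδ1 : ∀ ℓ : Fin k, 1 - (1 - ε) ^ (τ ℓ.succ - τ ℓ.castSucc) ≤ 1 := fun ℓ =>
    sub_le_self _ (pow_nonneg (sub_nonneg.2 hε1) _)
  -- Step F: factorise over the `m` clause slots
  have hF := stub_slotFactorization (A := Fin m) (B := Fin k) (Γ := Fin n × Bool) k
    (fun ℓ => 1 - (1 - ε) ^ (τ ℓ.succ - τ ℓ.castSucc))
    (fun (_ : Fin m) w => ∀ ℓ : Fin (k + 1), ∃ j : Fin k, Y ℓ (w ℓ j).1 = (w ℓ j).2)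
  -- Steps R + G: every slot factor is `≤ base' · #(Fin k → Γ)`
  have hslot : (∑ w : Fin (k + 1) → Fin k → Fin n × Bool,
      (∏ ℓ : Fin k, resampleKernel (1 - (1 - ε) ^ (τ ℓ.succ - τ ℓ.castSucc))
          (w ℓ.castSucc) (w ℓ.succ)) *
        @ite ℝ (∀ ℓ : Fin (k + 1), ∃ j : Fin k, Y ℓ (w ℓ j).1 = (w ℓ j).2)
          (Classical.propDecidable _) 1 0) ≤
      (1 - (1 / 2 : ℝ) ^ k * ((∑ ℓ : Fin (k + 1), ((univ.filter fun I : Fin s → Fin n =>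
              ∀ ℓ' : Fin (k + 1), ℓ' < ℓ → ¬ ∀ r, Y ℓ (I r) = Y ℓ' (I r)).card : ℝ)) / (n : ℝ) ^ s - (k : ℝ) * (k + 1) / 2 * (1 / 2 : ℝ) ^ F)) *
        (Fintype.card (Fin k → Fin n × Bool) : ℝ) := by
    refine stub_blockExpansion (B := Fin k) (Γ := Fin n × Bool) k
      (fun ℓ => 1 - (1 - ε) ^ (τ ℓ.succ - τ ℓ.castSucc)) hδ0 hδ1
      (fun w => @ite ℝ (∀ ℓ : Fin (k + 1), ∃ j : Fin k, Y ℓ (w ℓ j).1 = (w ℓ j).2)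
          (Classical.propDecidable _) 1 0)
      (fun w => by positivity) _ (fun ρ hρ1 hρ2 => ?_)
    have hG := stub_slotBound n k s F hn hsF Y ρ hρ1 hρ2
    refine le_trans (le_of_eq ?_) hG
    rw [Finset.natCast_card_filter]
    refine Finset.sum_congr rfl fun u _ => ?_
    simp only []
    congr 1
  -- nonnegativity of the slot factors
  have hslot0 : 0 ≤ (∑ w : Fin (k + 1) → Fin k → Fin n × Bool,
      (∏ ℓ : Fin k, resampleKernel (1 - (1 - ε) ^ (τ ℓ.succ - τ ℓ.castSucc))
          (w ℓ.castSucc) (w ℓ.succ)) *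
        @ite ℝ (∀ ℓ : Fin (k + 1), ∃ j : Fin k, Y ℓ (w ℓ j).1 = (w ℓ j).2)
          (Classical.propDecidable _) 1 0) :=
    Finset.sum_nonneg fun w _ => mul_nonneg
      (Finset.prod_nonneg fun ℓ _ => cmb_kernel_nonneg _ (hδ0 ℓ) (hδ1 ℓ) _ _) (by positivity)
  -- assemble: numerator = product of slot factors ≤ (base' c)^m, denominator = c^m
  have hnum : (∑ x : Fin (k + 1) → Fin m × Fin k → Fin n × Bool,
      (∏ ℓ : Fin k, resampleKernel (1 - (1 - ε) ^ (τ ℓ.succ - τ ℓ.castSucc))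
          (x ℓ.castSucc) (x ℓ.succ)) *
        @ite ℝ (∀ i : Fin m, ∀ ℓ : Fin (k + 1), ∃ j : Fin k, Y ℓ (x ℓ (i, j)).1 = (x ℓ (i, j)).2)
          (Classical.propDecidable _) 1 0) ≤
      ((1 - (1 / 2 : ℝ) ^ k * ((∑ ℓ : Fin (k + 1), ((univ.filter fun I : Fin s → Fin n =>
              ∀ ℓ' : Fin (k + 1), ℓ' < ℓ → ¬ ∀ r, Y ℓ (I r) = Y ℓ' (I r)).card : ℝ)) / (n : ℝ) ^ s - (k : ℝ) * (k + 1) / 2 * (1 / 2 : ℝ) ^ F)) *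
        (Fintype.card (Fin k → Fin n × Bool) : ℝ)) ^ m := by
    calc (∑ x : Fin (k + 1) → Fin m × Fin k → Fin n × Bool,
      (∏ ℓ : Fin k, resampleKernel (1 - (1 - ε) ^ (τ ℓ.succ - τ ℓ.castSucc))
          (x ℓ.castSucc) (x ℓ.succ)) *
        @ite ℝ (∀ i : Fin m, ∀ ℓ : Fin (k + 1), ∃ j : Fin k, Y ℓ (x ℓ (i, j)).1 = (x ℓ (i, j)).2)
          (Classical.propDecidable _) 1 0)
        = _ := Finset.sum_congr rfl fun x _ => by simp only []; congr 1; exact cmb_ite_congr Iff.rfl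
      _ = _ := hF
      _ ≤ ∏ _a : Fin m, ((1 - (1 / 2 : ℝ) ^ k * ((∑ ℓ : Fin (k + 1), ((univ.filter fun I : Fin s → Fin n =>
              ∀ ℓ' : Fin (k + 1), ℓ' < ℓ → ¬ ∀ r, Y ℓ (I r) = Y ℓ' (I r)).card : ℝ)) / (n : ℝ) ^ s - (k : ℝ) * (k + 1) / 2 * (1 / 2 : ℝ) ^ F)) *
        (Fintype.card (Fin k → Fin n × Bool) : ℝ)) :=
          Finset.prod_le_prod (fun _ _ => hslot0) (fun _ _ => hslot)
      _ = _ := by rw [Finset.prod_const, Finset.card_univ, Fintype.card_fin]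
  have hden : (Fintype.card (Fin m × Fin k → Fin n × Bool) : ℝ) = (Fintype.card (Fin k → Fin n × Bool) : ℝ) ^ m :=
    ogp_card_inst m k (Fin n × Bool)
  rw [hden, div_le_iff₀ (pow_pos hcpos m)]
  calc _ ≤ _ := hnum
    _ = (1 - (1 / 2 : ℝ) ^ k * ((∑ ℓ : Fin (k + 1), ((univ.filter fun I : Fin s → Fin n =>
              ∀ ℓ' : Fin (k + 1), ℓ' < ℓ → ¬ ∀ r, Y ℓ (I r) = Y ℓ' (I r)).card : ℝ)) / (n : ℝ) ^ s - (k : ℝ) * (k + 1) / 2 * (1 / 2 : ℝ) ^ F)) ^ m *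
        (Fintype.card (Fin k → Fin n × Bool) : ℝ) ^ m := mul_pow _ _ _
    _ ≤ _ := mul_le_mul_of_nonneg_right (pow_le_pow_left₀ hbase'0 hbase'le m)
        (pow_nonneg hcpos.le m)

/-! ## Huang–Sellke 2025, Lemma 3.22, and the unconditional corollaries -/

/-- **Huang–Sellke 2025, Lemma 3.22 (ensemble OGP for random `k`-SAT on the `ε`-resampling chain)** —
the Literature named fact `HuangSellke2025KSatEnsembleOGP` is a THEOREM: parameters and rate from `stub_ogpAsymptotics`;
eventually in `n` (`D n < n`, so `0 < ε ≤ 1`), the first moment `stub_ogpCore` (fed with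
`stub_chainMassBasic`.1, `stub_chainMassUnion`, the per-tuple bound `ogp_tupleBound` and the count
`stub_bandCount`) is below the asymptotic bound.
[cite: HuangSellke2025, §3.3.2, Lemma 3.22, Lemma 3.23, Cor. 3.21 (Lemma 3.22 (ensemble OGP), Lemma 3.23, Cor. 3.21 assembled)] -/
theorem huangSellke2025KSatEnsembleOGP_holds : HuangSellke2025KSatEnsembleOGP := by
  unfold HuangSellke2025KSatEnsembleOGP
  obtain ⟨k₀, hk₀⟩ := stub_ogpAsymptotics
  refine ⟨max k₀ 1, fun k hk => ?_⟩
  obtain ⟨β, η, θ, s, F, hη, hηβ, hβ5, hθ, hθ1, hb, hsF, hbase, hasy⟩ :=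
    hk₀ k (le_trans (le_max_left _ _) hk)
  refine ⟨β, η, hη, hηβ, hβ5, fun D hD hD1 A => ?_⟩
  obtain ⟨c, hc, hev⟩ := hasy A
  refine ⟨c, hc, ?_⟩
  filter_upwards [hev, cas_eventually_lt D hD, eventually_ge_atTop 1] with n hevn hDn hn1
  intro m hm ε hε K hK
  obtain ⟨hεpos, hε1⟩ : 0 < ε ∧ ε ≤ 1 := by
    rw [hε]; exact cas_eps_bounds n (D n) hDn (hD1 n)
  have hk1 : 1 ≤ k := le_trans (le_max_right _ _) hk
  have hβ0 : 0 ≤ β := by linarith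
  subst hm
  have hcore := stub_ogpCore
    (fun ε h0 h1 K E E' hEE' =>
      (Literature.Computability.Complexity.HuangSellke2025Chain.stub_chainMassBasic ε h0 h1 K).1 E E' hEE')
    (fun ε h0 h1 K E => Literature.Computability.Complexity.HuangSellke2025Chain.stub_chainMassUnion ε h0 h1 K E)
    ogp_tupleBound stub_bandCount
    n ⌊5 * 2 ^ k * Real.log k / k * n⌋₊ k K s F hn1 hk1 hsF ε hεpos.le hε1 β η θ hβ0 hθ hθ1 hb
    hbase
  exact hcore.trans (hevn K hK)

/-- **Huang–Sellke 2025, Lemmas 3.22–3.23 (the resampling-chain obstructions of random `k`-SAT)** —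
the Literature named fact `HuangSellke2025KSatObstructions` is a THEOREM.
[cite: HuangSellke2025, §3.3.2, Lemma 3.22, Lemma 3.23, Cor. 3.21 (Lemma 3.22 (ensemble OGP), Lemma 3.23, Cor. 3.21 assembled)] -/
theorem huangSellke2025KSatObstructions_holds : HuangSellke2025KSatObstructions :=
  huangSellke2025KSatObstructions_of_ensembleOGP huangSellke2025KSatEnsembleOGP_holds

/-- **Huang–Sellke 2025, Corollary 3.21 (strong low-degree hardness of random `k`-SAT,
deterministic saturated form, `κ = 5`)** — the Literature named fact `HuangSellke2025KSat` is a
THEOREM: for `k ≥ k₀`, every sequence of coordinate-degree-`o(n)` maps of linear energy sign-solves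
`F_k(n, ⌊5·2^k log k/k · n⌋)` with probability `→ 0`.
[cite: HuangSellke2025, §3.3.2, Lemma 3.22, Lemma 3.23, Cor. 3.21 (Lemma 3.22 (ensemble OGP), Lemma 3.23, Cor. 3.21 assembled)] -/
theorem huangSellke2025KSat_holds : HuangSellke2025KSat :=
  huangSellke2025KSat_of_ensembleOGP huangSellke2025KSatEnsembleOGP_holds

end Literature.Computability.Complexity.HuangSellke2025Chain

end Part13

/-! ## Part 14 — the EXACT discharges -/

namespace Literature.Computability.Complexity

/-- **The named fact `HuangSellke2025KSatEnsembleOGP` HOLDS** (`RandomKSatEnsembleOGP.lean`; Huang–Sellke 2025 Lemma 3.22, the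
ensemble overlap-gap property of random `k`-SAT on the `ε`-resampling chain).  EXACT-name restatement of
`HuangSellke2025Chain.huangSellke2025KSatEnsembleOGP_holds` (last Part), Literature-side twin of
`Summit.PneNP.PneNP.Theorems.huangSellke2025KSatEnsembleOGP_holds` (same proof). [cite: HuangSellke2025, §3.3.2 Lemma 3.22] -/
theorem HuangSellke2025KSatEnsembleOGP_holds : HuangSellke2025KSatEnsembleOGP :=
  HuangSellke2025Chain.huangSellke2025KSatEnsembleOGP_holds

/-- **The named fact `HuangSellke2025KSatObstructions` HOLDS** (`RandomKSatEnsembleOGP.lean`; Huang–Sellke 2025 Lemmas 3.22–3.23,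
the resampling-chain obstructions).  EXACT-name restatement of `HuangSellke2025Chain.huangSellke2025KSatObstructions_holds`.
[cite: HuangSellke2025, §3.3.2 Lemmas 3.22–3.23] -/
theorem HuangSellke2025KSatObstructions_holds : HuangSellke2025KSatObstructions :=
  HuangSellke2025Chain.huangSellke2025KSatObstructions_holds

/-- **The named fact `HuangSellke2025KSat` HOLDS** (`RandomKSatLowDegreeHardness.lean`; Huang–Sellke 2025 Corollary 3.21, strong
low-degree hardness of random `k`-SAT at clause density `α_k = 5·2^k log k / k`, deterministic saturated form).  EXACT-name restatement
of `HuangSellke2025Chain.huangSellke2025KSat_holds`. [cite: HuangSellke2025, §3.3.2 Cor. 3.21] -/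
theorem HuangSellke2025KSat_holds : HuangSellke2025KSat :=
  HuangSellke2025Chain.huangSellke2025KSat_holds

end Literature.Computability.Complexity

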